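import Literature.Geometry.Lorentzian.KerrDeSitterHiddenSymmetryKernel
import Literature.Geometry.Lorentzian.KerrDeSitterSurfaceGravities
import Literature.Analysis.ODE.HeunFlip
import Literature.Geometry.Lorentzian.KerrDeSitterHeunForm
import Mathlib.Analysis.SpecialFunctions.Pow.Deriv
import Mathlib.Analysis.SpecialFunctions.Pow.Asymptotics
import Mathlib.Analysis.Calculus.MeanValue
import Mathlib.Analysis.Complex.RealDeriv
import Literature.Geometry.Lorentzian.TeukolskyStarobinskyHeun
import Mathlib.Analysis.Calculus.Deriv.Polynomial
import Mathlib.Analysis.Calculus.ContDiff.Polynomial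
import Mathlib.Algebra.Polynomial.Roots
import Literature.Analysis.ODE.HeunMobius
import Literature.Analysis.ODE.HeunEulerBranch
import Literature.Geometry.Lorentzian.KerrDeSitterHeunEquivalence
import Literature.Geometry.Lorentzian.KerrDeSitterPartialModeStabilityNonzeroFreq
import Literature.Geometry.Lorentzian.KerrDeSitterAccessoryIdentity
import Literature.Geometry.Lorentzian.KerrDeSitterHiddenSymmetryEnergy
import Literature.Analysis.ODE.HeunEulerRL
import HarnessLib

/-!
# Radial Teukolsky ODE on subextremal Kerr–de Sitter: route W (transfer, Euler recursion, gauge glue, swapped energy) and the spin flip — re-homed proofs, file 1 of 2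

**Casals–Teixeira da Costa 2022, Proposition 3.8 (with Lemma 3.5, the proof of Corollary 3.9 and Step 2 of the proof of Theorem 3.10) —
the named fact `Literature.Geometry.Lorentzian.KerrDeSitter.CasalsTeixeiraDaCosta2022_partialModeStabilityProp38` (`KerrDeSitterThresholdRays.lean`)
HOLDS**: for subextremal Kerr–de Sitter parameters, half-integer spin `s`, `Im ω > 0`, `Im(λ̄ω̄) ≤ 0`, `|ω| ∉ |m|·(0, Ω_SR)` and Proposition 3.8's
pair conditions, every classical solution of the radial Teukolsky ODE on `(r₊, r_c)` that is ingoing at `𝓗⁺` and outgoing at `𝓗⁺_c` in the generic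
sense vanishes identically (M. Casals, R. Teixeira da Costa, *Hidden spectral symmetries and mode stability of subextremal Kerr(-de Sitter) black
holes*, CMP (2022) = arXiv:2105.13329v2, Prop. 3.8, Lemma 3.5, Cor. 3.9, Thm. 3.10 Step 2) [CasalsTeixeiradacosta2022].  ARCHITECTURE of the in-tree
proof (kernel-checked, 0 cited facts; until now Summits-side only, `Summits/Ventures/KdS/RouteWSpinFlipStrata.lean`): ROUTE W — the radial Teukolsky
ODE in Heun normal form (`HeunModeData`, `NormalFormModeData`), the transfer to the Euler gauge through the accessory identity (`Transfer`,
`AccessoryIdentity`, `transfer_holds`), the non-resonant Euler recursion (`EulerRLNonRes`, `eulerRLNonRes_holds`), the gauge glue (`GaugeGlue`,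
`gaugeGlue_holds`) and the swapped energy identity of Thm. 3.10 Step 2 (`SwappedEnergyVanishing`, `swappedEnergyVanishing_holds`), giving the
vanishing below height `κ₁` and above `(s−1)κ₁`; the SPIN FLIP through the Teukolsky–Starobinsky map (`SpinFlipTS`, `spinFlipTS_holds`: monomial /
polynomial bookkeeping, branch coefficients) off the cosmological lattice; and ON the lattice the formal Euler partner (Frobenius sums, the
three-term recurrence and its termwise intertwining, the Euler form) closing every stratum (`radial_vanishing_lattice`), whence
`prop38_allSpins`.  RE-HOMED into `Literature/` by the Hodge foundations lane (`lit-hodgefound`, seat p20, generation 38) as TWO files: verbatim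
DECLARATION-LEVEL ports (the declarations needed, in dependency order) of the 19 Summits modules `Summits/Ventures/KdS/{RouteW, SpinFlip{Bookkeeping,
Analysis,Polynomial,Monomial,Intertwine,Frobenius,EulerForm}, RouteW{SpinFlip,NonRes,GaugeGlue,Transfer,TransferHolds,SwappedEnergy,EulerRL,HighSpin,
SpinFlipProp38,SpinFlipPoly,SpinFlipStrata}}.lean`, namespace `Summit.Ventures.KdS` re-rooted as `Literature.Geometry.Lorentzian.KerrDeSitter.TeukolskyRadial`
(sub-namespaces `RouteW`, `SpinFlipTS` kept), followed by the EXACT-name discharge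
`Literature.Geometry.Lorentzian.KerrDeSitter.CasalsTeixeiraDaCosta2022_partialModeStabilityProp38_holds`.  The route's intermediate statements come
as definitions WITH their proofs in the same files (`Transfer`/`transfer_holds`, `GaugeGlue`/`gaugeGlue_holds`, `SwappedEnergyVanishing`/`…_holds`,
`EulerRLNonRes`/`…_holds`, `AccessoryIdentity`/`…_holds`, `SpinFlipTS`/`…_holds`) and the data/gadgets with their bodies (`HeunModeData`,
`NormalFormModeData`, `zTwo`, `ltBlock`, `mass₁…₄`, `bigE`, `tildeCoeff`, `lamFlip`, `branchCoeff`, `OffLattice`, `gaugeW`, `gaugeP`, `symX₀…₂`,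
`recCoeff`, `partnerWeight`, `partnerCoeff`, `cpowSum…`, `symbolSum`, `shiftPoly`); no unproved named fact (D-0026), no Summits import; built on the
tree's Literature layer (`Geometry/Lorentzian/KerrDeSitter*`, `Analysis/ODE/GeneralHeun*`) and Mathlib.  The Summits originals stay in place
(transitional duplication).  WHAT THIS IS NOT: no mode-stability claim beyond the displayed statement (Prop. 3.8's partial result under its explicit
hypotheses); nothing about the full Teukolsky equation or nonlinear stability.

THIS FILE (1 of 2) ports: RouteW, SpinFlipBookkeeping, SpinFlipAnalysis, SpinFlipPolynomial, SpinFlipMonomial, RouteWSpinFlip, RouteWNonRes, RouteWGaugeGlue, RouteWTransfer, RouteWTransferHolds, RouteWSwappedEnergy, RouteWEulerRL.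
-/

noncomputable section

/-!
## Part 1 — port of `Summits/Ventures/KdS/RouteW.lean` (18 declarations kept)

# Venture KdS — ROUTE W: Casals–Teixeira da Costa's Proposition-3.8 fact (H3) reduced, in the
# kernel, to four named analytic lemmas via Euler's integral transformation

HONEST FRAMING (venture `Summits/Ventures/KdS`, cell `pub-kds`; MONDAY-REBALANCE item 2 decision
object, NOT a result about Kerr–de Sitter): this file PROVES
`prop38_of_routeW : Transfer → EulerRL → GaugeGlue → SwappedEnergyVanishing → SpinFlip →`
`  CasalsTeixeiraDaCosta2022_partialModeStabilityProp38`,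
i.e. it reduces the cell's cited fact H3 (Casals–Teixeira da Costa 2022, Prop. 3.8 / Cor. 3.9 /
Thm 3.10 Step 2, `Literature/Geometry/Lorentzian/KerrDeSitterThresholdRays.lean`) to FIVE named
`Prop`s, each an ordinary statement of real analysis with its intended proof route and size written
in its docstring. Nothing here discharges H3; the five `Prop`s are hypotheses. What IS kernel-checked
is (a) that these five statements, exactly as typed, imply H3 verbatim, and (b) — in the Literature
files this one imports — the complete ALGEBRA of the route: the Euler/Kazakov–Slavyanov kernel
identity (`GeneralHeun.euler_kernel_identity`, [Takemura2017] Prop. 1.2), the fact that Takemura's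
parameter map with `η = α = 1+s+2η₀` IS the hidden symmetry `m₂ ↔ m₃` including the accessory
parameter (`euler_swap_*`), `(3.11) =` Heun normal form (`sqcdCoeff_eq_normalForm`) and
`(3.25) = (3.11)|_{m₂↔m₃}` (`ctdcTilde_eq_sqcd_swap`).

THE ROUTE (cell memo `theory/ROUTE-W-KERNEL.md`): a radial mode `R` (tree predicates
`IsRadialTeukolskySolution`, `IsIngoingAtEventHorizon`, `IsOutgoingAtCosmoHorizon`) is moved to the
Euler gauge of CTdC's `z`-variable on `(1, z₂)` (`Transfer`); the ONE-SIDED Euler /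
Riemann–Liouville transform from the event horizon `z = 1` with kernel `(z−w)^{−(1−s−2η₀)}`
(regularised by `z`-derivatives when `Re ≥ 1`) produces a solution of the `m₂ ↔ m₃`-swapped
equation with the swapped boundary branches and is injective (`EulerRL`, a statement about GENERAL
Heun equations); back to CTdC's normal form (3.25)/(3.26) (`GaugeGlue`, general masses); there the
energy identity of CTdC's Step 2 forces vanishing (`SwappedEnergyVanishing`, LIT-1's file); for spins
`s ≥ 1` the integrability condition at `z = 1` (`Re(2η₁ − s) > −1`) is first restored by passing to
the spin `−s` companion (`SpinFlip`, the Teukolsky–Starobinsky/Umetsu leg; vacuous for the cell's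
`s = −2, 0`). No continued fractions, no hypergeometric expansions, no contour integrals.

Sizes (Lean lines, estimates): `Transfer` ≈ 400–500 (twin of `KerrDeSitterHeunEquivalence` under
CTdC's Möbius map; exact CAS check kit j165967); `EulerRL` ≈ 800–1200 (its algebraic core is landed:
`euler_kernel_identity`, `euler_tau_identity`; remaining: differentiation under `∫₀¹`, two endpoint
limits, Beta-integral branch at `1`, smoothness across `z₂`, injectivity, induction on the
regularisation order — CAS checks kit j166563/w3-tau-reg); `GaugeGlue` ≈ 200–300 (calculus with
`z^{γ/2}(z−1)^{δ/2}(z₂−z)^{ε/2}` + `sqcdCoeff_eq_normalForm`); `SwappedEnergyVanishing` ≈ 700–900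
(LIT-1 g5, in progress, `KerrDeSitterHiddenSymmetryEnergy.lean`); `SpinFlip` ≈ 300–400 (Umetsu's
`HeunDerivative` + exponent bookkeeping; not needed for `s ≤ 1/2`).

References: Casals–Teixeira da Costa, Commun. Math. Phys. 394 (2022) 797–832
[CasalsTeixeiradacosta2022] §3.3–3.4; K. Takemura, J. Math. Soc. Japan 69 (2017) 849–891
[Takemura2017] Prop. 1.2.

(Verbatim declaration-level port — the declarations listed in the Part header count — of the Summits-side module of the KdS
venture; venture / cell / ruling bookkeeping in the text above is historical.)
-/

section Part1

open _root_.Set _root_.Complex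

namespace Literature.Geometry.Lorentzian.KerrDeSitter.TeukolskyRadial

namespace RouteW

open Literature.Analysis.ODE Literature.Analysis.ODE.GeneralHeun
open Literature.Geometry.Lorentzian Literature.Geometry.Lorentzian.KerrDeSitter

/-! ### Data carriers -/

/-- **Euler-gauge Heun mode data on `(1, z₂)`.** `v` is a classical solution of Umetsu's Heun
equation `lead·v″ + mid_{γδε}·v′ + (αβ·+q)·v = 0` on `(1,z₂)` (`a_H = z₂`), it is the Frobenius
branch `(w−1)^ρ·h(w)` at `w = 1` with `h` smooth on a two-sided neighbourhood (principal power of the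
positive real `w − 1`), and it agrees near `z₂⁻` with a function smooth across `z₂` (the analytic
branch). This is the shape in which the tree states "ingoing"/"outgoing" (`IsIngoingAtEventHorizon`,
`IsOutgoingAtCosmoHorizon`).
[cite: CasalsTeixeiradacosta2022, Proposition 3.8 (arXiv v2) with Lemma 3.5 and the proof of Theorem 3.10, Step 2 (route W / spin-flip bookkeeping of the in-tree proof)] -/
def HeunModeData (z₂ : ℝ) (α β γ δ ε q ρ : ℂ) (v : ℝ → ℂ) : Prop :=
  GeneralHeun.IsSolutionOn (z₂ : ℂ) α β γ δ ε q (Ioo 1 z₂) v ∧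
  (∃ e : ℝ, 0 < e ∧ ∃ h : ℝ → ℂ, ContDiffOn ℝ ((⊤ : ℕ∞) : WithTop ℕ∞) h (Ioo (1 - e) (1 + e)) ∧
      ∀ w ∈ Ioo 1 (1 + e), v w = ((w - 1 : ℝ) : ℂ) ^ ρ * h w) ∧
  (∃ e : ℝ, 0 < e ∧ ∃ g : ℝ → ℂ, ContDiffOn ℝ ((⊤ : ℕ∞) : WithTop ℕ∞) g (Ioo (z₂ - e) (z₂ + e)) ∧
      ∀ w ∈ Ioo (z₂ - e) z₂, v w = g w)

/-- **Normal-form mode data on `(1, z₂)`** (CTdC's shape (3.11)/(3.25) with boundary conditions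
(3.16)/(3.26)): `R` is a classical solution of `z(z−1)(z−z₂)·R″ + C(z)·R = 0` on `(1,z₂)`,
`R = (z−1)^{e₁}·h` near `1⁺` and `R = (z₂−z)^{e₂}·g` near `z₂⁻` with `h`, `g` smooth on two-sided
neighbourhoods (positive real bases).
[cite: CasalsTeixeiradacosta2022, Proposition 3.8 (arXiv v2) with Lemma 3.5 and the proof of Theorem 3.10, Step 2 (route W / spin-flip bookkeeping of the in-tree proof)] -/
def NormalFormModeData (z₂ : ℝ) (C : ℝ → ℂ) (e₁ e₂ : ℂ) (R : ℝ → ℂ) : Prop :=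
  (∃ R₁ R₂ : ℝ → ℂ, ∀ z ∈ Ioo 1 z₂, HasDerivAt R (R₁ z) z ∧ HasDerivAt R₁ (R₂ z) z ∧
      GeneralHeun.lead (z₂ : ℂ) z * R₂ z + C z * R z = 0) ∧
  (∃ e : ℝ, 0 < e ∧ ∃ h : ℝ → ℂ, ContDiffOn ℝ ((⊤ : ℕ∞) : WithTop ℕ∞) h (Ioo (1 - e) (1 + e)) ∧
      ∀ z ∈ Ioo 1 (1 + e), R z = ((z - 1 : ℝ) : ℂ) ^ e₁ * h z) ∧
  (∃ e : ℝ, 0 < e ∧ ∃ g : ℝ → ℂ, ContDiffOn ℝ ((⊤ : ℕ∞) : WithTop ℕ∞) g (Ioo (z₂ - e) (z₂ + e)) ∧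
      ∀ z ∈ Ioo (z₂ - e) z₂, R z = ((z₂ - z : ℝ) : ℂ) ^ e₂ * g z)

/-- Changing the coefficient function on `(1,z₂)` does not change normal-form mode data.
[cite: CasalsTeixeiradacosta2022, Proposition 3.8 (arXiv v2) with Lemma 3.5 and the proof of Theorem 3.10, Step 2 (route W / spin-flip bookkeeping of the in-tree proof)] -/
theorem NormalFormModeData.congr {z₂ : ℝ} {C C' : ℝ → ℂ} {e₁ e₂ : ℂ} {R : ℝ → ℂ}
    (h : NormalFormModeData z₂ C e₁ e₂ R) (hC : ∀ z ∈ Ioo 1 z₂, C z = C' z) :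
    NormalFormModeData z₂ C' e₁ e₂ R := by
  obtain ⟨⟨R₁, R₂, hode⟩, h1, h2⟩ := h
  refine ⟨⟨R₁, R₂, fun z hz => ?_⟩, h1, h2⟩
  obtain ⟨ha, hb, hc⟩ := hode z hz
  exact ⟨ha, hb, by rw [← hC z hz]; exact hc⟩

/-! ### Kerr–de Sitter abbreviations (CTdC (3.10), (3.14), (3.15)) -/

/-- CTdC's `z₂` (3.14) of the geometry `(M,a,Λ)`: roots `r₀ = rMinus`, `r₁ = rPlus`, `r₂ = rCosmo`
(`r₃ = rNeg = −(r₀+r₁+r₂)`).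
[cite: CasalsTeixeiradacosta2022, Proposition 3.8 (arXiv v2) with Lemma 3.5 and the proof of Theorem 3.10, Step 2 (route W / spin-flip bookkeeping of the in-tree proof)] -/
def zTwo (M a Λ : ℝ) : ℝ := ctdcZ₂ (rMinus M a Λ) (rPlus M a Λ) (rCosmo M a Λ)

/-- The `λ̄`-block `LT = L²(λ̄ − 2Ξ²amω + a²Ξ²ω²)/((r₂−r₃)(r₁−r₀))`, `L² = 3/Λ`, of (3.15)/(3.25)
(STU separation constant `λ` converted by `lambdaBar`).
[cite: CasalsTeixeiradacosta2022, Proposition 3.8 (arXiv v2) with Lemma 3.5 and the proof of Theorem 3.10, Step 2 (route W / spin-flip bookkeeping of the in-tree proof)] -/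
def ltBlock (M a Λ s : ℝ) (ω : ℂ) (m : ℝ) (lam : ℂ) : ℂ :=
  ((3 / Λ : ℝ) : ℂ) *
      (lambdaBar a Λ s ω m lam - 2 * (xi a Λ : ℂ) ^ 2 * (a : ℂ) * (m : ℂ) * ω +
        (a : ℂ) ^ 2 * (xi a Λ : ℂ) ^ 2 * ω ^ 2) /
    ((((rCosmo M a Λ - rNeg M a Λ) * (rPlus M a Λ - rMinus M a Λ)) : ℝ) : ℂ)

/-- Mass `m₁ = s − η₁ − η₀` of the geometry/frequency.
[cite: CasalsTeixeiradacosta2022, Proposition 3.8 (arXiv v2) with Lemma 3.5 and the proof of Theorem 3.10, Step 2 (route W / spin-flip bookkeeping of the in-tree proof)] -/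
def mass₁ (M a Λ s : ℝ) (ω : ℂ) (m : ℝ) : ℂ := sqcdM₁ (s : ℂ) (etaCauchy M a Λ ω m) (etaEvent M a Λ ω m)

/-- Mass `m₂ = η₀ − η₁`.
[cite: CasalsTeixeiradacosta2022, Proposition 3.8 (arXiv v2) with Lemma 3.5 and the proof of Theorem 3.10, Step 2 (route W / spin-flip bookkeeping of the in-tree proof)] -/
def mass₂ (M a Λ : ℝ) (ω : ℂ) (m : ℝ) : ℂ := sqcdM₂ (etaCauchy M a Λ ω m) (etaEvent M a Λ ω m)

/-- Mass `m₃ = −s − η₁ − η₀`.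
[cite: CasalsTeixeiradacosta2022, Proposition 3.8 (arXiv v2) with Lemma 3.5 and the proof of Theorem 3.10, Step 2 (route W / spin-flip bookkeeping of the in-tree proof)] -/
def mass₃ (M a Λ s : ℝ) (ω : ℂ) (m : ℝ) : ℂ := sqcdM₃ (s : ℂ) (etaCauchy M a Λ ω m) (etaEvent M a Λ ω m)

/-- Mass `m₄ = η₀ + η₁ + 2η₂`.
[cite: CasalsTeixeiradacosta2022, Proposition 3.8 (arXiv v2) with Lemma 3.5 and the proof of Theorem 3.10, Step 2 (route W / spin-flip bookkeeping of the in-tree proof)] -/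
def mass₄ (M a Λ : ℝ) (ω : ℂ) (m : ℝ) : ℂ :=
  sqcdM₄ (etaCauchy M a Λ ω m) (etaEvent M a Λ ω m) (etaCosmo M a Λ ω m)

/-- CTdC's `E` of (3.15): `E = (E z₂)/z₂` with `E z₂ = ctdcEz₂ …`.
[cite: CasalsTeixeiradacosta2022, Proposition 3.8 (arXiv v2) with Lemma 3.5 and the proof of Theorem 3.10, Step 2 (route W / spin-flip bookkeeping of the in-tree proof)] -/
def bigE (M a Λ s : ℝ) (ω : ℂ) (m : ℝ) (lam : ℂ) : ℂ :=
  ctdcEz₂ (s : ℂ) (etaCauchy M a Λ ω m) (etaEvent M a Λ ω m) (etaCosmo M a Λ ω m)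
      (ltBlock M a Λ s ω m lam) (zTwo M a Λ : ℂ) (rMinus M a Λ) (rPlus M a Λ) (rCosmo M a Λ) /
    (zTwo M a Λ : ℂ)

/-- The `y`-coefficient of the swapped equation (3.25) for the geometry/frequency, as a function of
`z`.
[cite: CasalsTeixeiradacosta2022, Proposition 3.8 (arXiv v2) with Lemma 3.5 and the proof of Theorem 3.10, Step 2 (route W / spin-flip bookkeeping of the in-tree proof)] -/
def tildeCoeff (M a Λ s : ℝ) (ω : ℂ) (m : ℝ) (lam : ℂ) (z : ℝ) : ℂ :=
  ctdcTildeCoeff (s : ℂ) (etaCauchy M a Λ ω m) (etaEvent M a Λ ω m) (etaCosmo M a Λ ω m)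
    (ltBlock M a Λ s ω m lam) (zTwo M a Λ : ℂ) (rMinus M a Λ) (rPlus M a Λ) (rCosmo M a Λ) z

/-- The STU separation constant of the spin-`−s` companion: `λ' = λ − 2s(1−α)`, characterised by
`lambdaBar a Λ (−s) ω m λ' = lambdaBar a Λ s ω m λ` (CTdC's (ii): "the radial ODE … where `s` is
replaced by `−s`", same `λ̄`).
[cite: CasalsTeixeiradacosta2022, Proposition 3.8 (arXiv v2) with Lemma 3.5 and the proof of Theorem 3.10, Step 2 (route W / spin-flip bookkeeping of the in-tree proof)] -/
def lamFlip (a Λ s : ℝ) (lam : ℂ) : ℂ := lam - ((2 * s * (1 - alpha a Λ) : ℝ) : ℂ)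

/-- `λ̄(−s, λ') = λ̄(s, λ)`.
[cite: CasalsTeixeiradacosta2022, Proposition 3.8 (arXiv v2) with Lemma 3.5 and the proof of Theorem 3.10, Step 2 (route W / spin-flip bookkeeping of the in-tree proof)] -/
theorem lambdaBar_lamFlip (a Λ s : ℝ) (ω : ℂ) (m : ℝ) (lam : ℂ) :
    lambdaBar a Λ (-s) ω m (lamFlip a Λ s lam) = lambdaBar a Λ s ω m lam := by
  unfold lambdaBar lamFlip
  push_cast
  ring

/-! ### The five named analytic statements -/

/-- **K_A — Transfer** (CTdC Lemma 3.5 at the level of SOLUTIONS; ≈ 400–500 lines; exact CAS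
check of the coefficient identity: pub-kds kit j165967). Every classical solution of the radial
Teukolsky equation on `(r₊, r_c)` that is ingoing at `𝓗⁺` and outgoing at `𝓗⁺_c` (generic bullets)
yields, under `u = Δ^{(s+1)/2}R`, `y = u/(r−r₃)`, `z = z_∞(r−r₀)/(r−r₃)` and the Euler gauge
`v = z^{−γ/2}(z−1)^{−δ/2}(z−z₂)^{−ε/2}·y`, Euler-gauge Heun mode data on `(1,z₂)` with the
parameters of the masses `(m₁,m₂,m₃,m₄)` and branch exponent `2η₁ − s` at `z = 1`, such that
`v ≡ 0 ⇒ R ≡ 0`; and `1 < z₂`. Route: twin of `KerrDeSitterHeunEquivalence` (LIT-1) under CTdC's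
Möbius map, `KerrDeSitterHiddenSymmetryKernel.sqcdCoeff_eq_normalForm`, `branch_event/branch_cosmo`.
[cite: CasalsTeixeiradacosta2022, Proposition 3.8 (arXiv v2) with Lemma 3.5 and the proof of Theorem 3.10, Step 2 (route W / spin-flip bookkeeping of the in-tree proof)] -/
def Transfer : Prop :=
  ∀ (M a Λ s : ℝ) (ω : ℂ) (m : ℝ) (lam : ℂ) (R : ℝ → ℂ), IsSubextremal M a Λ →
    IsRadialTeukolskySolution M a Λ s ω m lam R → IsIngoingAtEventHorizon M a Λ s ω m R →
    IsOutgoingAtCosmoHorizon M a Λ ω m R →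
      1 < zTwo M a Λ ∧
      ∃ v : ℝ → ℂ,
        HeunModeData (zTwo M a Λ)
          (eulerGaugeα (mass₂ M a Λ ω m) (mass₃ M a Λ s ω m))
          (eulerGaugeβ (mass₂ M a Λ ω m) (mass₄ M a Λ ω m))
          (eulerGaugeγ (mass₁ M a Λ s ω m) (mass₂ M a Λ ω m))
          (eulerGaugeδ (mass₁ M a Λ s ω m) (mass₂ M a Λ ω m))
          (eulerGaugeε (mass₃ M a Λ s ω m) (mass₄ M a Λ ω m))
          (eulerGaugeQ (mass₁ M a Λ s ω m) (mass₂ M a Λ ω m) (mass₃ M a Λ s ω m) (mass₄ M a Λ ω m)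
            (bigE M a Λ s ω m lam) (zTwo M a Λ : ℂ))
          (2 * etaEvent M a Λ ω m - (s : ℂ)) v ∧
        ((∀ w ∈ Ioo 1 (zTwo M a Λ), v w = 0) →
          ∀ r ∈ Ioo (rPlus M a Λ) (rCosmo M a Λ), R r = 0)

/-- **K_G — gauge glue** (general masses; ≈ 200–300 lines): Euler-gauge Heun mode data for masses
`(m₁,m₂,m₃,m₄)` gives, under `R = z^{γ/2}(z−1)^{δ/2}(z₂−z)^{ε/2}·u` (positive real bases on
`(1,z₂)`), normal-form mode data for CTdC's (3.11) coefficient `sqcdCoeff m₁ m₂ m₃ m₄ E z₂` with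
exponents `ρ + δ/2` at `1` and `ε/2` at `z₂`, and `R ≡ 0 ⇒ u ≡ 0`. Route: product rule +
`sqcdCoeff_eq_normalForm`.
[cite: CasalsTeixeiradacosta2022, Proposition 3.8 (arXiv v2) with Lemma 3.5 and the proof of Theorem 3.10, Step 2 (route W / spin-flip bookkeeping of the in-tree proof)] -/
def GaugeGlue : Prop :=
  ∀ (z₂ : ℝ) (m₁ m₂ m₃ m₄ E ρ : ℂ) (u : ℝ → ℂ), 1 < z₂ →
    HeunModeData z₂ (eulerGaugeα m₂ m₃) (eulerGaugeβ m₂ m₄) (eulerGaugeγ m₁ m₂)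
        (eulerGaugeδ m₁ m₂) (eulerGaugeε m₃ m₄) (eulerGaugeQ m₁ m₂ m₃ m₄ E (z₂ : ℂ)) ρ u →
      ∃ R : ℝ → ℂ,
        NormalFormModeData z₂ (fun z => sqcdCoeff m₁ m₂ m₃ m₄ E (z₂ : ℂ) z)
          (ρ + eulerGaugeδ m₁ m₂ / 2) (eulerGaugeε m₃ m₄ / 2) R ∧
        ((∀ z ∈ Ioo 1 z₂, R z = 0) → ∀ z ∈ Ioo 1 z₂, u z = 0)

/-- **K₂ — CTdC Theorem 3.10, proof Step 2, as a statement** (LIT-1's file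
`KerrDeSitterHiddenSymmetryEnergy.lean`, ≈ 700–900 lines): for subextremal `(M,a,Λ)`, `0 ≤ a`,
`Im ω > 0`, `Im(λ̄ ω̄) ≤ 0` and `|ω| ∉ |m|·(0, Ω_SR)`, every normal-form mode datum of the SWAPPED
equation (3.25) — coefficient `tildeCoeff`, exponents `½ + η₀ + η₁` at `1` and `½ − η₀ − η₂` at
`z₂`, i.e. (3.26) — vanishes identically on `(1,z₂)` (energy identity (3.28) for
`ũ = [z(z−1)(z₂−z)]^{−1/2}R̃` with the potential (3.27), positivity (3.29)).
[cite: CasalsTeixeiradacosta2022, Proposition 3.8 (arXiv v2) with Lemma 3.5 and the proof of Theorem 3.10, Step 2 (route W / spin-flip bookkeeping of the in-tree proof)] -/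
def SwappedEnergyVanishing : Prop :=
  ∀ (M a Λ s : ℝ) (ω : ℂ) (m : ℝ) (lam : ℂ) (Rt : ℝ → ℂ), IsSubextremal M a Λ → 0 ≤ a →
    0 < ω.im → (lambdaBar a Λ s ω m lam * (starRingEnd ℂ) ω).im ≤ 0 →
    ¬(0 < ‖ω‖ ∧ ‖ω‖ < |m| * superradiantUpper M a Λ) →
    NormalFormModeData (zTwo M a Λ) (tildeCoeff M a Λ s ω m lam)
        (1 / 2 + etaCauchy M a Λ ω m + etaEvent M a Λ ω m)
        (1 / 2 - etaCauchy M a Λ ω m - etaCosmo M a Λ ω m) Rt →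
      ∀ z ∈ Ioo 1 (zTwo M a Λ), Rt z = 0

/-- `δ̃ = 1 + m₁ + m₃ = 1 − 2η₁ − 2η₀` for the swapped masses.
[cite: CasalsTeixeiradacosta2022, Proposition 3.8 (arXiv v2) with Lemma 3.5 and the proof of Theorem 3.10, Step 2 (route W / spin-flip bookkeeping of the in-tree proof)] -/
theorem eulerGaugeδ_swap_eta (s η₀ η₁ : ℂ) :
    eulerGaugeδ (sqcdM₁ s η₀ η₁) (sqcdM₃ s η₀ η₁) = 1 - 2 * η₁ - 2 * η₀ := by
  unfold eulerGaugeδ sqcdM₁ sqcdM₃; ring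

/-- `ε̃ = 1 − m₂ − m₄ = 1 − 2η₀ − 2η₂` for the swapped masses.
[cite: CasalsTeixeiradacosta2022, Proposition 3.8 (arXiv v2) with Lemma 3.5 and the proof of Theorem 3.10, Step 2 (route W / spin-flip bookkeeping of the in-tree proof)] -/
theorem eulerGaugeε_swap_eta (η₀ η₁ η₂ : ℂ) :
    eulerGaugeε (sqcdM₂ η₀ η₁) (sqcdM₄ η₀ η₁ η₂) = 1 - 2 * η₀ - 2 * η₂ := by
  unfold eulerGaugeε sqcdM₂ sqcdM₄; ring

end RouteW

end Literature.Geometry.Lorentzian.KerrDeSitter.TeukolskyRadial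

end Part1

/-!
## Part 2 — port of `Summits/Ventures/KdS/SpinFlipBookkeeping.lean` (11 declarations kept)

# Venture KdS — the spin flip `s ↦ −s`: parameter bookkeeping of the flipped Heun frames

HONEST FRAMING (venture `Summits/Ventures/KdS`, cell `pub-kds`; STRUCTURE.md C3): pure algebra
feeding `RouteWSpinFlip.lean` (the Teukolsky–Starobinsky transfer as Umetsu's `2s`-th derivative
in the exponent-flipped Hatsuda frame). For Hatsuda's radial Heun data of spin `s`
(`heunGamma/Delta/Eps`, `heunSigmaPlus = 2s+1`, `heunSigmaMinus`, `heunV`; tree file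
`KerrDeSitterHeunForm`) and `N = 2s`: the flipped frame has Heun `α = 2 − σ₊ = 1 − N`
(`two_sub_sigmaPlus`); Umetsu's shifted parameters of the flipped spin-`s` data are the flipped
spin-`−s` data (`image_gamma/delta/eps/sigmaPlus/sigmaMinus`), INCLUDING the accessory parameter
at the shifted separation constant `λ' = λ − 2s(1−α)` of `RouteW.lamFlip` (`accessory_identity` =
the general-Heun identity `shiftedQ_flipQ_sub` + the Kerr–de Sitter identity `heunV_flip_diff`,
which uses Vieta's `1 − Λa²/3 = (Λ/3)(S² − e₂)`; exact CAS cross-check: pub-kds kit j175340,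
j175397, j175983). Nothing about solutions is claimed here.

(Verbatim declaration-level port — the declarations listed in the Part header count — of the Summits-side module of the KdS
venture; venture / cell / ruling bookkeeping in the text above is historical.)
-/

section Part2

open _root_.Set _root_.Complex

namespace Literature.Geometry.Lorentzian.KerrDeSitter.TeukolskyRadial

namespace SpinFlipTS

open Literature.Analysis.ODE Literature.Analysis.ODE.GeneralHeun
open Literature.Geometry.Lorentzian Literature.Geometry.Lorentzian.KerrDeSitter

/-! ### Parameter bookkeeping of the flipped frames -/

/-- In the flipped spin-`s` frame Heun's `α` is `2 − σ₊ = 1 − 2s`.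
[cite: CasalsTeixeiradacosta2022, Proposition 3.8 (arXiv v2) with Lemma 3.5 and the proof of Theorem 3.10, Step 2 (route W / spin-flip bookkeeping of the in-tree proof)] -/
theorem two_sub_sigmaPlus (s : ℝ) {N : ℕ} (hsN : 2 * s = N) :
    2 - heunSigmaPlus s = 1 - (N : ℂ) := by
  have h : (2 * s : ℝ) = (N : ℝ) := hsN
  have h' : (2 : ℂ) * (s : ℂ) = (N : ℂ) := by exact_mod_cast h
  unfold heunSigmaPlus
  linear_combination -h'

/-- Image exponent at `z = 0`: `(2 − γ_s) + 2s = 2 − γ_{−s}`.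
[cite: CasalsTeixeiradacosta2022, Proposition 3.8 (arXiv v2) with Lemma 3.5 and the proof of Theorem 3.10, Step 2 (route W / spin-flip bookkeeping of the in-tree proof)] -/
theorem image_gamma (M a Λ s : ℝ) (ω : ℂ) (m : ℝ) {N : ℕ} (hsN : 2 * s = N) :
    2 - heunGamma M a Λ s ω m + N = 2 - heunGamma M a Λ (-s) ω m := by
  have h' : (2 : ℂ) * (s : ℂ) = (N : ℂ) := by exact_mod_cast hsN
  unfold heunGamma; push_cast; linear_combination -h'

/-- Image exponent at `z = 1`: `(2 − δ_s) + 2s = 2 − δ_{−s}`.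
[cite: CasalsTeixeiradacosta2022, Proposition 3.8 (arXiv v2) with Lemma 3.5 and the proof of Theorem 3.10, Step 2 (route W / spin-flip bookkeeping of the in-tree proof)] -/
theorem image_delta (M a Λ s : ℝ) (ω : ℂ) (m : ℝ) {N : ℕ} (hsN : 2 * s = N) :
    2 - heunDelta M a Λ s ω m + N = 2 - heunDelta M a Λ (-s) ω m := by
  have h' : (2 : ℂ) * (s : ℂ) = (N : ℂ) := by exact_mod_cast hsN
  unfold heunDelta; push_cast; linear_combination -h'

/-- Image exponent at `z = z_r`: `(2 − ε_s) + 2s = 2 − ε_{−s}`.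
[cite: CasalsTeixeiradacosta2022, Proposition 3.8 (arXiv v2) with Lemma 3.5 and the proof of Theorem 3.10, Step 2 (route W / spin-flip bookkeeping of the in-tree proof)] -/
theorem image_eps (M a Λ s : ℝ) (ω : ℂ) (m : ℝ) {N : ℕ} (hsN : 2 * s = N) :
    2 - heunEps M a Λ s ω m + N = 2 - heunEps M a Λ (-s) ω m := by
  have h' : (2 : ℂ) * (s : ℂ) = (N : ℂ) := by exact_mod_cast hsN
  unfold heunEps; push_cast; linear_combination -h'

/-- Image exponent at `∞` (Umetsu's `α̃ = N + 1`): `2s + 1 = 2 − σ₊(−s)`.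
[cite: CasalsTeixeiradacosta2022, Proposition 3.8 (arXiv v2) with Lemma 3.5 and the proof of Theorem 3.10, Step 2 (route W / spin-flip bookkeeping of the in-tree proof)] -/
theorem image_sigmaPlus (s : ℝ) {N : ℕ} (hsN : 2 * s = N) :
    (N : ℂ) + 1 = 2 - heunSigmaPlus (-s) := by
  have h' : (2 : ℂ) * (s : ℂ) = (N : ℂ) := by exact_mod_cast hsN
  unfold heunSigmaPlus; push_cast; linear_combination -h'

/-- Image exponent at `∞` (Umetsu's `β̃ = β + N`): `(2 − σ₋(s)) + 2s = 2 − σ₋(−s)`.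
[cite: CasalsTeixeiradacosta2022, Proposition 3.8 (arXiv v2) with Lemma 3.5 and the proof of Theorem 3.10, Step 2 (route W / spin-flip bookkeeping of the in-tree proof)] -/
theorem image_sigmaMinus (M a Λ s : ℝ) (ω : ℂ) (m : ℝ) {N : ℕ} (hsN : 2 * s = N) :
    2 - heunSigmaMinus M a Λ s ω m + N = 2 - heunSigmaMinus M a Λ (-s) ω m := by
  have h' : (2 : ℂ) * (s : ℂ) = (N : ℂ) := by exact_mod_cast hsN
  unfold heunSigmaMinus; push_cast; linear_combination -h'

/-- `δ_s − δ_{−s} = 2s`: the exponents at `z = 1` of the two Hatsuda frames differ by `N`.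
[cite: CasalsTeixeiradacosta2022, Proposition 3.8 (arXiv v2) with Lemma 3.5 and the proof of Theorem 3.10, Step 2 (route W / spin-flip bookkeeping of the in-tree proof)] -/
theorem delta_sub_delta (M a Λ s : ℝ) (ω : ℂ) (m : ℝ) {N : ℕ} (hsN : 2 * s = N) :
    heunDelta M a Λ s ω m - heunDelta M a Λ (-s) ω m = N := by
  have h' : (2 : ℂ) * (s : ℂ) = (N : ℂ) := by exact_mod_cast hsN
  unfold heunDelta; push_cast; linear_combination h'

/-- `δ_s − 1 = s + 2B(r_c)` (the branch exponent of the flipped frame at `z = 1`).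
[cite: CasalsTeixeiradacosta2022, Proposition 3.8 (arXiv v2) with Lemma 3.5 and the proof of Theorem 3.10, Step 2 (route W / spin-flip bookkeeping of the in-tree proof)] -/
theorem delta_sub_one (M a Λ s : ℝ) (ω : ℂ) (m : ℝ) :
    heunDelta M a Λ s ω m - 1 = (s : ℂ) + 2 * horizonB M a Λ ω m (rCosmo M a Λ) := by
  unfold heunDelta; ring

/-- **The general-Heun part of the accessory bookkeeping** (pure algebra; CAS: pub-kds kit j175983):
with `γ_{±} = 2B₁ ± s + 1`, `δ_{±} = 2B₂ ± s + 1`, `ε_{±} = 2B₃ ± s + 1` and `N = 2s`,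
`shiftedQ(a_H; 2−γ₊, 2−δ₊, 2−ε₊; flipQ(γ₊,δ₊,ε₊; q); N) − flipQ(γ₋,δ₋,ε₋; q)`
`= 2s·(2(a_H+1)B₁ + 2a_H B₂ + 2B₃ + a_H + 1)`.
[cite: CasalsTeixeiradacosta2022, Proposition 3.8 (arXiv v2) with Lemma 3.5 and the proof of Theorem 3.10, Step 2 (route W / spin-flip bookkeeping of the in-tree proof)] -/
theorem shiftedQ_flipQ_sub (aH B₁ B₂ B₃ q : ℂ) (s : ℝ) {N : ℕ} (hsN : 2 * s = N) :
    shiftedQ aH (2 - (2 * B₁ + s + 1)) (2 - (2 * B₂ + s + 1)) (2 - (2 * B₃ + s + 1))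
        (flipQ aH (2 * B₁ + s + 1) (2 * B₂ + s + 1) (2 * B₃ + s + 1) q) N -
      flipQ aH (2 * B₁ + ((-s : ℝ) : ℂ) + 1) (2 * B₂ + ((-s : ℝ) : ℂ) + 1)
        (2 * B₃ + ((-s : ℝ) : ℂ) + 1) q =
      2 * (s : ℂ) * (2 * (aH + 1) * B₁ + 2 * aH * B₂ + 2 * B₃ + aH + 1) := by
  have h' : (N : ℂ) = 2 * (s : ℂ) := by exact_mod_cast hsN.symm
  unfold shiftedQ flipQ
  rw [h']
  push_cast
  ring

set_option maxRecDepth 8192 in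
/-- **The Kerr–de Sitter part of the accessory bookkeeping**: Hatsuda's accessory quantity at
`(−s, λ − 2s(1−α))` minus the one at `(s, λ)` is `2s·(2(z_r+1)B₁ + 2z_r B₂ + 2B₃ + z_r + 1)`
(uses Vieta's `1 − Λa²/3 = (Λ/3)(S² − e₂)` for the roots; CAS: pub-kds kit j175983).
[cite: CasalsTeixeiradacosta2022, Proposition 3.8 (arXiv v2) with Lemma 3.5 and the proof of Theorem 3.10, Step 2 (route W / spin-flip bookkeeping of the in-tree proof)] -/
theorem heunV_flip_diff {M a Λ : ℝ} (hsub : IsSubextremal M a Λ) (s : ℝ) (ω : ℂ) (m : ℝ) (lam : ℂ) :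
    heunV M a Λ (-s) ω m (RouteW.lamFlip a Λ s lam) - heunV M a Λ s ω m lam =
      2 * (s : ℂ) * (2 * ((mobiusZr M a Λ : ℂ) + 1) * horizonB M a Λ ω m (rPlus M a Λ) +
        2 * (mobiusZr M a Λ : ℂ) * horizonB M a Λ ω m (rCosmo M a Λ) +
        2 * horizonB M a Λ ω m (rNeg M a Λ) + (mobiusZr M a Λ : ℂ) + 1) := by
  have hV := vieta_sq hsub
  have hdy := deltaDeriv_at_rPlus hsub
  have hdz := deltaDeriv_at_rCosmo hsub
  have hdw := deltaDeriv_at_rNeg hsub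
  have h0 := rMinus_nonneg M a Λ
  obtain ⟨hM, hΛ, h01, h12, -⟩ := hsub
  -- `1 − α` through the roots
  have hα : (1 - alpha a Λ : ℝ) = Λ / 3 * ((rMinus M a Λ + rPlus M a Λ + rCosmo M a Λ) ^ 2 -
      (rMinus M a Λ * rPlus M a Λ + rPlus M a Λ * rCosmo M a Λ + rCosmo M a Λ * rMinus M a Λ)) := by
    unfold alpha; linarith
  have hw : rNeg M a Λ = -(rMinus M a Λ + rPlus M a Λ + rCosmo M a Λ) := rfl
  -- non-vanishing denominators
  have hxy : (rMinus M a Λ : ℂ) - rPlus M a Λ ≠ 0 := by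
    exact_mod_cast (show rMinus M a Λ - rPlus M a Λ ≠ 0 by linarith)
  have hyz : (rPlus M a Λ : ℂ) - rCosmo M a Λ ≠ 0 := by
    exact_mod_cast (show rPlus M a Λ - rCosmo M a Λ ≠ 0 by linarith)
  have hxz : (rMinus M a Λ : ℂ) - rCosmo M a Λ ≠ 0 := by
    exact_mod_cast (show rMinus M a Λ - rCosmo M a Λ ≠ 0 by linarith)
  have hxw : (rMinus M a Λ : ℂ) - (-(rMinus M a Λ + rPlus M a Λ + rCosmo M a Λ)) ≠ 0 := by
    exact_mod_cast (show rMinus M a Λ - (-(rMinus M a Λ + rPlus M a Λ + rCosmo M a Λ)) ≠ 0 by linarith)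
  have hyw : (rPlus M a Λ : ℂ) - (-(rMinus M a Λ + rPlus M a Λ + rCosmo M a Λ)) ≠ 0 := by
    exact_mod_cast (show rPlus M a Λ - (-(rMinus M a Λ + rPlus M a Λ + rCosmo M a Λ)) ≠ 0 by linarith)
  have hzw : (rCosmo M a Λ : ℂ) - (-(rMinus M a Λ + rPlus M a Λ + rCosmo M a Λ)) ≠ 0 := by
    exact_mod_cast (show rCosmo M a Λ - (-(rMinus M a Λ + rPlus M a Λ + rCosmo M a Λ)) ≠ 0 by linarith)
  have hwx : (-(rMinus M a Λ + rPlus M a Λ + rCosmo M a Λ) : ℂ) - rMinus M a Λ ≠ 0 := by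
    exact_mod_cast (show -(rMinus M a Λ + rPlus M a Λ + rCosmo M a Λ) - rMinus M a Λ ≠ 0 by linarith)
  have hwy : (-(rMinus M a Λ + rPlus M a Λ + rCosmo M a Λ) : ℂ) - rPlus M a Λ ≠ 0 := by
    exact_mod_cast (show -(rMinus M a Λ + rPlus M a Λ + rCosmo M a Λ) - rPlus M a Λ ≠ 0 by linarith)
  have hwz : (-(rMinus M a Λ + rPlus M a Λ + rCosmo M a Λ) : ℂ) - rCosmo M a Λ ≠ 0 := by
    exact_mod_cast (show -(rMinus M a Λ + rPlus M a Λ + rCosmo M a Λ) - rCosmo M a Λ ≠ 0 by linarith)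
  have hzy : (rCosmo M a Λ : ℂ) - rPlus M a Λ ≠ 0 := by
    exact_mod_cast (show rCosmo M a Λ - rPlus M a Λ ≠ 0 by linarith)
  have hyx : (rPlus M a Λ : ℂ) - rMinus M a Λ ≠ 0 := by
    exact_mod_cast (show rPlus M a Λ - rMinus M a Λ ≠ 0 by linarith)
  have hzx : (rCosmo M a Λ : ℂ) - rMinus M a Λ ≠ 0 := by
    exact_mod_cast (show rCosmo M a Λ - rMinus M a Λ ≠ 0 by linarith)
  have hΛ' : (Λ : ℂ) ≠ 0 := by exact_mod_cast hΛ.ne'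
  have h3 : (3 : ℂ) ≠ 0 := by norm_num
  unfold heunV RouteW.lamFlip mobiusZr mobiusZ horizonB radialK xi
  rw [hα, hdy, hdz, hdw, hw]
  push_cast
  field_simp
  ring

/-- **Accessory identity of the Teukolsky–Starobinsky transfer** (Umetsu's shifted accessory
parameter of the flipped spin-`s` data IS the flipped spin-`−s` data at `λ' = λ − 2s(1−α)`).
[cite: CasalsTeixeiradacosta2022, Proposition 3.8 (arXiv v2) with Lemma 3.5 and the proof of Theorem 3.10, Step 2 (route W / spin-flip bookkeeping of the in-tree proof)] -/
theorem accessory_identity {M a Λ : ℝ} (hsub : IsSubextremal M a Λ) (s : ℝ) (ω : ℂ) (m : ℝ)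
    (lam : ℂ) {N : ℕ} (hsN : 2 * s = N) :
    shiftedQ (mobiusZr M a Λ : ℂ) (2 - heunGamma M a Λ s ω m) (2 - heunDelta M a Λ s ω m)
        (2 - heunEps M a Λ s ω m)
        (flipQ (mobiusZr M a Λ : ℂ) (heunGamma M a Λ s ω m) (heunDelta M a Λ s ω m)
          (heunEps M a Λ s ω m) (heunV M a Λ s ω m lam)) N =
      flipQ (mobiusZr M a Λ : ℂ) (heunGamma M a Λ (-s) ω m) (heunDelta M a Λ (-s) ω m)
        (heunEps M a Λ (-s) ω m) (heunV M a Λ (-s) ω m (RouteW.lamFlip a Λ s lam)) := by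
  have hE := shiftedQ_flipQ_sub (mobiusZr M a Λ : ℂ) (horizonB M a Λ ω m (rPlus M a Λ))
    (horizonB M a Λ ω m (rCosmo M a Λ)) (horizonB M a Λ ω m (rNeg M a Λ)) (heunV M a Λ s ω m lam)
    s hsN
  have hD := heunV_flip_diff hsub s ω m lam
  have e1 : flipQ (mobiusZr M a Λ : ℂ) (heunGamma M a Λ (-s) ω m) (heunDelta M a Λ (-s) ω m)
        (heunEps M a Λ (-s) ω m) (heunV M a Λ (-s) ω m (RouteW.lamFlip a Λ s lam)) =
      flipQ (mobiusZr M a Λ : ℂ) (heunGamma M a Λ (-s) ω m) (heunDelta M a Λ (-s) ω m)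
        (heunEps M a Λ (-s) ω m) (heunV M a Λ s ω m lam) +
        (heunV M a Λ (-s) ω m (RouteW.lamFlip a Λ s lam) - heunV M a Λ s ω m lam) := by
    unfold flipQ; ring
  rw [e1, hD]
  unfold heunGamma heunDelta heunEps
  linear_combination hE

end SpinFlipTS

end Literature.Geometry.Lorentzian.KerrDeSitter.TeukolskyRadial

end Part2

/-!
## Part 3 — port of `Summits/Ventures/KdS/SpinFlipAnalysis.lean` (11 declarations kept)

# Venture KdS — analysis toolkit for the Teukolsky–Starobinsky transfer (I): branches and
# iterated derivatives

HONEST FRAMING (venture `Summits/Ventures/KdS`, cell `pub-kds`): elementary real analysis used by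
`RouteWSpinFlip.lean` (the Teukolsky–Starobinsky map `s ↦ −s` realised as Umetsu's `2s`-th
derivative in a flipped Heun frame). Nothing here mentions Kerr–de Sitter. Contents:

* iterated derivatives of smooth functions on open sets are taken from the tree's Kerr file
  `TeukolskyStarobinskyHeun` (`Kerr.Costa2019.iterate_deriv_smooth`, `iterate_deriv_eqOn`);
* `branchCoeff`, `iterate_deriv_branch`: for `Q` smooth near `1`,
  `(d/dx)^k [(1−x)^ν Q(x)] = (1−x)^{ν−k} H_k(x)` on the left of `1`, with `H_k` smooth ACROSS `1` and
  `H_k(1) = (−1)^k ν(ν−1)⋯(ν−k+1) Q(1)` (principal powers of the positive real `1 − x`);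
* `natural_of_smooth_branch`: if `(1−x)^ν Q(x)` (`Q(1) ≠ 0`) agrees on the left of `1` with a function
  smooth across `1`, then `ν ∈ ℕ` (otherwise a high derivative blows up like `(1−x)^{Re ν − k}`);
* `iterate_deriv_of_branch`, `iterate_deriv_of_agree`: shapes of iterated derivatives transported
  along local agreements near `1⁻` and `0⁺`.

(Verbatim declaration-level port — the declarations listed in the Part header count — of the Summits-side module of the KdS
venture; venture / cell / ruling bookkeeping in the text above is historical.)
-/

section Part3

open _root_.Set _root_.Complex _root_.Filter _root_.Topology _root_.Polynomial

namespace Literature.Geometry.Lorentzian.KerrDeSitter.TeukolskyRadial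

namespace SpinFlipTS

open Literature.Geometry.Lorentzian.Kerr.Costa2019 (iterate_deriv_smooth iterate_deriv_eqOn)

/-! ### The branch `(1−x)^ν · Q(x)` and its iterated derivatives -/

/-- The cofactor recursion: `H₀ = Q`, `H_{k+1} = −(ν−k)·H_k + (1−x)·H_k'`.
[cite: CasalsTeixeiradacosta2022, Proposition 3.8 (arXiv v2) with Lemma 3.5 and the proof of Theorem 3.10, Step 2 (route W / spin-flip bookkeeping of the in-tree proof)] -/
def branchCoeff (ν : ℂ) (Q : ℝ → ℂ) : ℕ → ℝ → ℂ
  | 0 => Q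
  | k + 1 => fun x => -(ν - k) * branchCoeff ν Q k x + ((1 - x : ℝ) : ℂ) * deriv (branchCoeff ν Q k) x

/-- `x ↦ ((1−x : ℝ) : ℂ)` is smooth.
[cite: CasalsTeixeiradacosta2022, Proposition 3.8 (arXiv v2) with Lemma 3.5 and the proof of Theorem 3.10, Step 2 (route W / spin-flip bookkeeping of the in-tree proof)] -/
private theorem contDiff_cast_one_sub :
    ContDiff ℝ ((⊤ : ℕ∞) : WithTop ℕ∞) (fun x : ℝ => ((1 - x : ℝ) : ℂ)) :=
  Complex.ofRealCLM.contDiff.comp (contDiff_const.sub contDiff_id)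

/-- The cofactors are smooth wherever `Q` is (open set).
[cite: CasalsTeixeiradacosta2022, Proposition 3.8 (arXiv v2) with Lemma 3.5 and the proof of Theorem 3.10, Step 2 (route W / spin-flip bookkeeping of the in-tree proof)] -/
theorem branchCoeff_smooth (ν : ℂ) {Q : ℝ → ℂ} {U : Set ℝ} (hU : IsOpen U)
    (hQ : ContDiffOn ℝ ((⊤ : ℕ∞) : WithTop ℕ∞) Q U) (k : ℕ) :
    ContDiffOn ℝ ((⊤ : ℕ∞) : WithTop ℕ∞) (branchCoeff ν Q k) U := by
  induction k with
  | zero => exact hQ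
  | succ k ih =>
    have hd : ContDiffOn ℝ ((⊤ : ℕ∞) : WithTop ℕ∞) (deriv (branchCoeff ν Q k)) U :=
      ih.deriv_of_isOpen hU le_rfl
    exact (contDiffOn_const.mul ih).add (contDiff_cast_one_sub.contDiffOn.mul hd)

/-- Value at `1`: `H_k(1) = (−1)^k · ∏_{i<k}(ν − i) · Q(1)`.
[cite: CasalsTeixeiradacosta2022, Proposition 3.8 (arXiv v2) with Lemma 3.5 and the proof of Theorem 3.10, Step 2 (route W / spin-flip bookkeeping of the in-tree proof)] -/
theorem branchCoeff_one (ν : ℂ) (Q : ℝ → ℂ) (k : ℕ) :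
    branchCoeff ν Q k 1 = (-1) ^ k * (∏ i ∈ Finset.range k, (ν - i)) * Q 1 := by
  induction k with
  | zero => simp [branchCoeff]
  | succ k ih =>
    simp only [branchCoeff]
    rw [ih, Finset.prod_range_succ]
    push_cast
    ring

/-- `d/dx (c − x)^p = (c − x)^p · p/(x − c)` for `x < c` (principal power of a positive real).
[cite: CasalsTeixeiradacosta2022, Proposition 3.8 (arXiv v2) with Lemma 3.5 and the proof of Theorem 3.10, Step 2 (route W / spin-flip bookkeeping of the in-tree proof)] -/
private theorem hasDerivAt_const_sub_cpow (c : ℝ) (p : ℂ) {r : ℝ} (hr : r < c) :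
    HasDerivAt (fun x : ℝ => ((c - x : ℝ) : ℂ) ^ p)
      (((c - r : ℝ) : ℂ) ^ p * (p / ((r : ℂ) - c))) r := by
  have hpos : (0 : ℝ) < c - r := sub_pos.2 hr
  have hslit : ((c : ℂ) - r) ∈ slitPlane := by
    rw [← Complex.ofReal_sub]
    exact Complex.ofReal_mem_slitPlane.2 hpos
  have hne : ((c - r : ℝ) : ℂ) ≠ 0 := by exact_mod_cast hpos.ne'
  have hne' : ((r : ℂ) - c) ≠ 0 := by
    have : ((r - c : ℝ) : ℂ) ≠ 0 := by exact_mod_cast (show r - c ≠ 0 by linarith)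
    simpa using this
  have h1 : HasDerivAt (fun z : ℂ => (c - z) ^ p) (p * ((c : ℂ) - r) ^ (p - 1) * -1) (r : ℂ) :=
    ((hasDerivAt_id (r : ℂ)).const_sub (c : ℂ)).cpow_const hslit
  have hfun : (fun x : ℝ => ((c - x : ℝ) : ℂ) ^ p) = fun y : ℝ => ((c : ℂ) - y) ^ p := by
    funext y
    rw [Complex.ofReal_sub]
  rw [hfun]
  refine h1.comp_ofReal.congr_deriv ?_
  rw [← Complex.ofReal_sub, Complex.cpow_sub _ _ hne, Complex.cpow_one]
  have e : ((c - r : ℝ) : ℂ) = -((r : ℂ) - c) := by push_cast; ring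
  rw [e]
  field_simp

/-- **Iterated derivatives of a branch.** If `Q` is smooth on `(1−e, 1+e)`, then for every `k` and
every `x ∈ (1−e, 1)`,
`(d/dx)^k [(1−x)^ν Q(x)] = (1−x)^{ν−k} · H_k(x)` with `H_k = branchCoeff ν Q k`.
[cite: CasalsTeixeiradacosta2022, Proposition 3.8 (arXiv v2) with Lemma 3.5 and the proof of Theorem 3.10, Step 2 (route W / spin-flip bookkeeping of the in-tree proof)] -/
theorem iterate_deriv_branch (ν : ℂ) {Q : ℝ → ℂ} {e : ℝ}
    (hQ : ContDiffOn ℝ ((⊤ : ℕ∞) : WithTop ℕ∞) Q (Ioo (1 - e) (1 + e))) (k : ℕ) :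
    ∀ x ∈ Ioo (1 - e) 1,
      (deriv^[k] fun t => ((1 - t : ℝ) : ℂ) ^ ν * Q t) x =
        ((1 - x : ℝ) : ℂ) ^ (ν - k) * branchCoeff ν Q k x := by
  induction k with
  | zero => intro x _; simp [branchCoeff]
  | succ k ih =>
    intro x hx
    have hxW : x ∈ Ioo (1 - e) (1 + e) := ⟨hx.1, by linarith [hx.1, hx.2]⟩
    have hW : IsOpen (Ioo (1 - e) (1 + e)) := isOpen_Ioo
    have hS : IsOpen (Ioo (1 - e) (1 : ℝ)) := isOpen_Ioo
    rw [Function.iterate_succ_apply']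
    -- replace the k-th derivative by its closed form near x
    have hloc : (deriv^[k] fun t => ((1 - t : ℝ) : ℂ) ^ ν * Q t) =ᶠ[𝓝 x]
        fun t => ((1 - t : ℝ) : ℂ) ^ (ν - k) * branchCoeff ν Q k t := by
      filter_upwards [hS.mem_nhds hx] with t ht using ih t ht
    rw [hloc.deriv_eq]
    -- differentiate the closed form
    have hH : HasDerivAt (branchCoeff ν Q k) (deriv (branchCoeff ν Q k) x) x :=
      (((branchCoeff_smooth ν hW hQ k).differentiableOn (by simp)).differentiableAt
        (hW.mem_nhds hxW)).hasDerivAt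
    have hP := hasDerivAt_const_sub_cpow 1 (ν - k) hx.2
    have hne : ((1 - x : ℝ) : ℂ) ≠ 0 := by exact_mod_cast (show (1 - x : ℝ) ≠ 0 by linarith [hx.2])
    have hne' : (x : ℂ) - 1 ≠ 0 := by
      have : ((x - 1 : ℝ) : ℂ) ≠ 0 := by exact_mod_cast (show x - 1 ≠ 0 by linarith [hx.2])
      simpa using this
    have hprod : HasDerivAt (fun t => ((1 - t : ℝ) : ℂ) ^ (ν - k) * branchCoeff ν Q k t)
        (((1 - x : ℝ) : ℂ) ^ (ν - k) * ((ν - k) / ((x : ℂ) - 1)) * branchCoeff ν Q k x +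
          ((1 - x : ℝ) : ℂ) ^ (ν - k) * deriv (branchCoeff ν Q k) x) x := hP.mul hH
    rw [hprod.deriv]
    -- `(1−x)^{ν−k} = (1−x)^{ν−(k+1)} · (1−x)`
    have hsplit : ((1 - x : ℝ) : ℂ) ^ (ν - (k : ℕ)) =
        ((1 - x : ℝ) : ℂ) ^ (ν - ((k + 1 : ℕ) : ℂ)) * ((1 - x : ℝ) : ℂ) := by
      conv_lhs => rw [show ν - ((k : ℕ) : ℂ) = (ν - ((k + 1 : ℕ) : ℂ)) + 1 by push_cast; ring]
      rw [Complex.cpow_add _ _ hne, Complex.cpow_one]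
    rw [show branchCoeff ν Q (k + 1) x =
        -(ν - k) * branchCoeff ν Q k x + ((1 - x : ℝ) : ℂ) * deriv (branchCoeff ν Q k) x from rfl]
    rw [hsplit]
    have e1 : ((1 - x : ℝ) : ℂ) = -((x : ℂ) - 1) := by push_cast; ring
    rw [e1]
    field_simp

/-! ### A branch extending smoothly across `1` has a natural exponent -/

/-- `x ↦ 1 − x` maps the left neighbourhoods of `1` to the right neighbourhoods of `0`.
[cite: CasalsTeixeiradacosta2022, Proposition 3.8 (arXiv v2) with Lemma 3.5 and the proof of Theorem 3.10, Step 2 (route W / spin-flip bookkeeping of the in-tree proof)] -/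
private theorem tendsto_one_sub_nhdsLT :
    Tendsto (fun x : ℝ => 1 - x) (𝓝[<] (1 : ℝ)) (𝓝[>] (0 : ℝ)) := by
  refine tendsto_nhdsWithin_iff.mpr ⟨?_, ?_⟩
  · have h : Tendsto (fun x : ℝ => 1 - x) (𝓝 (1 : ℝ)) (𝓝 (1 - 1)) :=
      ((continuous_const.sub continuous_id).tendsto (1 : ℝ))
    rw [sub_self] at h
    exact h.mono_left nhdsWithin_le_nhds
  · filter_upwards [self_mem_nhdsWithin] with x hx
    exact sub_pos.mpr (mem_Iio.mp hx)

/-- `(1−x)^{c} → +∞` as `x → 1⁻` for `c < 0` (real powers).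
[cite: CasalsTeixeiradacosta2022, Proposition 3.8 (arXiv v2) with Lemma 3.5 and the proof of Theorem 3.10, Step 2 (route W / spin-flip bookkeeping of the in-tree proof)] -/
private theorem tendsto_one_sub_rpow_atTop {c : ℝ} (hc : c < 0) :
    Tendsto (fun x : ℝ => (1 - x) ^ c) (𝓝[<] (1 : ℝ)) atTop := by
  have h2 := (tendsto_rpow_atTop (show 0 < -c by linarith)).comp
    (tendsto_inv_nhdsGT_zero.comp tendsto_one_sub_nhdsLT)
  refine h2.congr' ?_
  filter_upwards [self_mem_nhdsWithin] with x hx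
  have hx' : (0 : ℝ) ≤ 1 - x := by simp only [mem_Iio] at hx; linarith
  simp only [Function.comp]
  rw [Real.inv_rpow hx', ← Real.rpow_neg hx', neg_neg]

/-- **A branch that extends smoothly across `1` has a natural exponent.** If `Q` and `G` are smooth on
`(1−e, 1+e)`, `Q(1) ≠ 0`, and `(1−x)^ν Q(x) = G(x)` for `x ∈ (1−e, 1)`, then `ν ∈ ℕ`. (Otherwise,
with `k > Re ν`, the `k`-th derivative of the left side is `(1−x)^{ν−k} H_k(x)` with
`H_k(1) = (−1)^k ν(ν−1)⋯(ν−k+1) Q(1) ≠ 0`, unbounded as `x → 1⁻`, while `G^{(k)}` is continuous at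
`1`.)
[cite: CasalsTeixeiradacosta2022, Proposition 3.8 (arXiv v2) with Lemma 3.5 and the proof of Theorem 3.10, Step 2 (route W / spin-flip bookkeeping of the in-tree proof)] -/
theorem natural_of_smooth_branch {ν : ℂ} {Q G : ℝ → ℂ} {e : ℝ} (he : 0 < e)
    (hQ : ContDiffOn ℝ ((⊤ : ℕ∞) : WithTop ℕ∞) Q (Ioo (1 - e) (1 + e))) (hQ1 : Q 1 ≠ 0)
    (hG : ContDiffOn ℝ ((⊤ : ℕ∞) : WithTop ℕ∞) G (Ioo (1 - e) (1 + e)))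
    (hagree : ∀ x ∈ Ioo (1 - e) 1, ((1 - x : ℝ) : ℂ) ^ ν * Q x = G x) :
    ∃ n : ℕ, ν = n := by
  by_contra hcon'
  have hcon : ∀ n : ℕ, ν ≠ n := fun n h => hcon' ⟨n, h⟩
  set k : ℕ := ⌈ν.re⌉₊ + 1 with hk
  have hkre : ν.re < k := by
    have h1 := Nat.le_ceil ν.re
    rw [hk]; push_cast; linarith
  set W : Set ℝ := Ioo (1 - e) (1 + e) with hWdef
  have hW : IsOpen W := isOpen_Ioo
  have h1W : (1 : ℝ) ∈ W := ⟨by linarith, by linarith⟩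
  set H := branchCoeff ν Q k with hHdef
  have hHs : ContDiffOn ℝ ((⊤ : ℕ∞) : WithTop ℕ∞) H W := branchCoeff_smooth ν hW hQ k
  have hH1 : H 1 ≠ 0 := by
    rw [hHdef, branchCoeff_one]
    refine mul_ne_zero (mul_ne_zero (pow_ne_zero _ (by norm_num)) ?_) hQ1
    rw [Finset.prod_ne_zero_iff]
    intro i _
    exact sub_ne_zero.mpr (hcon i)
  obtain ⟨hDk, -⟩ := iterate_deriv_smooth hW hG k
  have hleft : ∀ x ∈ Ioo (1 - e) 1, (deriv^[k] G) x = ((1 - x : ℝ) : ℂ) ^ (ν - k) * H x := by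
    intro x hx
    have heq : EqOn G (fun t => ((1 - t : ℝ) : ℂ) ^ ν * Q t) (Ioo (1 - e) 1) :=
      fun t ht => (hagree t ht).symm
    rw [iterate_deriv_eqOn isOpen_Ioo heq k hx]
    exact iterate_deriv_branch ν hQ k x hx
  have hcG : ContinuousAt (deriv^[k] G) 1 :=
    (hDk.continuousOn.continuousWithinAt h1W).continuousAt (hW.mem_nhds h1W)
  have hcH : ContinuousAt H 1 :=
    (hHs.continuousOn.continuousWithinAt h1W).continuousAt (hW.mem_nhds h1W)
  set B : ℝ := ‖(deriv^[k] G) 1‖ + 1 with hBdef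
  have hB : 0 < B := by positivity
  have hH1n : 0 < ‖H 1‖ := norm_pos_iff.mpr hH1
  set h₀ : ℝ := ‖H 1‖ / 2 with hh₀def
  have hh₀ : 0 < h₀ := by positivity
  have evG : ∀ᶠ x in 𝓝 (1 : ℝ), ‖(deriv^[k] G) x‖ ≤ B := by
    have h := (Metric.tendsto_nhds.mp hcG) 1 one_pos
    filter_upwards [h] with x hx
    rw [dist_eq_norm] at hx
    have := norm_le_insert' ((deriv^[k] G) x) ((deriv^[k] G) 1)
    linarith [hx.le]
  have evH : ∀ᶠ x in 𝓝 (1 : ℝ), h₀ ≤ ‖H x‖ := by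
    have h := (Metric.tendsto_nhds.mp hcH) h₀ hh₀
    filter_upwards [h] with x hx
    rw [dist_eq_norm] at hx
    have := norm_le_insert' (H 1) (H x)
    rw [norm_sub_rev] at this
    linarith
  have evBig : ∀ᶠ x in 𝓝[<] (1 : ℝ), B / h₀ < (1 - x) ^ (ν.re - k) :=
    (tendsto_one_sub_rpow_atTop (show ν.re - k < 0 by linarith)).eventually_gt_atTop _
  have evIn : ∀ᶠ x in 𝓝[<] (1 : ℝ), x ∈ Ioo (1 - e) 1 := Ioo_mem_nhdsLT (by linarith)
  obtain ⟨x, hxbig, hxin, hxG, hxH⟩ :=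
    (evBig.and (evIn.and ((evG.filter_mono nhdsWithin_le_nhds).and
      (evH.filter_mono nhdsWithin_le_nhds)))).exists
  have hpos1 : 0 < 1 - x := by linarith [hxin.2]
  have hnorm : ‖(deriv^[k] G) x‖ = (1 - x) ^ (ν.re - k) * ‖H x‖ := by
    rw [hleft x hxin, norm_mul, Complex.norm_cpow_eq_rpow_re_of_pos hpos1]
    simp
  have hrp : 0 ≤ (1 - x) ^ (ν.re - k) := Real.rpow_nonneg hpos1.le _
  have hlt : B < ‖(deriv^[k] G) x‖ := by
    rw [hnorm]
    calc B = (B / h₀) * h₀ := by field_simp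
      _ < (1 - x) ^ (ν.re - k) * h₀ := by gcongr
      _ ≤ (1 - x) ^ (ν.re - k) * ‖H x‖ := by gcongr
  linarith

/-! ### Shapes of iterated derivatives transported along local agreements -/

/-- Near `1⁻`: if `u = (1−x)^μ G` on `(1−e,1)` with `G` smooth on `(1−e,1+e)`, then for every `k`,
`u^{(k)} = (1−x)^{μ−k} · H_k` on `(1−e,1)` with `H_k = branchCoeff μ G k` (smooth on `(1−e,1+e)` by
`branchCoeff_smooth`).
[cite: CasalsTeixeiradacosta2022, Proposition 3.8 (arXiv v2) with Lemma 3.5 and the proof of Theorem 3.10, Step 2 (route W / spin-flip bookkeeping of the in-tree proof)] -/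
theorem iterate_deriv_of_branch {u G : ℝ → ℂ} {μ : ℂ} {e : ℝ}
    (hG : ContDiffOn ℝ ((⊤ : ℕ∞) : WithTop ℕ∞) G (Ioo (1 - e) (1 + e)))
    (hbranch : ∀ x ∈ Ioo (1 - e) 1, u x = ((1 - x : ℝ) : ℂ) ^ μ * G x) (k : ℕ) :
    ∀ x ∈ Ioo (1 - e) 1,
      (deriv^[k] u) x = ((1 - x : ℝ) : ℂ) ^ (μ - k) * branchCoeff μ G k x := by
  intro x hx
  have heq : EqOn u (fun t => ((1 - t : ℝ) : ℂ) ^ μ * G t) (Ioo (1 - e) 1) := fun t ht => hbranch t ht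
  rw [iterate_deriv_eqOn isOpen_Ioo heq k hx]
  exact iterate_deriv_branch μ hG k x hx

/-- Near `0⁺`: if `u = F` on `(0,e)` with `F` smooth on `(−e,e)`, then `u^{(k)} = F^{(k)}` on `(0,e)`
and `F^{(k)}` is smooth on `(−e,e)`.
[cite: CasalsTeixeiradacosta2022, Proposition 3.8 (arXiv v2) with Lemma 3.5 and the proof of Theorem 3.10, Step 2 (route W / spin-flip bookkeeping of the in-tree proof)] -/
theorem iterate_deriv_of_agree {u F : ℝ → ℂ} {e : ℝ}
    (hF : ContDiffOn ℝ ((⊤ : ℕ∞) : WithTop ℕ∞) F (Ioo (-e) e))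
    (hagree : ∀ x ∈ Ioo 0 e, u x = F x) (k : ℕ) :
    ContDiffOn ℝ ((⊤ : ℕ∞) : WithTop ℕ∞) (deriv^[k] F) (Ioo (-e) e) ∧
      ∀ x ∈ Ioo 0 e, (deriv^[k] u) x = (deriv^[k] F) x :=
  ⟨(iterate_deriv_smooth isOpen_Ioo hF k).1,
    fun _ hx => iterate_deriv_eqOn isOpen_Ioo (fun t ht => hagree t ht) k hx⟩

end SpinFlipTS

end Literature.Geometry.Lorentzian.KerrDeSitter.TeukolskyRadial

end Part3

/-!
## Part 4 — port of `Summits/Ventures/KdS/SpinFlipPolynomial.lean` (4 declarations kept)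

# Venture KdS — analysis toolkit for the Teukolsky–Starobinsky transfer (II): polynomial rigidity
# and the injectivity lemma

HONEST FRAMING (venture `Summits/Ventures/KdS`, cell `pub-kds`): elementary real analysis used by
`RouteWSpinFlip.lean`. Nothing here mentions Kerr–de Sitter. Contents:

* `exists_polynomial_of_iterate_deriv_eq_zero`: `f^{(N)} ≡ 0` on an open interval forces `f` to be a
  polynomial of degree `< N` there (induction with explicit antiderivatives and the mean value
  theorem);
* `eq_zero_of_iterate_deriv_eq_zero_of_branch`: the INJECTIVITY LEMMA — a function on `(0,1)` with
  `u^{(N)} ≡ 0` which is `(1−x)^μ ·(smooth across 1)` near `1⁻` vanishes identically unless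
  `μ ∈ ℤ_{≤ N−1}` (the "cosmological lattice" of the spin-flip theorem: there the kernel of the
  `2s`-th derivative contains functions with the physical branch at the cosmological horizon).

(Verbatim declaration-level port — the declarations listed in the Part header count — of the Summits-side module of the KdS
venture; venture / cell / ruling bookkeeping in the text above is historical.)
-/

section Part4

open _root_.Set _root_.Complex _root_.Filter _root_.Topology _root_.Polynomial

namespace Literature.Geometry.Lorentzian.KerrDeSitter.TeukolskyRadial

namespace SpinFlipTS

open Literature.Geometry.Lorentzian.Kerr.Costa2019 (iterate_deriv_smooth iterate_deriv_eqOn)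

/-! ### Vanishing `N`-th derivative on an interval ⇒ polynomial -/

/-- An explicit antiderivative of a polynomial: `(∑ c_i/(i+1) X^{i+1})' = ∑ c_i X^i`.
[cite: CasalsTeixeiradacosta2022, Proposition 3.8 (arXiv v2) with Lemma 3.5 and the proof of Theorem 3.10, Step 2 (route W / spin-flip bookkeeping of the in-tree proof)] -/
private theorem exists_antiderivative (P : Polynomial ℂ) :
    ∃ Q : Polynomial ℂ, Q.derivative = P ∧ Q.natDegree ≤ P.natDegree + 1 := by
  set n := P.natDegree + 1 with hn
  refine ⟨∑ i ∈ Finset.range n, C (P.coeff i / ((i : ℂ) + 1)) * X ^ (i + 1), ?_, ?_⟩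
  · rw [derivative_sum]
    conv_rhs => rw [as_sum_range_C_mul_X_pow' P (show P.natDegree < n by omega)]
    refine Finset.sum_congr rfl fun i _ => ?_
    rw [derivative_C_mul_X_pow]
    have hi : (i : ℂ) + 1 ≠ 0 := by exact_mod_cast Nat.succ_ne_zero i
    congr 1
    · push_cast
      field_simp
    -- `X ^ (i + 1 - 1) = X ^ i`
  · refine (natDegree_sum_le_of_forall_le _ _ fun i hi => ?_)
    calc (C (P.coeff i / ((i : ℂ) + 1)) * X ^ (i + 1)).natDegree ≤ i + 1 := natDegree_C_mul_X_pow_le _ _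
      _ ≤ P.natDegree + 1 := by
        have := Finset.mem_range.mp hi
        omega

/-- Two points of an open interval: a function with zero derivative on the interval takes equal
values (mean value theorem on the segment).
[cite: CasalsTeixeiradacosta2022, Proposition 3.8 (arXiv v2) with Lemma 3.5 and the proof of Theorem 3.10, Step 2 (route W / spin-flip bookkeeping of the in-tree proof)] -/
private theorem eq_of_hasDerivAt_zero {a b : ℝ} {g : ℝ → ℂ}
    (hg : ∀ x ∈ Ioo a b, HasDerivAt g 0 x) {x y : ℝ} (hx : x ∈ Ioo a b) (hy : y ∈ Ioo a b)
    (hxy : x ≤ y) : g y = g x := by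
  have hsub : Icc x y ⊆ Ioo a b := fun t ht => ⟨lt_of_lt_of_le hx.1 ht.1, lt_of_le_of_lt ht.2 hy.2⟩
  have hcont : ContinuousOn g (Icc x y) := fun t ht =>
    (hg t (hsub ht)).continuousAt.continuousWithinAt
  exact constant_of_has_deriv_right_zero hcont
    (fun t ht => (hg t (hsub ⟨ht.1, ht.2.le⟩)).hasDerivWithinAt) y ⟨hxy, le_rfl⟩

/-- **`f^{(N)} ≡ 0` on an open interval forces `f` to be a polynomial of degree `< N` there.**
[cite: CasalsTeixeiradacosta2022, Proposition 3.8 (arXiv v2) with Lemma 3.5 and the proof of Theorem 3.10, Step 2 (route W / spin-flip bookkeeping of the in-tree proof)] -/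
theorem exists_polynomial_of_iterate_deriv_eq_zero {a b : ℝ} (hab : a < b) :
    ∀ (N : ℕ) {f : ℝ → ℂ}, ContDiffOn ℝ ((⊤ : ℕ∞) : WithTop ℕ∞) f (Ioo a b) →
      (∀ x ∈ Ioo a b, (deriv^[N] f) x = 0) →
        ∃ P : Polynomial ℂ, P.degree < N ∧ ∀ x ∈ Ioo a b, f x = P.eval (x : ℂ) := by
  intro N
  induction N with
  | zero =>
    intro f _ h0
    refine ⟨0, by simp, fun x hx => ?_⟩
    simpa using h0 x hx
  | succ N ih =>
    intro f hf hN
    have hI : IsOpen (Ioo a b) := isOpen_Ioo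
    -- `deriv f` is smooth and its `N`-th derivative vanishes
    obtain ⟨hf1, hfd⟩ := iterate_deriv_smooth hI hf 1
    simp only [Function.iterate_one] at hf1
    have hN' : ∀ x ∈ Ioo a b, (deriv^[N] (deriv f)) x = 0 := by
      intro x hx
      have := hN x hx
      rwa [Function.iterate_succ_apply] at this
    obtain ⟨P, hPdeg, hP⟩ := ih hf1 hN'
    -- antiderivative `Q` of `P`, and `f − Q` has zero derivative
    obtain ⟨Q, hQ, hQdeg⟩ : ∃ Q : Polynomial ℂ, Q.derivative = P ∧ Q.natDegree ≤ N := by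
      by_cases hP0 : P = 0
      · exact ⟨0, by simp [hP0], by simp⟩
      · obtain ⟨Q, hQ, hQdeg⟩ := exists_antiderivative P
        have := (natDegree_lt_iff_degree_lt hP0).mpr hPdeg
        exact ⟨Q, hQ, hQdeg.trans (by omega)⟩
    have hderiv0 : ∀ x ∈ Ioo a b, HasDerivAt (fun t => f t - Q.eval (t : ℂ)) 0 x := by
      intro x hx
      have h1 : HasDerivAt f (deriv f x) x :=
        ((hf.differentiableOn (by simp)).differentiableAt (hI.mem_nhds hx)).hasDerivAt
      have h2 : HasDerivAt (fun t : ℝ => Q.eval (t : ℂ)) (Q.derivative.eval (x : ℂ)) x :=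
        (Q.hasDerivAt (x : ℂ)).comp_ofReal
      have h3 := h1.sub h2
      rw [hQ, ← hP x hx, sub_self] at h3
      exact h3
    -- hence `f = Q + c` on the interval
    set x₀ : ℝ := (a + b) / 2 with hx₀
    have hx₀I : x₀ ∈ Ioo a b := ⟨by rw [hx₀]; linarith, by rw [hx₀]; linarith⟩
    set c : ℂ := f x₀ - Q.eval (x₀ : ℂ) with hc
    have hconst : ∀ x ∈ Ioo a b, f x - Q.eval (x : ℂ) = c := by
      intro x hx
      rcases le_total x₀ x with h | h
      · exact eq_of_hasDerivAt_zero hderiv0 hx₀I hx h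
      · exact (eq_of_hasDerivAt_zero hderiv0 hx hx₀I h).symm
    refine ⟨Q + C c, ?_, fun x hx => ?_⟩
    · -- degree bound: `natDegree Q ≤ N`
      have h1 : (Q + C c).natDegree ≤ N := by
        calc (Q + C c).natDegree ≤ max Q.natDegree (C c).natDegree := natDegree_add_le _ _
          _ ≤ N := by
            rw [natDegree_C]
            exact max_le hQdeg (Nat.zero_le _)
      calc (Q + C c).degree ≤ (Q + C c).natDegree := degree_le_natDegree
        _ ≤ (N : WithBot ℕ) := by exact_mod_cast h1
        _ < ((N + 1 : ℕ) : WithBot ℕ) := by exact_mod_cast Nat.lt_succ_self N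
    · have := hconst x hx
      rw [eval_add, eval_C]
      linear_combination this

/-! ### The injectivity lemma -/

/-- **Injectivity lemma.** Let `u` be smooth on `(0,1)` with `u^{(N)} ≡ 0` there, and suppose that
near `1⁻`, `u(x) = (1−x)^μ G(x)` with `G` smooth on a two-sided neighbourhood of `1` (principal power
of the positive real `1−x`). If `μ ∉ ℤ_{≤ N−1}`, then `u ≡ 0` on `(0,1)`. (Indeed `u` is a polynomial
`P` of degree `< N`; if `P ≠ 0`, write `P = (X−1)^n q`, `q(1) ≠ 0`, `n ≤ N−1`; then
`G = ±(1−x)^{n−μ} q` extends smoothly across `1`, forcing `n − μ ∈ ℕ`, i.e. `μ ∈ ℤ_{≤ n}`.)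
[cite: CasalsTeixeiradacosta2022, Proposition 3.8 (arXiv v2) with Lemma 3.5 and the proof of Theorem 3.10, Step 2 (route W / spin-flip bookkeeping of the in-tree proof)] -/
theorem eq_zero_of_iterate_deriv_eq_zero_of_branch {N : ℕ} {u : ℝ → ℂ}
    (hu : ContDiffOn ℝ ((⊤ : ℕ∞) : WithTop ℕ∞) u (Ioo 0 1))
    (hN : ∀ x ∈ Ioo (0 : ℝ) 1, (deriv^[N] u) x = 0) {μ : ℂ} {e : ℝ} (he : 0 < e) (he1 : e ≤ 1)
    {G : ℝ → ℂ} (hG : ContDiffOn ℝ ((⊤ : ℕ∞) : WithTop ℕ∞) G (Ioo (1 - e) (1 + e)))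
    (hbranch : ∀ x ∈ Ioo (1 - e) 1, u x = ((1 - x : ℝ) : ℂ) ^ μ * G x)
    (hoff : ∀ k : ℤ, k ≤ (N : ℤ) - 1 → μ ≠ k) :
    ∀ x ∈ Ioo (0 : ℝ) 1, u x = 0 := by
  obtain ⟨P, hPdeg, hP⟩ := exists_polynomial_of_iterate_deriv_eq_zero zero_lt_one N hu hN
  by_cases hP0 : P = 0
  · intro x hx; simp [hP x hx, hP0]
  exfalso
  set n := P.rootMultiplicity 1 with hn
  obtain ⟨q, hPq, hqdvd⟩ := exists_eq_pow_rootMultiplicity_mul_and_not_dvd P hP0 1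
  have hq1 : q.eval 1 ≠ 0 := by
    intro h0; exact hqdvd (dvd_iff_isRoot.mpr h0)
  have hq0 : q ≠ 0 := by rintro rfl; simp at hq1
  -- `n ≤ natDegree P ≤ N − 1`
  have hnle : n ≤ P.natDegree := by
    have h := congrArg natDegree hPq
    rw [natDegree_mul (pow_ne_zero _ (X_sub_C_ne_zero 1)) hq0, natDegree_pow, natDegree_X_sub_C,
      mul_one] at h
    omega
  have hPnat : P.natDegree < N := (natDegree_lt_iff_degree_lt hP0).mpr hPdeg
  -- the cofactor `Q(x) = (−1)^n q(x)` and the identity `(1−x)^{n−μ} Q(x) = G(x)` on `(1−e, 1)`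
  set Q : ℝ → ℂ := fun x => (-1) ^ n * q.eval (x : ℂ) with hQdef
  have hQs : ContDiffOn ℝ ((⊤ : ℕ∞) : WithTop ℕ∞) Q (Ioo (1 - e) (1 + e)) := by
    have h1 : ContDiff ℝ ((⊤ : ℕ∞) : WithTop ℕ∞) (fun x : ℝ => q.eval (x : ℂ)) := by
      have hq0 : ContDiff ℂ ((⊤ : ℕ∞) : WithTop ℕ∞) (fun x : ℂ => aeval x q) :=
        Polynomial.contDiff_aeval q _
      have hq := hq0.restrict_scalars ℝ
      have e1 : (fun x : ℂ => aeval x q) = fun x : ℂ => q.eval x := by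
        funext x; simp [coe_aeval_eq_eval]
      rw [e1] at hq
      exact hq.comp Complex.ofRealCLM.contDiff
    exact (contDiff_const.mul h1).contDiffOn
  have hQ1 : Q 1 ≠ 0 := by
    rw [hQdef]
    simp only [Complex.ofReal_one]
    exact mul_ne_zero (pow_ne_zero _ (by norm_num)) hq1
  have hagree : ∀ x ∈ Ioo (1 - e) 1, ((1 - x : ℝ) : ℂ) ^ ((n : ℂ) - μ) * Q x = G x := by
    intro x hx
    have hx01 : x ∈ Ioo (0 : ℝ) 1 := ⟨by linarith [hx.1], hx.2⟩
    have hpos : (0 : ℝ) < 1 - x := by linarith [hx.2]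
    have hne : ((1 - x : ℝ) : ℂ) ≠ 0 := by exact_mod_cast hpos.ne'
    have h1 := hbranch x hx
    rw [hP x hx01, hPq, eval_mul, eval_pow, eval_sub, eval_X, eval_C] at h1
    -- `(x − 1)^n q(x) = (1−x)^μ G(x)`  ⇒  `G(x) = (1−x)^{−μ} (x−1)^n q(x)`
    have hG' : G x = ((1 - x : ℝ) : ℂ) ^ (-μ) * (((x : ℂ) - 1) ^ n * q.eval (x : ℂ)) := by
      rw [h1, ← mul_assoc, ← Complex.cpow_add _ _ hne, neg_add_cancel, Complex.cpow_zero, one_mul]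
    rw [hG', hQdef, Complex.cpow_sub _ _ hne, Complex.cpow_natCast]
    have e2 : ((x : ℂ) - 1) = -((1 - x : ℝ) : ℂ) := by push_cast; ring
    rw [e2, neg_pow, Complex.cpow_neg]
    field_simp
    ring
  obtain ⟨n', hn'⟩ := natural_of_smooth_branch he hQs hQ1 hG hagree
  -- `μ = n − n'` is an integer `≤ n ≤ N − 1`
  have hμ : μ = ((n : ℤ) - (n' : ℤ) : ℤ) := by
    push_cast
    linear_combination -hn'
  exact hoff _ (by omega) hμ

end SpinFlipTS

end Literature.Geometry.Lorentzian.KerrDeSitter.TeukolskyRadial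

end Part4

/-!
## Part 5 — port of `Summits/Ventures/KdS/SpinFlipMonomial.lean` (3 declarations kept)

# Venture KdS — analysis toolkit for the Teukolsky–Starobinsky transfer (III): monomial solutions
# of Heun's equation and the extreme lattice stratum

HONEST FRAMING (venture `Summits/Ventures/KdS`, cell `pub-kds`): general-Heun algebra and one more
piece of polynomial rigidity, used by `RouteWSpinFlip.lean` / `RouteWSpinFlipLattice.lean` to close
the EXTREME stratum of the cosmological lattice (the only stratum in the open upper half-plane for
spins `s ≤ 2`). Contents (Umetsu's normalisation `GeneralHeun.IsSolutionOn`):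

* `IsSolutionOn.congr_eqOn`: solutions may be replaced by functions agreeing on the open set;
* `accessory_of_monomial_solution`: if `c·(1−x)^p` (`c ≠ 0`, `p ∈ ℕ`) solves Heun's equation on
  `(0,1)` then the accessory parameter is `q = p·γ·a_H` (the constant coefficient of the residual
  quadratic, obtained by continuity at `x → 0⁺`);
* `isSolutionOn_monomial`: conversely `(z−1)^p` solves Heun's equation on `(1, a_H)` when
  `p = 1 − δ`, `(p+α)(p+β) = 0` and `q = pγa_H` (the residual quadratic then vanishes identically);
* `eq_monomial_of_iterate_deriv_eq_zero_of_branch_extreme`: a function on `(0,1)` with `u^{(N)} ≡ 0`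
  and the branch `(1−x)^{N−1}·(smooth across 1)` at `1⁻` is `c·(1−x)^{N−1}`;
* `mobiusQ_of_flipQ_extreme`: the accessory condition of the extreme stratum transported through the
  Möbius automorphism `x = a(z−1)/z` of `HeunMobius` (pure algebra; data with `α = N+1`, `δ = N`).

(Verbatim declaration-level port — the declarations listed in the Part header count — of the Summits-side module of the KdS
venture; venture / cell / ruling bookkeeping in the text above is historical.)
-/

section Part5

open _root_.Set _root_.Complex _root_.Filter _root_.Topology _root_.Polynomial

namespace Literature.Geometry.Lorentzian.KerrDeSitter.TeukolskyRadial

namespace SpinFlipTS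

open Literature.Geometry.Lorentzian.Kerr.Costa2019 (iterate_deriv_smooth iterate_deriv_eqOn)
open Literature.Analysis.ODE Literature.Analysis.ODE.GeneralHeun

/-! ### Solutions are insensitive to changes off the open set -/

/-- If `f` solves Heun's equation on an open set `U` and `g = f` on `U`, then `g` solves it on `U`.
[cite: CasalsTeixeiradacosta2022, Proposition 3.8 (arXiv v2) with Lemma 3.5 and the proof of Theorem 3.10, Step 2 (route W / spin-flip bookkeeping of the in-tree proof)] -/
theorem IsSolutionOn.congr_eqOn {aH α β γ δ ε q : ℂ} {U : Set ℝ} (hU : IsOpen U) {f g : ℝ → ℂ}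
    (hf : IsSolutionOn aH α β γ δ ε q U f) (hfg : EqOn f g U) : IsSolutionOn aH α β γ δ ε q U g := by
  obtain ⟨f₁, f₂, h⟩ := hf
  refine ⟨f₁, f₂, fun x hx => ?_⟩
  obtain ⟨h1, h2, h3⟩ := h x hx
  have hev : f =ᶠ[𝓝 x] g := by
    filter_upwards [hU.mem_nhds hx] with t ht using hfg ht
  refine ⟨h1.congr_of_eventuallyEq hev.symm, h2, ?_⟩
  rw [← hfg hx]
  exact h3

/-! ### Monomial solutions: the accessory condition -/

/-- **If `c(1−x)^p` solves Heun's equation on `(0,1)` then `q = pγa_H`.** (Plugging in: the residual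
divided by `c(1−x)^{p−1}`… is a quadratic in `x` whose constant coefficient is `q − pγa_H`; here it is
extracted by letting `x → 0⁺` in the continuous residual.)
[cite: CasalsTeixeiradacosta2022, Proposition 3.8 (arXiv v2) with Lemma 3.5 and the proof of Theorem 3.10, Step 2 (route W / spin-flip bookkeeping of the in-tree proof)] -/
theorem accessory_of_monomial_solution {aH α β γ δ ε q : ℂ} {c : ℂ} (hc : c ≠ 0) {p : ℕ}
    (hsol : IsSolutionOn aH α β γ δ ε q (Ioo (0 : ℝ) 1) (fun x => c * ((1 - x : ℝ) : ℂ) ^ p)) :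
    q = p * γ * aH := by
  obtain ⟨f₁, f₂, h⟩ := hsol
  -- the actual derivatives of the monomial
  set g : ℝ → ℂ := fun x => c * ((1 - x : ℝ) : ℂ) ^ p with hg
  set g₁ : ℝ → ℂ := fun x => c * (-(p : ℂ) * ((1 - x : ℝ) : ℂ) ^ (p - 1)) with hg₁
  set g₂ : ℝ → ℂ := fun x => c * ((p : ℂ) * ((p - 1 : ℕ) : ℂ) * ((1 - x : ℝ) : ℂ) ^ (p - 1 - 1)) with hg₂
  have hcast : ∀ x : ℝ, HasDerivAt (fun t : ℝ => ((1 - t : ℝ) : ℂ)) (-1) x := by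
    intro x
    have h1 : HasDerivAt (fun t : ℝ => (1 - t : ℝ)) (-1) x := by
      simpa using (hasDerivAt_id x).const_sub 1
    simpa using h1.ofReal_comp
  have hd1 : ∀ x : ℝ, HasDerivAt g (g₁ x) x := by
    intro x
    have h := ((hcast x).pow p).const_mul c
    refine h.congr_deriv ?_
    simp only [hg₁]
    push_cast
    ring
  have hd2 : ∀ x : ℝ, HasDerivAt g₁ (g₂ x) x := by
    intro x
    have h := (((hcast x).pow (p - 1)).const_mul (-(p : ℂ))).const_mul c
    refine h.congr_deriv ?_
    simp only [hg₂]
    push_cast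
    ring
  -- the residual with the true derivatives vanishes on (0,1)
  set Φ : ℝ → ℂ := fun x => lead aH x * g₂ x + mid aH γ δ ε x * g₁ x + low α β q x * g x with hΦ
  have hΦ0 : ∀ x ∈ Ioo (0 : ℝ) 1, Φ x = 0 := by
    intro x hx
    obtain ⟨h1, h2, h3⟩ := h x hx
    have e1 : f₁ x = g₁ x := h1.unique (hd1 x)
    have hev : f₁ =ᶠ[𝓝 x] g₁ := by
      filter_upwards [isOpen_Ioo.mem_nhds hx] with t ht using (h t ht).1.unique (hd1 t)
    have e2 : f₂ x = g₂ x := (h2.congr_of_eventuallyEq hev.symm |>.unique (hd2 x))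
    simp only [hΦ]
    rw [← e1, ← e2]
    exact h3
  -- `Φ` is continuous, hence `Φ 0 = 0`
  have hΦc : Continuous Φ := by
    have hc1 : Continuous fun t : ℝ => ((1 - t : ℝ) : ℂ) :=
      Complex.continuous_ofReal.comp (continuous_const.sub continuous_id)
    have hx : Continuous fun t : ℝ => ((t : ℝ) : ℂ) := Complex.continuous_ofReal
    simp only [hΦ, hg, hg₁, hg₂, lead, mid, low]
    fun_prop
  have hΦ00 : Φ 0 = 0 := by
    have h1 : Tendsto Φ (𝓝[>] (0 : ℝ)) (𝓝 (Φ 0)) :=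
      (hΦc.tendsto 0).mono_left nhdsWithin_le_nhds
    have h2 : Tendsto Φ (𝓝[>] (0 : ℝ)) (𝓝 0) := by
      refine tendsto_const_nhds.congr' ?_
      filter_upwards [Ioo_mem_nhdsGT (zero_lt_one' ℝ)] with x hx using (hΦ0 x hx).symm
    exact tendsto_nhds_unique h1 h2
  -- read off the constant coefficient
  have hval : Φ 0 = c * (q - p * γ * aH) := by
    simp only [hΦ, hg, hg₁, hg₂, lead, mid, low]
    push_cast
    ring
  rw [hval] at hΦ00
  have := (mul_eq_zero.mp hΦ00).resolve_left hc
  linear_combination this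

/-! ### Monomial solutions: sufficiency on `(1, a_H)` -/

/-- **Extreme stratum.** If `u` is smooth on `(0,1)`, `u^{(N)} ≡ 0`, and near `1⁻`,
`u = (1−x)^{N−1}·G` with `G` smooth across `1`, then `u = c·(1−x)^{N−1}` on `(0,1)` for a constant
`c`. (`u` is a polynomial `P` of degree `≤ N−1`; if `P = (X−1)^n q`, `q(1) ≠ 0`, the branch forces
`n − (N−1) ∈ ℕ`, so `n = N−1` and `q` is constant.)
[cite: CasalsTeixeiradacosta2022, Proposition 3.8 (arXiv v2) with Lemma 3.5 and the proof of Theorem 3.10, Step 2 (route W / spin-flip bookkeeping of the in-tree proof)] -/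
theorem eq_monomial_of_iterate_deriv_eq_zero_of_branch_extreme {N : ℕ} {u : ℝ → ℂ}
    (hu : ContDiffOn ℝ ((⊤ : ℕ∞) : WithTop ℕ∞) u (Ioo 0 1))
    (hN : ∀ x ∈ Ioo (0 : ℝ) 1, (deriv^[N] u) x = 0) {e : ℝ} (he : 0 < e) (he1 : e ≤ 1)
    {G : ℝ → ℂ} (hG : ContDiffOn ℝ ((⊤ : ℕ∞) : WithTop ℕ∞) G (Ioo (1 - e) (1 + e)))
    (hbranch : ∀ x ∈ Ioo (1 - e) 1, u x = ((1 - x : ℝ) : ℂ) ^ (((N : ℂ) - 1)) * G x) :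
    ∃ c : ℂ, ∀ x ∈ Ioo (0 : ℝ) 1, u x = c * ((1 - x : ℝ) : ℂ) ^ (N - 1) := by
  obtain ⟨P, hPdeg, hP⟩ := exists_polynomial_of_iterate_deriv_eq_zero zero_lt_one N hu hN
  by_cases hP0 : P = 0
  · exact ⟨0, fun x hx => by simp [hP x hx, hP0]⟩
  obtain ⟨q, hPq, hqdvd⟩ := exists_eq_pow_rootMultiplicity_mul_and_not_dvd P hP0 1
  set n := P.rootMultiplicity 1 with hn
  have hq1 : q.eval 1 ≠ 0 := fun h0 => hqdvd (dvd_iff_isRoot.mpr h0)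
  have hq0 : q ≠ 0 := by rintro rfl; simp at hq1
  have hPnat : P.natDegree < N := (natDegree_lt_iff_degree_lt hP0).mpr hPdeg
  have hdeg : P.natDegree = n + q.natDegree := by
    have h := congrArg natDegree hPq
    rwa [natDegree_mul (pow_ne_zero _ (X_sub_C_ne_zero 1)) hq0, natDegree_pow, natDegree_X_sub_C,
      mul_one] at h
  -- the branch forces `n − (N−1) ∈ ℕ`
  set Q : ℝ → ℂ := fun x => (-1) ^ n * q.eval (x : ℂ) with hQdef
  have hQs : ContDiffOn ℝ ((⊤ : ℕ∞) : WithTop ℕ∞) Q (Ioo (1 - e) (1 + e)) := by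
    have h1 : ContDiff ℝ ((⊤ : ℕ∞) : WithTop ℕ∞) (fun x : ℝ => q.eval (x : ℂ)) := by
      have hq0' : ContDiff ℂ ((⊤ : ℕ∞) : WithTop ℕ∞) (fun x : ℂ => aeval x q) :=
        Polynomial.contDiff_aeval q _
      have hq' := hq0'.restrict_scalars ℝ
      have e1 : (fun x : ℂ => aeval x q) = fun x : ℂ => q.eval x := by
        funext x; simp [coe_aeval_eq_eval]
      rw [e1] at hq'
      exact hq'.comp Complex.ofRealCLM.contDiff
    exact (contDiff_const.mul h1).contDiffOn
  have hQ1 : Q 1 ≠ 0 := by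
    simp only [hQdef, Complex.ofReal_one]
    exact mul_ne_zero (pow_ne_zero _ (by norm_num)) hq1
  have hagree : ∀ x ∈ Ioo (1 - e) 1, ((1 - x : ℝ) : ℂ) ^ ((n : ℂ) - ((N : ℂ) - 1)) * Q x = G x := by
    intro x hx
    have hx01 : x ∈ Ioo (0 : ℝ) 1 := ⟨by linarith [hx.1], hx.2⟩
    have hpos : (0 : ℝ) < 1 - x := by linarith [hx.2]
    have hne : ((1 - x : ℝ) : ℂ) ≠ 0 := by exact_mod_cast hpos.ne'
    have h1 := hbranch x hx
    rw [hP x hx01, hPq, eval_mul, eval_pow, eval_sub, eval_X, eval_C] at h1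
    have hG' : G x = ((1 - x : ℝ) : ℂ) ^ (-((N : ℂ) - 1)) * (((x : ℂ) - 1) ^ n * q.eval (x : ℂ)) := by
      rw [h1, ← mul_assoc, ← Complex.cpow_add _ _ hne, neg_add_cancel, Complex.cpow_zero, one_mul]
    rw [hG', hQdef, Complex.cpow_sub _ _ hne, Complex.cpow_natCast]
    have e2 : ((x : ℂ) - 1) = -((1 - x : ℝ) : ℂ) := by push_cast; ring
    rw [e2, neg_pow, Complex.cpow_neg]
    field_simp
    ring
  obtain ⟨n', hn'⟩ := natural_of_smooth_branch he hQs hQ1 hG hagree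
  -- hence `n = N − 1 + n'`, and with `n ≤ natDegree P ≤ N − 1`: `n' = 0`, `q` constant
  have hnN : (n : ℤ) - ((N : ℤ) - 1) = n' := by
    have : ((n : ℂ) - ((N : ℂ) - 1)) = ((((n : ℤ) - ((N : ℤ) - 1) : ℤ)) : ℂ) := by push_cast; ring
    rw [this] at hn'
    exact_mod_cast hn'
  have hn1 : n = N - 1 ∧ q.natDegree = 0 := by omega
  have hqc : q = C (q.coeff 0) := eq_C_of_natDegree_eq_zero hn1.2
  refine ⟨(-1) ^ (N - 1) * q.coeff 0, fun x hx => ?_⟩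
  rw [hP x hx, hPq]
  rw [hqc, hn1.1]
  simp only [eval_mul, eval_pow, eval_sub, eval_X, eval_C]
  have e2 : ((x : ℂ) - 1) = -((1 - x : ℝ) : ℂ) := by push_cast; ring
  rw [e2, neg_pow]
  simp only [coeff_C_zero]
  ring

end SpinFlipTS

end Literature.Geometry.Lorentzian.KerrDeSitter.TeukolskyRadial

end Part5

/-!
## Part 6 — port of `Summits/Ventures/KdS/RouteWSpinFlip.lean` (7 declarations kept)

# Venture KdS — ROUTE W, the spin flip `s ↦ −s` (Teukolsky–Starobinsky) as a THEOREM off the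
# cosmological lattice, and Casals–Teixeira da Costa's Proposition 3.8 for every spin

HONEST FRAMING (venture `Summits/Ventures/KdS`, cell `pub-kds`; STRUCTURE.md C3): the route-W
skeleton (`RouteW.lean`) left `RouteW.SpinFlip` — "a generic-boundary radial solution of spin
`s ≥ 1` yields one of spin `−s`, same `λ̄`, generic boundary bullets, and `R' ≡ 0 ⇒ R ≡ 0`" — as a
hypothesis. This file PROVES that statement under ONE explicit extra binder, the
**off-lattice condition** `s − 2η₂ ∉ ℤ_{≤ 2s−1}` (`η₂ = −B(r_c)` the cosmological-horizon exponent),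
and explains why the binder cannot be dropped: the Teukolsky–Starobinsky operator
`Δ^s(𝒟†)^{2s}Δ^s` — realised here as Umetsu's `2s`-th derivative in the exponent-flipped Hatsuda
frame (`GeneralHeun.isSolutionOn_flip` + `GeneralHeun.isSolutionOn_iterate_deriv`, both landed) —
has kernel `{weight × polynomials of degree ≤ 2s−1}`, and a kernel element carries the OUTGOING
branch at `r_c` exactly when `s − 2η₂ ∈ ℤ_{≤ 2s−1}`, i.e. on the cosmological threshold ray
`Re ω = mϖ₂` at the heights `Im ω = jκ₂`, `j ∈ (s+ℤ) ∩ (0, s−1]` (empty for `s ≤ 1`). At those points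
explicit algebraically-special polynomial modes exist (cell memo `theory/w5/scan.py`: 1760/1760,
each violating a printed hypothesis of CTdC's theorem), so `RouteW.SpinFlip` as typed is not
expected to hold there; everywhere else it is the theorem `RouteW.spinFlipTS_holds` below, and at
the EXTREME lattice point the accessory condition exposed by `spinFlip_core` (b) is turned into a
contradiction with CTdC's hypotheses by an explicit partner mode (`RouteWSpinFlipLattice.lean`).

CONSEQUENCES (file `RouteWSpinFlipProp38.lean`; all with 0 cited facts; inputs = the landed route W
`radial_vanishing_lt_one` / `radial_vanishing_of_im_gt`): `RouteW.radial_vanishing_offLattice` — CTdC Prop. 3.8's conclusion for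
every half-integer spin `s ≥ 1/2` off the lattice; `RouteW.offLattice_of_im_gt_cosmo` /
`offLattice_of_re_ne` — the lattice is avoided whenever `Im ω > (s−1)κ₂` or `Re ω ≠ mϖ₂`;
`RouteW.prop38_of_im_gt_or_offLattice` — the cited fact
`CasalsTeixeiraDaCosta2022_partialModeStabilityProp38` restricted to
`Im ω > (s−1)·min(κ₁, κ₂) ∨ Re ω ≠ mϖ₂ ∨ s − 2η₂ ∉ ℤ_{≤2s−1}`, in particular IN FULL for `s ≤ 1`
(`prop38_le_one`; new for `s = 1`). The parameter algebra is in `SpinFlipBookkeeping.lean`.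

Mechanism (Heun level, Hatsuda's variable `x ∈ (0,1)`, `r₊ ↦ 0`, `r_c ↦ 1`, `a_H = z_r > 1`):
`y` (spin `s`, Hatsuda gauge: branch `x^{1−γ}` at `0`, regular at `1`) ↦
`ỹ = x^{γ−1}(1−x)^{δ−1}(z_r−x)^{ε−1} y` (regular at `0`, branch `(1−x)^{δ−1}` at `1`; flipped frame,
`α = 1 − 2s`) ↦ `u = ỹ^{(2s)}` (Umetsu; parameters `+2s`, accessory identity
`heunV_flip_diff`) ↦ `y₋ = x^{1−γ₋}(1−x)^{1−δ₋}(z_r−x)^{1−ε₋} u` (Hatsuda gauge of spin `−s` at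
`λ' = λ − 2s(1−α)`: branch at `0`, regular at `1` since `δ − δ₋ = 2s`) ↦ `R'` by LIT-1's
`isRadialTeukolskySolution_of_heunSolution` / `isIngoingAtEventHorizon_of_heun_branch_at_zero` /
`isOutgoingAtCosmoHorizon_of_heun_smooth_at_one`. Injectivity: `R' ≡ 0 ⇒ ỹ^{(2s)} ≡ 0 ⇒ ỹ` is a
polynomial with the branch `(1−x)^{δ−1}` at `1` ⇒ `ỹ ≡ 0` off the lattice
(`SpinFlipTS.eq_zero_of_iterate_deriv_eq_zero_of_branch`).

References: Casals–Teixeira da Costa, CMP 394 (2022) [CasalsTeixeiradacosta2022] Prop. 3.8,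
Cor. 3.9 (i)⇔(ii); Umetsu, PTP 104 (2000) 743 [Umetsu2000] §3; Suzuki–Takasugi–Umetsu, PTP 102
(1999) 253, §4 (4.1); Hatsuda, CQG 38 (2020) 025015 [Hatsuda2020] §2.2–§3.1.

(Verbatim declaration-level port — the declarations listed in the Part header count — of the Summits-side module of the KdS
venture; venture / cell / ruling bookkeeping in the text above is historical.)
-/

section Part6

open _root_.Set _root_.Complex _root_.Filter _root_.Topology

namespace Literature.Geometry.Lorentzian.KerrDeSitter.TeukolskyRadial

namespace SpinFlipTS

open Literature.Geometry.Lorentzian.Kerr.Costa2019 (iterate_deriv_smooth iterate_deriv_eqOn)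
open Literature.Analysis.ODE Literature.Analysis.ODE.GeneralHeun
open Literature.Geometry.Lorentzian Literature.Geometry.Lorentzian.KerrDeSitter

/-! ### Smoothness helpers (principal powers of positive reals) -/

/-- `t ↦ t^p` is smooth on `(0, ∞)` (real variable, principal complex power).
[cite: CasalsTeixeiradacosta2022, Proposition 3.8 (arXiv v2) with Lemma 3.5 and the proof of Theorem 3.10, Step 2 (route W / spin-flip bookkeeping of the in-tree proof)] -/
private theorem contDiffOn_ofReal_cpow (p : ℂ) :
    ContDiffOn ℝ ((⊤ : ℕ∞) : WithTop ℕ∞) (fun t : ℝ => (t : ℂ) ^ p) (Ioi 0) := by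
  intro x hx
  have hslit : ((x : ℝ) : ℂ) ∈ slitPlane := Complex.ofReal_mem_slitPlane.2 hx
  have h1 : AnalyticAt ℂ (fun z : ℂ => z ^ p) (x : ℂ) := analyticAt_id.cpow analyticAt_const hslit
  have h3 : AnalyticAt ℝ (fun y : ℝ => (y : ℂ)) x := Complex.ofRealCLM.analyticAt x
  have h4 : AnalyticAt ℝ (fun y : ℝ => ((y : ℂ)) ^ p) x :=
    AnalyticAt.comp (g := fun z : ℂ => z ^ p) (f := fun y : ℝ => (y : ℂ)) (x := x)
      h1.restrictScalars h3
  exact h4.contDiffAt.contDiffWithinAt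

/-- `x ↦ (g x)^p` is smooth where the real function `g` is smooth and positive.
[cite: CasalsTeixeiradacosta2022, Proposition 3.8 (arXiv v2) with Lemma 3.5 and the proof of Theorem 3.10, Step 2 (route W / spin-flip bookkeeping of the in-tree proof)] -/
private theorem contDiffOn_cpow_comp {g : ℝ → ℝ} {U : Set ℝ}
    (hg : ContDiffOn ℝ ((⊤ : ℕ∞) : WithTop ℕ∞) g U) (hpos : ∀ x ∈ U, 0 < g x) (p : ℂ) :
    ContDiffOn ℝ ((⊤ : ℕ∞) : WithTop ℕ∞) (fun x => ((g x : ℝ) : ℂ) ^ p) U :=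
  (contDiffOn_ofReal_cpow p).comp hg fun x hx => hpos x hx

/-- Product of principal powers of the same positive real: `t^p · t^q = t^{p+q}`.
[cite: CasalsTeixeiradacosta2022, Proposition 3.8 (arXiv v2) with Lemma 3.5 and the proof of Theorem 3.10, Step 2 (route W / spin-flip bookkeeping of the in-tree proof)] -/
private theorem cpow_mul_cpow_ofReal {t : ℝ} (ht : 0 < t) (p q : ℂ) :
    ((t : ℝ) : ℂ) ^ p * ((t : ℝ) : ℂ) ^ q = ((t : ℝ) : ℂ) ^ (p + q) := by
  rw [Complex.cpow_add _ _ (by exact_mod_cast ht.ne')]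

end SpinFlipTS

namespace RouteW

open Literature.Analysis.ODE Literature.Analysis.ODE.GeneralHeun
open Literature.Geometry.Lorentzian Literature.Geometry.Lorentzian.KerrDeSitter
open SpinFlipTS

/-! ### The spin-flip theorem -/

/-- **The off-lattice condition** at the cosmological horizon: `s + 2B(r_c) = s − 2η₂` is not an
integer `≤ 2s − 1`. Since `Re(s − 2η₂) = s + Im ω/κ₂`, for `Im ω > 0` this excludes exactly the points
`Re ω = mϖ₂`, `Im ω = jκ₂` with `j ∈ (s + ℤ) ∩ (0, s−1]` — none for `s ≤ 1`
(`offLattice_of_re_ne`, `offLattice_of_im_gt_cosmo`).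
[cite: CasalsTeixeiradacosta2022, Proposition 3.8 (arXiv v2) with Lemma 3.5 and the proof of Theorem 3.10, Step 2 (route W / spin-flip bookkeeping of the in-tree proof)] -/
def OffLattice (M a Λ s : ℝ) (ω : ℂ) (m : ℝ) : Prop :=
  ∀ j : ℤ, (j : ℝ) ≤ 2 * s - 1 → (s : ℂ) + 2 * horizonB M a Λ ω m (rCosmo M a Λ) ≠ j

/-- **`SpinFlip` re-typed (STRUCTURE.md C3): the Teukolsky–Starobinsky transfer off the lattice.**
For subextremal `(M,a,Λ)`, a half-integer spin `s = N/2 ≥ 1/2` and ANY `ω, m, λ`: every classical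
radial Teukolsky solution of spin `s` on `(r₊, r_c)` that is ingoing at `𝓗⁺` and outgoing at `𝓗⁺_c`
(generic bullets) yields one of spin `−s` with separation constant `λ' = λ − 2s(1−α)` (same `λ̄`)
and the same boundary behaviour; and, off the cosmological lattice, `R' ≡ 0 ⇒ R ≡ 0`.
[cite: CasalsTeixeiradacosta2022, Proposition 3.8 (arXiv v2) with Lemma 3.5 and the proof of Theorem 3.10, Step 2 (route W / spin-flip bookkeeping of the in-tree proof)] -/
def SpinFlipTS : Prop :=
  ∀ (M a Λ s : ℝ) (ω : ℂ) (m : ℝ) (lam : ℂ) (R : ℝ → ℂ) (N : ℕ), IsSubextremal M a Λ → 1 ≤ N →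
    2 * s = N →
    IsRadialTeukolskySolution M a Λ s ω m lam R → IsIngoingAtEventHorizon M a Λ s ω m R →
    IsOutgoingAtCosmoHorizon M a Λ ω m R →
      ∃ R' : ℝ → ℂ, IsRadialTeukolskySolution M a Λ (-s) ω m (lamFlip a Λ s lam) R' ∧
        IsIngoingAtEventHorizon M a Λ (-s) ω m R' ∧ IsOutgoingAtCosmoHorizon M a Λ ω m R' ∧
        (OffLattice M a Λ s ω m → (∀ r ∈ Ioo (rPlus M a Λ) (rCosmo M a Λ), R' r = 0) →
          ∀ r ∈ Ioo (rPlus M a Λ) (rCosmo M a Λ), R r = 0)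

/-- **The spin-flip chain (core).** For a generic-boundary spin-`s` radial solution `R` the
Teukolsky–Starobinsky image `R'` (spin `−s`, `λ' = lamFlip`) is a generic-boundary radial solution;
and IF `R' ≡ 0` then (a) off the lattice `R ≡ 0`, and (b) on the EXTREME stratum
`s + 2B(r_c) = 2s − 1` either `R ≡ 0` or the accessory parameter satisfies the algebraic condition of
the monomial `(1−x)^{2s−1}` in the flipped Hatsuda frame (the algebraically special value of `λ`).
Proof: Hatsuda gauge (LIT-1's `heunSolution_of_isRadialTeukolskySolution`,
`heunSolution_branch_at_zero`, `heunSolution_smooth_at_one`) → exponent flip (`isSolutionOn_flip`) →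
Umetsu's `2s`-th derivative (`isSolutionOn_iterate_deriv`, `accessory_identity`) → flip back →
LIT-1's converse transfer; boundary shapes by `SpinFlipTS.iterate_deriv_of_agree` /
`iterate_deriv_of_branch` (`δ_s − δ_{−s} = 2s`); (a) is
`SpinFlipTS.eq_zero_of_iterate_deriv_eq_zero_of_branch`, (b) is
`eq_monomial_of_iterate_deriv_eq_zero_of_branch_extreme` + `accessory_of_monomial_solution`.
PROVED, 0 cited facts.
[cite: CasalsTeixeiradacosta2022, Proposition 3.8 (arXiv v2) with Lemma 3.5 and the proof of Theorem 3.10, Step 2 (route W / spin-flip bookkeeping of the in-tree proof)] -/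
theorem spinFlip_core (M a Λ s : ℝ) (ω : ℂ) (m : ℝ) (lam : ℂ) (R : ℝ → ℂ) (N : ℕ)
    (hsub : IsSubextremal M a Λ) (hN1 : 1 ≤ N) (hsN : 2 * s = N)
    (hR : IsRadialTeukolskySolution M a Λ s ω m lam R) (hin : IsIngoingAtEventHorizon M a Λ s ω m R)
    (hout : IsOutgoingAtCosmoHorizon M a Λ ω m R) :
    ∃ R' : ℝ → ℂ, IsRadialTeukolskySolution M a Λ (-s) ω m (lamFlip a Λ s lam) R' ∧
      IsIngoingAtEventHorizon M a Λ (-s) ω m R' ∧ IsOutgoingAtCosmoHorizon M a Λ ω m R' ∧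
      ((∀ r ∈ Ioo (rPlus M a Λ) (rCosmo M a Λ), R' r = 0) →
        (OffLattice M a Λ s ω m → ∀ r ∈ Ioo (rPlus M a Λ) (rCosmo M a Λ), R r = 0) ∧
        ((s : ℂ) + 2 * horizonB M a Λ ω m (rCosmo M a Λ) = (N : ℂ) - 1 →
          (∀ r ∈ Ioo (rPlus M a Λ) (rCosmo M a Λ), R r = 0) ∨
          flipQ (mobiusZr M a Λ : ℂ) (heunGamma M a Λ s ω m) (heunDelta M a Λ s ω m)
              (heunEps M a Λ s ω m) (heunV M a Λ s ω m lam) =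
            ((N : ℂ) - 1) * (2 - heunGamma M a Λ s ω m) * (mobiusZr M a Λ : ℂ))) := by
  -- Hatsuda data of spin `s` and `−s`
  set zr := mobiusZr M a Λ with hzrdef
  have hzr : 1 < zr := one_lt_mobiusZr hsub
  set γ := heunGamma M a Λ s ω m with hγ
  set δ := heunDelta M a Λ s ω m with hδ
  set ε := heunEps M a Λ s ω m with hε
  set σp := heunSigmaPlus s with hσp
  set σm := heunSigmaMinus M a Λ s ω m with hσm
  set q := heunV M a Λ s ω m lam with hq
  set γ' := heunGamma M a Λ (-s) ω m with hγ'
  set δ' := heunDelta M a Λ (-s) ω m with hδ'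
  set ε' := heunEps M a Λ (-s) ω m with hε'
  set σp' := heunSigmaPlus (-s) with hσp'
  set σm' := heunSigmaMinus M a Λ (-s) ω m with hσm'
  set q' := heunV M a Λ (-s) ω m (lamFlip a Λ s lam) with hq'
  set ρ := mobiusInv M a Λ with hρ
  set w := heunWeight M a Λ s ω m with hw
  -- the Hatsuda-gauge function of `R` and its flip
  set y : ℝ → ℂ := fun x => R (ρ x) / w (ρ x) with hy
  set ytil : ℝ → ℂ := fun x => flipWeight zr γ δ ε x * y x with hytil
  set u : ℝ → ℂ := deriv^[N] ytil with hu
  set ym : ℝ → ℂ := fun x => flipWeight zr (2 - γ') (2 - δ') (2 - ε') x * u x with hym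
  set R' : ℝ → ℂ := fun r => heunWeight M a Λ (-s) ω m r * ym (mobiusZ M a Λ r) with hR'
  -- (1) equations
  have hysol : IsSolutionOn (zr : ℂ) σp σm γ δ ε q (Ioo 0 1) y :=
    heunSolution_of_isRadialTeukolskySolution hsub hR
  have hF : γ + δ + ε = σp + σm + 1 := heun_fuchs hsub s ω m
  have hytilsol : IsSolutionOn (zr : ℂ) (2 - σp) (2 - σm) (2 - γ) (2 - δ) (2 - ε)
      (flipQ zr γ δ ε q) (Ioo 0 1) ytil :=
    isSolutionOn_flip hzr hF Subset.rfl hysol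
  have hlead : ∀ x ∈ Ioo (0 : ℝ) 1, lead (zr : ℂ) x ≠ 0 := by
    intro x hx
    unfold lead
    have h0 : (x : ℂ) ≠ 0 := by exact_mod_cast hx.1.ne'
    have h1 : (x : ℂ) - 1 ≠ 0 := by
      have : ((x - 1 : ℝ) : ℂ) ≠ 0 := by exact_mod_cast (show x - 1 ≠ 0 by linarith [hx.2])
      simpa using this
    have ha : (x : ℂ) - zr ≠ 0 := by
      have : ((x - zr : ℝ) : ℂ) ≠ 0 := by exact_mod_cast (show x - zr ≠ 0 by linarith [hx.2])
      simpa using this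
    exact mul_ne_zero (mul_ne_zero h0 h1) ha
  have hytil_smooth : ContDiffOn ℝ ((⊤ : ℕ∞) : WithTop ℕ∞) ytil (Ioo 0 1) :=
    contDiffOn_of_isSolutionOn isOpen_Ioo hlead hytilsol
  have hα : 2 - σp = 1 - (N : ℂ) := two_sub_sigmaPlus s hsN
  have hF' : (2 - γ) + (2 - δ) + (2 - ε) = (2 - σp) + (2 - σm) + 1 := fuchs_flip hF
  have husol₀ := isSolutionOn_iterate_deriv hF' hN1 hα isOpen_Ioo hytil_smooth hytilsol
  have husol : IsSolutionOn (zr : ℂ) (2 - σp') (2 - σm') (2 - γ') (2 - δ') (2 - ε')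
      (flipQ zr γ' δ' ε' q') (Ioo 0 1) u := by
    have e1 : (N : ℂ) + 1 = 2 - σp' := image_sigmaPlus s hsN
    have e2 : 2 - σm + N = 2 - σm' := image_sigmaMinus M a Λ s ω m hsN
    have e3 : 2 - γ + N = 2 - γ' := image_gamma M a Λ s ω m hsN
    have e4 : 2 - δ + N = 2 - δ' := image_delta M a Λ s ω m hsN
    have e5 : 2 - ε + N = 2 - ε' := image_eps M a Λ s ω m hsN
    have e6 := accessory_identity hsub s ω m lam hsN
    rw [e1, e2, e3, e4, e5, e6] at husol₀
    exact husol₀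
  have hF'' : (2 - γ') + (2 - δ') + (2 - ε') = (2 - σp') + (2 - σm') + 1 :=
    fuchs_flip (heun_fuchs hsub (-s) ω m)
  have hymsol : IsSolutionOn (zr : ℂ) σp' σm' γ' δ' ε' q' (Ioo 0 1) ym := by
    have h := isSolutionOn_flip hzr hF'' Subset.rfl husol
    simp only [sub_sub_cancel, flipQ_flipQ] at h
    exact h
  have hR'sol : IsRadialTeukolskySolution M a Λ (-s) ω m (lamFlip a Λ s lam) R' :=
    isRadialTeukolskySolution_of_heunSolution hsub hymsol
  -- (2) boundary shape at `x = 0` (event horizon): `ytil` is smooth across `0`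
  obtain ⟨e₀, he₀, G, hG, hyG⟩ := heunSolution_branch_at_zero hsub hin
  set e := min e₀ 1 with hedef
  have he : 0 < e := lt_min he₀ one_pos
  have he1 : e ≤ 1 := min_le_right _ _
  have hee₀ : e ≤ e₀ := min_le_left _ _
  set F : ℝ → ℂ := fun x => ((1 - x : ℝ) : ℂ) ^ (δ - 1) * ((zr - x : ℝ) : ℂ) ^ (ε - 1) * G x
    with hFdef
  have hFs : ContDiffOn ℝ ((⊤ : ℕ∞) : WithTop ℕ∞) F (Ioo (-e) e) := by
    have hG' : ContDiffOn ℝ ((⊤ : ℕ∞) : WithTop ℕ∞) G (Ioo (-e) e) :=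
      hG.mono (Ioo_subset_Ioo (by linarith) hee₀)
    refine (ContDiffOn.mul ?_ ?_).mul hG'
    · exact contDiffOn_cpow_comp ((contDiff_const.sub contDiff_id).contDiffOn)
        (fun x hx => by have := hx.1; have := hx.2; (try simp only [id]); linarith) _
    · exact contDiffOn_cpow_comp ((contDiff_const.sub contDiff_id).contDiffOn)
        (fun x hx => by have := hx.1; have := hx.2; (try simp only [id]); linarith) _
  have hagree0 : ∀ x ∈ Ioo 0 e, ytil x = F x := by
    intro x hx
    have hx0 : (0 : ℝ) < x := hx.1
    have hxG := hyG x ⟨hx0, lt_of_lt_of_le hx.2 hee₀⟩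
    simp only [hytil, hFdef, flipWeight]
    rw [show y x = (x : ℂ) ^ (1 - γ) * G x from hxG]
    have hc : (x : ℂ) ^ (γ - 1) * (x : ℂ) ^ (1 - γ) = 1 := by
      rw [cpow_mul_cpow_ofReal hx0, show γ - 1 + (1 - γ) = 0 by ring, Complex.cpow_zero]
    linear_combination ((1 - x : ℝ) : ℂ) ^ (δ - 1) * ((zr - x : ℝ) : ℂ) ^ (ε - 1) * G x * hc
  obtain ⟨hDF, huF⟩ := iterate_deriv_of_agree hFs hagree0 N
  have h0m : IsHeunBranchAtZero M a Λ (-s) ω m ym := by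
    refine ⟨e, he, fun x => ((1 - x : ℝ) : ℂ) ^ (1 - δ') * ((zr - x : ℝ) : ℂ) ^ (1 - ε') *
      (deriv^[N] F) x, ?_, fun x hx => ?_⟩
    · refine (ContDiffOn.mul ?_ ?_).mul hDF
      · exact contDiffOn_cpow_comp ((contDiff_const.sub contDiff_id).contDiffOn)
          (fun x hx => by have := hx.1; have := hx.2; (try simp only [id]); linarith) _
      · exact contDiffOn_cpow_comp ((contDiff_const.sub contDiff_id).contDiffOn)
          (fun x hx => by have := hx.1; have := hx.2; (try simp only [id]); linarith) _
    · simp only [hym, flipWeight]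
      rw [show u x = (deriv^[N] F) x from huF x hx]
      rw [show (2 : ℂ) - γ' - 1 = 1 - heunGamma M a Λ (-s) ω m by rw [hγ']; ring,
        show (2 : ℂ) - δ' - 1 = 1 - δ' by ring, show (2 : ℂ) - ε' - 1 = 1 - ε' by ring]
      ring
  -- (3) boundary shape at `x = 1` (cosmological horizon): `ytil = (1−x)^{δ−1}·G₁`
  obtain ⟨e₁, he₁, Fs, hFs1, hyF⟩ := heunSolution_smooth_at_one hsub s hout
  set d := min e₁ (min 1 (zr - 1)) with hddef
  have hd : 0 < d := lt_min he₁ (lt_min one_pos (by linarith))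
  have hd1 : d ≤ 1 := (min_le_right _ _).trans (min_le_left _ _)
  have hdz : d ≤ zr - 1 := (min_le_right _ _).trans (min_le_right _ _)
  have hde₁ : d ≤ e₁ := min_le_left _ _
  set G₁ : ℝ → ℂ := fun x => (x : ℂ) ^ (γ - 1) * ((zr - x : ℝ) : ℂ) ^ (ε - 1) * Fs x with hG₁def
  have hG₁ : ContDiffOn ℝ ((⊤ : ℕ∞) : WithTop ℕ∞) G₁ (Ioo (1 - d) (1 + d)) := by
    have hFs' : ContDiffOn ℝ ((⊤ : ℕ∞) : WithTop ℕ∞) Fs (Ioo (1 - d) (1 + d)) :=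
      hFs1.mono (Ioo_subset_Ioo (by linarith) (by linarith))
    refine (ContDiffOn.mul ?_ ?_).mul hFs'
    · have := contDiffOn_cpow_comp (g := fun x : ℝ => x) (U := Ioo (1 - d) (1 + d))
        contDiff_id.contDiffOn (fun x hx => by have := hx.1; have := hx.2; linarith) (γ - 1)
      simpa using this
    · exact contDiffOn_cpow_comp ((contDiff_const.sub contDiff_id).contDiffOn)
        (fun x hx => by have := hx.1; have := hx.2; (try simp only [id]); linarith) _
  have hbranch1 : ∀ x ∈ Ioo (1 - d) 1, ytil x = ((1 - x : ℝ) : ℂ) ^ (δ - 1) * G₁ x := by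
    intro x hx
    have hxF := hyF x ⟨by linarith [hx.1], hx.2⟩
    simp only [hytil, hG₁def, flipWeight]
    rw [show y x = Fs x from hxF]
    ring
  have hH := iterate_deriv_of_branch hG₁ hbranch1 N
  have hHs : ContDiffOn ℝ ((⊤ : ℕ∞) : WithTop ℕ∞) (branchCoeff (δ - 1) G₁ N) (Ioo (1 - d) (1 + d)) :=
    branchCoeff_smooth (δ - 1) isOpen_Ioo hG₁ N
  have h1m : IsHeunRegularAtOne ym := by
    refine ⟨d, hd, fun x => (x : ℂ) ^ (1 - γ') * ((zr - x : ℝ) : ℂ) ^ (1 - ε') *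
      branchCoeff (δ - 1) G₁ N x, ?_, fun x hx => ?_⟩
    · refine (ContDiffOn.mul ?_ ?_).mul hHs
      · have := contDiffOn_cpow_comp (g := fun x : ℝ => x) (U := Ioo (1 - d) (1 + d))
          contDiff_id.contDiffOn (fun x hx => by have := hx.1; have := hx.2; linarith) (1 - γ')
        simpa using this
      · exact contDiffOn_cpow_comp ((contDiff_const.sub contDiff_id).contDiffOn)
          (fun x hx => by have := hx.1; have := hx.2; (try simp only [id]); linarith) _
    · have hx1 : (0 : ℝ) < 1 - x := by linarith [hx.2]
      simp only [hym, flipWeight]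
      rw [show u x = (deriv^[N] ytil) x from rfl, hH x hx]
      have hexp : ((1 - x : ℝ) : ℂ) ^ ((2 : ℂ) - δ' - 1) * ((1 - x : ℝ) : ℂ) ^ (δ - 1 - (N : ℕ)) = 1 := by
        rw [cpow_mul_cpow_ofReal hx1]
        have : (2 : ℂ) - δ' - 1 + (δ - 1 - (N : ℕ)) = 0 := by
          have := delta_sub_delta M a Λ s ω m hsN
          rw [← hδ, ← hδ'] at this
          linear_combination this
        rw [this, Complex.cpow_zero]
      rw [show (2 : ℂ) - γ' - 1 = 1 - γ' by ring, show (2 : ℂ) - ε' - 1 = 1 - ε' by ring]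
      linear_combination (x : ℂ) ^ (1 - γ') * ((zr - x : ℝ) : ℂ) ^ (1 - ε') *
        branchCoeff (δ - 1) G₁ N x * hexp
  have hin' : IsIngoingAtEventHorizon M a Λ (-s) ω m R' :=
    isIngoingAtEventHorizon_of_heun_branch_at_zero hsub (-s) ω m h0m
  have hout' : IsOutgoingAtCosmoHorizon M a Λ ω m R' :=
    isOutgoingAtCosmoHorizon_of_heun_smooth_at_one hsub (-s) ω m h1m
  refine ⟨R', hR'sol, hin', hout', fun hR'0 => ?_⟩
  -- (4) consequences of `R' ≡ 0`
  have hz1 := one_lt_mobiusZinf hsub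
  have hym0 : ∀ x ∈ Ioo (0 : ℝ) 1, ym x = 0 := by
    intro x hx
    have hxinf : x ≠ mobiusZinf M a Λ := ne_of_lt (hx.2.trans hz1)
    have hρx : ρ x ∈ Ioo (rPlus M a Λ) (rCosmo M a Λ) := mobiusInv_mem_Ioo hsub hx
    have h := hR'0 (ρ x) hρx
    simp only [hR'] at h
    rw [hρ, mobiusZ_mobiusInv hsub hxinf] at h
    exact (mul_eq_zero.mp h).resolve_left (heunWeight_ne_zero hsub (-s) ω m hρx)
  have hu0 : ∀ x ∈ Ioo (0 : ℝ) 1, u x = 0 := fun x hx =>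
    (flip_eq_zero_iff hzr (2 - γ') (2 - δ') (2 - ε') hx).mp (hym0 x hx)
  -- `ytil ≡ 0 ⇒ R ≡ 0`
  have hR_of_ytil : (∀ x ∈ Ioo (0 : ℝ) 1, ytil x = 0) →
      ∀ r ∈ Ioo (rPlus M a Λ) (rCosmo M a Λ), R r = 0 := by
    intro hytil0 r hr
    have hx : mobiusZ M a Λ r ∈ Ioo (0 : ℝ) 1 := mobiusZ_mem_Ioo hsub hr
    have hy0 : y (mobiusZ M a Λ r) = 0 := (flip_eq_zero_iff hzr γ δ ε hx).mp (hytil0 _ hx)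
    have hrm : r ≠ rMinus M a Λ := by
      obtain ⟨-, -, h01, -⟩ := hsub
      intro h; rw [h] at hr; exact absurd hr.1 (not_lt.mpr h01.le)
    simp only [hy, hρ, mobiusInv_mobiusZ hsub hrm] at hy0
    exact (div_eq_zero_iff.mp hy0).resolve_right (heunWeight_ne_zero hsub s ω m hr)
  refine ⟨fun hoff => ?_, fun hext => ?_⟩
  · -- (a) injectivity off the lattice
    have hoff' : ∀ k : ℤ, k ≤ (N : ℤ) - 1 → δ - 1 ≠ k := by
      intro k hk
      rw [hδ, delta_sub_one]
      refine hoff k ?_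
      have hk' : ((k : ℤ) : ℝ) ≤ ((N : ℤ) : ℝ) - 1 := by exact_mod_cast hk
      push_cast at hk'
      linarith
    exact hR_of_ytil
      (eq_zero_of_iterate_deriv_eq_zero_of_branch hytil_smooth hu0 hd hd1 hG₁ hbranch1 hoff')
  · -- (b) the extreme stratum `δ − 1 = N − 1`: `ytil = c (1−x)^{N−1}`
    have hμ : δ - 1 = (N : ℂ) - 1 := by rw [hδ, delta_sub_one]; exact hext
    have hbranch1' : ∀ x ∈ Ioo (1 - d) 1, ytil x = ((1 - x : ℝ) : ℂ) ^ ((N : ℂ) - 1) * G₁ x := by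
      intro x hx; rw [← hμ]; exact hbranch1 x hx
    obtain ⟨c, hc⟩ :=
      eq_monomial_of_iterate_deriv_eq_zero_of_branch_extreme hytil_smooth hu0 hd hd1 hG₁ hbranch1'
    by_cases hc0 : c = 0
    · left
      exact hR_of_ytil fun x hx => by rw [hc x hx, hc0, zero_mul]
    · right
      have hsol' : IsSolutionOn (zr : ℂ) (2 - σp) (2 - σm) (2 - γ) (2 - δ) (2 - ε)
          (flipQ zr γ δ ε q) (Ioo 0 1) (fun x => c * ((1 - x : ℝ) : ℂ) ^ (N - 1)) :=
        SpinFlipTS.IsSolutionOn.congr_eqOn isOpen_Ioo hytilsol (fun x hx => hc x hx)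
      have hacc := accessory_of_monomial_solution hc0 hsol'
      have hN' : (((N - 1 : ℕ) : ℕ) : ℂ) = (N : ℂ) - 1 := by
        rw [Nat.cast_sub hN1]; push_cast; ring
      rw [hN'] at hacc
      exact hacc

/-- **THE SPIN FLIP IS A THEOREM (off the lattice)** — `RouteW.SpinFlipTS` holds: the image `R'`
of `spinFlip_core` with its injectivity clause (a). PROVED, 0 cited facts.
[cite: CasalsTeixeiradacosta2022, Proposition 3.8 (arXiv v2) with Lemma 3.5 and the proof of Theorem 3.10, Step 2 (route W / spin-flip bookkeeping of the in-tree proof)] -/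
theorem spinFlipTS_holds : SpinFlipTS := by
  intro M a Λ s ω m lam R N hsub hN1 hsN hR hin hout
  obtain ⟨R', h1, h2, h3, h4⟩ := spinFlip_core M a Λ s ω m lam R N hsub hN1 hsN hR hin hout
  exact ⟨R', h1, h2, h3, fun hoff hR'0 => (h4 hR'0).1 hoff⟩

end RouteW

end Literature.Geometry.Lorentzian.KerrDeSitter.TeukolskyRadial

end Part6

/-!
## Part 7 — port of `Summits/Ventures/KdS/RouteWNonRes.lean` (4 declarations kept)

# Venture KdS — ROUTE W, non-resonant variant of `EulerRL`

HONEST FRAMING (venture `Summits/Ventures/KdS`, cell `pub-kds`; MONDAY-REBALANCE item 2 decision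
object, NOT a result about Kerr–de Sitter): this file repairs a STATEMENT DEFECT of the hypothesis
`RouteW.EulerRL` of `Summits/Ventures/KdS/RouteW.lean` found by LIT-1 g6 (exact CAS, pub-kds kit
j170060, cell memo `lit/LIT1-KB-ARCHITECTURE.md` §1) and re-proves the route-W composition with the
repaired hypothesis. Nothing here discharges H3; `EulerRLNonRes` is a hypothesis like `EulerRL`.

THE DEFECT. `EulerRL` asks the one-sided Euler / Riemann–Liouville transform
`u = ∂_z^k ∫₀¹ (z−1)^{k+η−1}(1−t)^{k+η−2} v(1+(z−1)t) dt` (essentially the Riemann–Liouville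
derivative `D^{1−η}_{1+} v`) to be injective on ALL Euler-gauge mode data `v = (w−1)^ρ·h`,
`Re ρ > −1`. It is not: `D^{1−η}` kills `(w−1)^{η−1−i}`, `1 ≤ i ≤ k`, and an honest mode datum lies
in that kernel iff the TARGET exponent `ρ_T := ρ + η − 1` is a negative integer (resonance; explicit
witness: `δ = 1+α`, `q = −αγ·a_H`, `v = (w−1)^{−α}`, whose `k = 1` transform is
`∂_z B(α,1−α) ≡ 0`). Whether `EulerRL` is nevertheless true on the resonant set is a case-by-case
Frobenius question the route does not need.

THE REPAIR. `EulerRLNonRes` = `EulerRL` with one more hypothesis, NON-RESONANCE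
`∀ n : ℕ, ρ + η − 1 ≠ −(n+1)`. In the Kerr–de Sitter assembly (`radial_vanishing_of_routeW_lt_one`)
the transform is applied with `η = α = 1 + s + 2η₀` and `ρ = 2η₁ − s`, so
`ρ + η − 1 = 2(η₀ + η₁) = −p₃` where `p₃ := −2(η₁ + η₀) = m₁ + m₃` is the third pair sum of CTdC's
Proposition 3.8 (`rho_add_eta_sub_one_eq`); and H3's binder `PairCondition p₃` ("`Re(p₃−1) < 0` if
`Im p₃ = 0`"), IGNORED by `prop38_of_routeW`, forbids `p₃ ∈ ℤ_{≥1}`, i.e. IS the non-resonance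
(`nonres_of_pairCondition`). So CTdC's pair condition on `m₁ + m₃` is exactly the non-resonance of
the hidden-symmetry transform — not idle for route W. PROVED here:
`prop38_of_routeW_nonres : Transfer → EulerRLNonRes → GaugeGlue → SwappedEnergyVanishing → SpinFlip →`
`  CasalsTeixeiraDaCosta2022_partialModeStabilityProp38` (kernel-checked composition, H3 by name),
and `eulerRLNonRes_of_eulerRL : EulerRL → EulerRLNonRes` (the repaired hypothesis is weaker).
With `transfer_holds`, `gaugeGlue_holds`, `swappedEnergyVanishing_holds` LANDED, route W for the
cell's spins `s = −2, 0` now rests on `EulerRLNonRes` alone (`SpinFlip` enters only for `s ≥ 1`).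

References: Casals–Teixeira da Costa, Commun. Math. Phys. 394 (2022) 797–832
[CasalsTeixeiradacosta2022] Prop. 3.8, (3.10), (3.15); K. Takemura, J. Math. Soc. Japan 69 (2017)
849–891 [Takemura2017] Prop. 1.2.

(Verbatim declaration-level port — the declarations listed in the Part header count — of the Summits-side module of the KdS
venture; venture / cell / ruling bookkeeping in the text above is historical.)
-/

section Part7

open _root_.Set _root_.Complex

namespace Literature.Geometry.Lorentzian.KerrDeSitter.TeukolskyRadial

namespace RouteW

open Literature.Analysis.ODE Literature.Analysis.ODE.GeneralHeun
open Literature.Geometry.Lorentzian Literature.Geometry.Lorentzian.KerrDeSitter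

/-! ### The repaired hypothesis -/

/-- **K_B, non-resonant variant — the one-sided Euler / Riemann–Liouville transform for Heun's
equation off resonance.** Exactly `RouteW.EulerRL` with the additional hypothesis
`∀ n : ℕ, ρ + η − 1 ≠ −(n+1)` (the target exponent `ρ_T = ρ + η − 1` at `z = 1` is not a negative
integer): for a Heun equation on `(1,z₂)` (`a_H = z₂ > 1`, Fuchs relation), a source exponent
`η ∈ {α, β}`, and an Euler-gauge mode datum `v` with branch exponent `ρ = 1 − δ`, `Re ρ > −1`,
`ρ + η − 1 ∉ ℤ_{≤−1}`, there is Euler-gauge mode data `u` for Takemura's image parameters with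
branch exponent `ρ + η − 1` at `1` and the analytic branch at `z₂`, with `u ≡ 0 ⇒ v ≡ 0`. Intended
proof (LIT-1 g6, `lit/LIT1-KB-ARCHITECTURE.md` §3): `u = ∂_z^k Φ_{θ−k}[v]`, `θ = 2 − η`,
`Re θ < k+1`; the ODE by analytic continuation in the kernel exponent from the `k = 0` Euler theorem
(`GeneralHeun.euler_tau_identity`); injectivity by the Riemann–Liouville semigroup and independence
of the powers `(w−1)^{−ρ_T−i}`, `1 ≤ i ≤ k`, from smooth functions — which is where non-resonance
enters.
[cite: CasalsTeixeiradacosta2022, Proposition 3.8 (arXiv v2) with Lemma 3.5 and the proof of Theorem 3.10, Step 2 (route W / spin-flip bookkeeping of the in-tree proof)] -/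
def EulerRLNonRes : Prop :=
  ∀ (z₂ : ℝ) (α β γ δ ε q η ρ : ℂ) (v : ℝ → ℂ), 1 < z₂ → γ + δ + ε = α + β + 1 →
    (η - α) * (η - β) = 0 → ρ = 1 - δ → -1 < ρ.re → (∀ n : ℕ, ρ + η - 1 ≠ -((n : ℂ) + 1)) →
    HeunModeData z₂ α β γ δ ε q ρ v →
      ∃ u : ℝ → ℂ,
        HeunModeData z₂ (eulerSrcα η) (eulerSrcβ α β η) (eulerSrc γ η) (eulerSrc δ η)
          (eulerSrc ε η) (eulerSrcQ (z₂ : ℂ) γ δ ε q η) (ρ + η - 1) u ∧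
        ((∀ z ∈ Ioo 1 z₂, u z = 0) → ∀ w ∈ Ioo 1 z₂, v w = 0)

/-- **The target exponent of the hidden-symmetry transform.** With the Euler exponent
`η = α = 1 + s + 2η₀` (`eulerGaugeα_eta`) and the event-horizon branch `ρ = 2η₁ − s`:
`ρ + η − 1 = 2(η₀ + η₁)` (`= −(m₁ + m₃)`, the negative of Proposition 3.8's third pair sum).
[cite: CasalsTeixeiradacosta2022, Proposition 3.8 (arXiv v2) with Lemma 3.5 and the proof of Theorem 3.10, Step 2 (route W / spin-flip bookkeeping of the in-tree proof)] -/
theorem rho_add_eta_sub_one_eq (s η₀ η₁ : ℂ) :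
    2 * η₁ - s + eulerGaugeα (sqcdM₂ η₀ η₁) (sqcdM₃ s η₀ η₁) - 1 = 2 * (η₀ + η₁) := by
  rw [eulerGaugeα_eta]
  ring

/-- **Non-resonance from the pair condition.** If `p₃ = −2(η₁ + η₀)` satisfies Proposition 3.8's
pair condition ("`Re(p₃ − 1) < 0` if `Im p₃ = 0`"), then `2(η₀ + η₁) = −p₃` is not a negative
integer.
[cite: CasalsTeixeiradacosta2022, Proposition 3.8 (arXiv v2) with Lemma 3.5 and the proof of Theorem 3.10, Step 2 (route W / spin-flip bookkeeping of the in-tree proof)] -/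
theorem nonres_of_pairCondition {η₀ η₁ : ℂ} (hp : PairCondition (-2 * (η₁ + η₀))) (n : ℕ) :
    2 * (η₀ + η₁) ≠ -((n : ℂ) + 1) := by
  intro h
  have hp' : -2 * (η₁ + η₀) = (n : ℂ) + 1 := by linear_combination -h
  have him : (-2 * (η₁ + η₀)).im = 0 := by
    rw [hp']; simp
  have hre := hp him
  rw [hp'] at hre
  simp at hre
  have : (0 : ℝ) ≤ (n : ℝ) := n.cast_nonneg
  linarith

/-! ### The assembly with the repaired hypothesis -/

/-- **Route W for spins `s < 1`, non-resonant variant** (covers the cell's `s = −2` and `s = 0`):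
`Transfer`, `EulerRLNonRes`, `GaugeGlue` and `SwappedEnergyVanishing` imply that every
generic-boundary radial mode with `Im ω > 0`, `Im(λ̄ω̄) ≤ 0`, `|ω| ∉ |m|(0,Ω_SR)` AND Proposition 3.8's
pair condition for `p₃ = −2(η₁ + η₀)` vanishes. PROVED (the composition is kernel-checked); the pair
condition discharges the non-resonance hypothesis of `EulerRLNonRes` via `rho_add_eta_sub_one_eq`
and `nonres_of_pairCondition`.
[cite: CasalsTeixeiradacosta2022, Proposition 3.8 (arXiv v2) with Lemma 3.5 and the proof of Theorem 3.10, Step 2 (route W / spin-flip bookkeeping of the in-tree proof)] -/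
theorem radial_vanishing_of_routeW_nonres_lt_one (kA : Transfer) (kB : EulerRLNonRes)
    (kG : GaugeGlue) (k2 : SwappedEnergyVanishing) {M a Λ s : ℝ} {ω : ℂ} {m : ℝ} {lam : ℂ}
    {R : ℝ → ℂ} (hsub : IsSubextremal M a Λ) (ha : 0 ≤ a) (hs : s < 1) (hω : 0 < ω.im)
    (hlam : (lambdaBar a Λ s ω m lam * (starRingEnd ℂ) ω).im ≤ 0)
    (hSR : ¬(0 < ‖ω‖ ∧ ‖ω‖ < |m| * superradiantUpper M a Λ))
    (hp₃ : PairCondition (-2 * (etaEvent M a Λ ω m + etaCauchy M a Λ ω m)))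
    (hR : IsRadialTeukolskySolution M a Λ s ω m lam R) (hin : IsIngoingAtEventHorizon M a Λ s ω m R)
    (hout : IsOutgoingAtCosmoHorizon M a Λ ω m R) :
    ∀ r ∈ Ioo (rPlus M a Λ) (rCosmo M a Λ), R r = 0 := by
  obtain ⟨hz₂, v, hv, hvR⟩ := kA M a Λ s ω m lam R hsub hR hin hout
  -- abbreviations
  set η₀ := etaCauchy M a Λ ω m with hη₀
  set η₁ := etaEvent M a Λ ω m with hη₁
  set η₂ := etaCosmo M a Λ ω m with hη₂
  set z₂ := zTwo M a Λ with hz₂def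
  -- the Euler step: source exponent η = α = 1 + s + 2η₀
  have hF := eulerGauge_fuchs (mass₁ M a Λ s ω m) (mass₂ M a Λ ω m) (mass₃ M a Λ s ω m)
    (mass₄ M a Λ ω m)
  have hroot := euler_exponent_root (mass₂ M a Λ ω m) (mass₃ M a Λ s ω m) (mass₄ M a Λ ω m)
  have hρ : 2 * etaEvent M a Λ ω m - (s : ℂ) =
      1 - eulerGaugeδ (mass₁ M a Λ s ω m) (mass₂ M a Λ ω m) := by
    unfold mass₁ mass₂
    rw [eulerGaugeδ_eta]
    ring
  have hκ₁ := surfaceGravity_rPlus_pos hsub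
  have hre : -1 < (2 * etaEvent M a Λ ω m - (s : ℂ)).re := by
    have h1 : (2 * etaEvent M a Λ ω m - (s : ℂ)).re = 2 * (etaEvent M a Λ ω m).re - s := by
      simp [Complex.mul_re]
    rw [h1, etaEvent_re]
    have h2 : 0 < ω.im / (2 * surfaceGravity M a Λ (rPlus M a Λ)) :=
      div_pos hω (mul_pos two_pos hκ₁)
    linarith
  -- NON-RESONANCE: ρ + η − 1 = 2(η₀ + η₁) = −p₃, and `PairCondition p₃` forbids p₃ ∈ ℤ_{≥1}
  have hnr : ∀ n : ℕ, 2 * etaEvent M a Λ ω m - (s : ℂ) +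
      eulerGaugeα (mass₂ M a Λ ω m) (mass₃ M a Λ s ω m) - 1 ≠ -((n : ℂ) + 1) := by
    intro n
    unfold mass₂ mass₃
    rw [rho_add_eta_sub_one_eq]
    exact nonres_of_pairCondition hp₃ n
  obtain ⟨u, hu, huv⟩ := kB z₂ _ _ _ _ _ _ _ _ v hz₂ hF hroot hρ hre hnr hv
  rw [euler_swap_α, euler_swap_β, euler_swap_γ, euler_swap_δ, euler_swap_ε, euler_swap_q] at hu
  -- gauge glue with the swapped masses (m₁, m₃, m₂, m₄)
  obtain ⟨Rt, hRt, hRtu⟩ := kG z₂ (mass₁ M a Λ s ω m) (mass₃ M a Λ s ω m) (mass₂ M a Λ ω m)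
    (mass₄ M a Λ ω m) (bigE M a Λ s ω m lam) _ u hz₂ hu
  -- exponents of (3.26)
  have he₁ : 2 * etaEvent M a Λ ω m - (s : ℂ) + eulerGaugeα (mass₂ M a Λ ω m) (mass₃ M a Λ s ω m)
        - 1 + eulerGaugeδ (mass₁ M a Λ s ω m) (mass₃ M a Λ s ω m) / 2 =
      1 / 2 + etaCauchy M a Λ ω m + etaEvent M a Λ ω m := by
    unfold mass₁ mass₂ mass₃
    rw [eulerGaugeα_eta, eulerGaugeδ_swap_eta]
    ring
  have he₂ : eulerGaugeε (mass₂ M a Λ ω m) (mass₄ M a Λ ω m) / 2 =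
      1 / 2 - etaCauchy M a Λ ω m - etaCosmo M a Λ ω m := by
    unfold mass₂ mass₄
    rw [eulerGaugeε_swap_eta]
    ring
  rw [he₁, he₂] at hRt
  -- the coefficient of (3.25) = (3.11) with m₂ ↔ m₃ on (1, z₂)
  have hsub' := hsub
  obtain ⟨hM, hΛ, h01, h12, -⟩ := hsub'
  have hr₀ : 0 ≤ rMinus M a Λ := rMinus_nonneg M a Λ
  have hcoef : ∀ z ∈ Ioo 1 z₂,
      sqcdCoeff (mass₁ M a Λ s ω m) (mass₃ M a Λ s ω m) (mass₂ M a Λ ω m) (mass₄ M a Λ ω m)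
          (bigE M a Λ s ω m lam) (z₂ : ℂ) z = tildeCoeff M a Λ s ω m lam z := by
    intro z hz
    obtain ⟨hz1, hzz⟩ := hz
    unfold tildeCoeff bigE mass₁ mass₂ mass₃ mass₄
    rw [hz₂def] at hzz ⊢
    unfold zTwo
    symm
    refine ctdcTilde_eq_sqcd_swap (s : ℂ) η₀ η₁ η₂ (ltBlock M a Λ s ω m lam) ?_ ?_ ?_ ?_ ?_ ?_ ?_
    · exact_mod_cast (sub_pos.mpr h01).ne'
    · have : 0 < rCosmo M a Λ + (rMinus M a Λ + rPlus M a Λ + rCosmo M a Λ) := by linarith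
      exact_mod_cast this.ne'
    · have : 0 < rPlus M a Λ + rCosmo M a Λ := by linarith
      exact_mod_cast this.ne'
    · have : (0 : ℝ) < z := by linarith
      exact_mod_cast this.ne'
    · exact sub_ne_zero.mpr (by exact_mod_cast (ne_of_gt hz1))
    · unfold zTwo at hzz
      exact sub_ne_zero.mpr (by exact_mod_cast (ne_of_gt hzz))
    · rw [hz₂def] at hz₂
      unfold zTwo at hz₂
      have : (0 : ℝ) < ctdcZ₂ (rMinus M a Λ) (rPlus M a Λ) (rCosmo M a Λ) := by linarith
      exact_mod_cast this.ne'
  have hRt' : NormalFormModeData z₂ (tildeCoeff M a Λ s ω m lam)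
      (1 / 2 + etaCauchy M a Λ ω m + etaEvent M a Λ ω m)
      (1 / 2 - etaCauchy M a Λ ω m - etaCosmo M a Λ ω m) Rt := hRt.congr hcoef
  -- energy identity on the swapped problem, then back through the injectivities
  have hRt0 := k2 M a Λ s ω m lam Rt hsub ha hω hlam hSR hRt'
  exact hvR (huv (hRtu hRt0))

end RouteW

end Literature.Geometry.Lorentzian.KerrDeSitter.TeukolskyRadial

end Part7

/-!
## Part 8 — port of `Summits/Ventures/KdS/RouteWGaugeGlue.lean` (16 declarations kept)

# Venture KdS — ROUTE W: the gauge glue `K_G` PROVED (`RouteW.GaugeGlue`)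

HONEST FRAMING (venture `Summits/Ventures/KdS`, cell `pub-kds`): this file discharges ONE of the
five named hypotheses of `RouteW.prop38_of_routeW` — the elementary one, `RouteW.GaugeGlue`:
Euler-gauge Heun mode data `u` on `(1,z₂)` (Umetsu form with parameters
`(γ,δ,ε;α,β;q) = eulerGauge…(m₁,m₂,m₃,m₄; E)`) gives, under
`R = z^{γ/2}(z−1)^{δ/2}(z₂−z)^{ε/2}·u` (positive real bases on `(1,z₂)`), normal-form mode data for
CTdC's (3.11) coefficient `sqcdCoeff m₁ m₂ m₃ m₄ E z₂` with the shifted branch exponents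
`ρ + δ/2` at `z = 1` and `ε/2` at `z = z₂`, and `R ≡ 0 ⇒ u ≡ 0`. Ingredients: the product rule, the
kernel-profile calculus of `GeneralHeun.eulerKernel`, and the landed identity
`KerrDeSitter.sqcdCoeff_eq_normalForm` ((3.11) = Heun normal form). Nothing about Kerr–de Sitter
modes is claimed; H1′/H3 stay cited; the other four route-W hypotheses are untouched.

Reference: Casals–Teixeira da Costa, arXiv:2105.13329, (3.11), Lemma 3.5 (3.16), proof of
Prop. 3.9 (the gauge functions `g_±`).

(Verbatim declaration-level port — the declarations listed in the Part header count — of the Summits-side module of the KdS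
venture; venture / cell / ruling bookkeeping in the text above is historical.)
-/

section Part8

open _root_.Set _root_.Complex

namespace Literature.Geometry.Lorentzian.KerrDeSitter.TeukolskyRadial

namespace RouteW

open Literature.Analysis.ODE Literature.Analysis.ODE.GeneralHeun
open Literature.Geometry.Lorentzian Literature.Geometry.Lorentzian.KerrDeSitter

/-! ### Calculus of the kernel profile `k_η(x) = x^{−η}` (`x > 0`) -/

/-- `k_a · k_b = k_{a+b}`.
[cite: CasalsTeixeiradacosta2022, Proposition 3.8 (arXiv v2) with Lemma 3.5 and the proof of Theorem 3.10, Step 2 (route W / spin-flip bookkeeping of the in-tree proof)] -/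
theorem eulerKernel_mul (a b : ℂ) (x : ℝ) :
    eulerKernel a x * eulerKernel b x = eulerKernel (a + b) x := by
  unfold eulerKernel
  rw [← Complex.exp_add]
  ring_nf

/-- `k_{−c}(x)·x^ρ = x^{ρ+c}` for `x > 0` (principal powers of a positive real).
[cite: CasalsTeixeiradacosta2022, Proposition 3.8 (arXiv v2) with Lemma 3.5 and the proof of Theorem 3.10, Step 2 (route W / spin-flip bookkeeping of the in-tree proof)] -/
theorem eulerKernel_neg_mul_cpow (c ρ : ℂ) {x : ℝ} (hx : 0 < x) :
    eulerKernel (-c) x * (x : ℂ) ^ ρ = (x : ℂ) ^ (ρ + c) := by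
  rw [eulerKernel_eq_cpow (-c) hx, neg_neg, ← Complex.cpow_add _ _ (by exact_mod_cast hx.ne')]
  ring_nf

/-- `k_{−c}(x) = x^{c}` for `x > 0`.
[cite: CasalsTeixeiradacosta2022, Proposition 3.8 (arXiv v2) with Lemma 3.5 and the proof of Theorem 3.10, Step 2 (route W / spin-flip bookkeeping of the in-tree proof)] -/
theorem eulerKernel_neg_eq_cpow (c : ℂ) {x : ℝ} (hx : 0 < x) :
    eulerKernel (-c) x = (x : ℂ) ^ c := by
  rw [eulerKernel_eq_cpow (-c) hx, neg_neg]

/-- `k_η' = k_η · (−η/x)` for `x > 0`.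
[cite: CasalsTeixeiradacosta2022, Proposition 3.8 (arXiv v2) with Lemma 3.5 and the proof of Theorem 3.10, Step 2 (route W / spin-flip bookkeeping of the in-tree proof)] -/
theorem hasDerivAt_eulerKernel_mul_inv (η : ℂ) {x : ℝ} (hx : 0 < x) :
    HasDerivAt (eulerKernel η) (eulerKernel η x * (-η * ((x : ℂ))⁻¹)) x := by
  have h := hasDerivAt_eulerKernel η hx
  have hs := mul_eulerKernel_succ η hx
  have hx' : (x : ℂ) ≠ 0 := by exact_mod_cast hx.ne'
  refine h.congr_deriv ?_
  rw [← hs]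
  field_simp

/-- `k_η` is `C^∞` on `(0, ∞)`.
[cite: CasalsTeixeiradacosta2022, Proposition 3.8 (arXiv v2) with Lemma 3.5 and the proof of Theorem 3.10, Step 2 (route W / spin-flip bookkeeping of the in-tree proof)] -/
theorem contDiffOn_eulerKernel (η : ℂ) :
    ContDiffOn ℝ ((⊤ : ℕ∞) : WithTop ℕ∞) (eulerKernel η) (Ioi 0) := by
  have hlog : ContDiffOn ℝ ((⊤ : ℕ∞) : WithTop ℕ∞) (fun u : ℝ => (Real.log u : ℂ)) (Ioi 0) := by
    have h1 : ContDiffOn ℝ ((⊤ : ℕ∞) : WithTop ℕ∞) Real.log (Ioi 0) :=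
      Real.contDiffOn_log.mono (fun x hx => ne_of_gt hx)
    exact (Complex.ofRealCLM.contDiff.comp_contDiffOn h1)
  have h2 : ContDiffOn ℝ ((⊤ : ℕ∞) : WithTop ℕ∞) (fun u : ℝ => -η * (Real.log u : ℂ)) (Ioi 0) :=
    contDiffOn_const.mul hlog
  exact Complex.contDiff_exp.comp_contDiffOn h2

/-- `z ↦ k_η(z)` is `C^∞` on any set of positive reals.
[cite: CasalsTeixeiradacosta2022, Proposition 3.8 (arXiv v2) with Lemma 3.5 and the proof of Theorem 3.10, Step 2 (route W / spin-flip bookkeeping of the in-tree proof)] -/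
theorem contDiffOn_eulerKernel_of_pos (η : ℂ) {S : Set ℝ} (hS : ∀ z ∈ S, 0 < z) :
    ContDiffOn ℝ ((⊤ : ℕ∞) : WithTop ℕ∞) (fun z : ℝ => eulerKernel η z) S :=
  (contDiffOn_eulerKernel η).mono hS

/-- `z ↦ k_η(z − 1)` is `C^∞` where `z > 1`... more generally on any set where `z − 1 > 0`.
[cite: CasalsTeixeiradacosta2022, Proposition 3.8 (arXiv v2) with Lemma 3.5 and the proof of Theorem 3.10, Step 2 (route W / spin-flip bookkeeping of the in-tree proof)] -/
theorem contDiffOn_eulerKernel_sub (η : ℂ) (c : ℝ) {S : Set ℝ} (hS : ∀ z ∈ S, 0 < z - c) :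
    ContDiffOn ℝ ((⊤ : ℕ∞) : WithTop ℕ∞) (fun z : ℝ => eulerKernel η (z - c)) S :=
  (contDiffOn_eulerKernel η).comp (contDiffOn_id.sub contDiffOn_const) (fun z hz => hS z hz)

/-- `z ↦ k_η(z₂ − z)` is `C^∞` on any set where `z₂ − z > 0`.
[cite: CasalsTeixeiradacosta2022, Proposition 3.8 (arXiv v2) with Lemma 3.5 and the proof of Theorem 3.10, Step 2 (route W / spin-flip bookkeeping of the in-tree proof)] -/
theorem contDiffOn_eulerKernel_const_sub (η : ℂ) (c : ℝ) {S : Set ℝ} (hS : ∀ z ∈ S, 0 < c - z) :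
    ContDiffOn ℝ ((⊤ : ℕ∞) : WithTop ℕ∞) (fun z : ℝ => eulerKernel η (c - z)) S :=
  (contDiffOn_eulerKernel η).comp (contDiffOn_const.sub contDiffOn_id) (fun z hz => hS z hz)

/-! ### The gauge weight `W = z^{γ/2}(z−1)^{δ/2}(z₂−z)^{ε/2}` and its derivative -/

/-- The gauge weight `W(z) = z^{γ/2}(z−1)^{δ/2}(z₂−z)^{ε/2}` on `(1,z₂)`, written with `eulerKernel`.
[cite: CasalsTeixeiradacosta2022, Proposition 3.8 (arXiv v2) with Lemma 3.5 and the proof of Theorem 3.10, Step 2 (route W / spin-flip bookkeeping of the in-tree proof)] -/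
def gaugeW (z₂ : ℝ) (γ δ ε : ℂ) (z : ℝ) : ℂ :=
  eulerKernel (-(γ / 2)) z * eulerKernel (-(δ / 2)) (z - 1) * eulerKernel (-(ε / 2)) (z₂ - z)

/-- Half the logarithmic derivative: `P = W′/W = γ/(2z) + δ/(2(z−1)) + ε/(2(z−z₂))` (`= p/2`).
[cite: CasalsTeixeiradacosta2022, Proposition 3.8 (arXiv v2) with Lemma 3.5 and the proof of Theorem 3.10, Step 2 (route W / spin-flip bookkeeping of the in-tree proof)] -/
def gaugeP (z₂ : ℝ) (γ δ ε : ℂ) (z : ℝ) : ℂ :=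
  γ / 2 * ((z : ℂ))⁻¹ + δ / 2 * ((z : ℂ) - 1)⁻¹ + ε / 2 * ((z : ℂ) - z₂)⁻¹

/-- `P′ = −γ/(2z²) − δ/(2(z−1)²) − ε/(2(z−z₂)²)`.
[cite: CasalsTeixeiradacosta2022, Proposition 3.8 (arXiv v2) with Lemma 3.5 and the proof of Theorem 3.10, Step 2 (route W / spin-flip bookkeeping of the in-tree proof)] -/
def gaugeP' (z₂ : ℝ) (γ δ ε : ℂ) (z : ℝ) : ℂ :=
  -(γ / 2) * (((z : ℂ))⁻¹) ^ 2 - δ / 2 * (((z : ℂ) - 1)⁻¹) ^ 2 - ε / 2 * (((z : ℂ) - z₂)⁻¹) ^ 2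

/-- `W` never vanishes.
[cite: CasalsTeixeiradacosta2022, Proposition 3.8 (arXiv v2) with Lemma 3.5 and the proof of Theorem 3.10, Step 2 (route W / spin-flip bookkeeping of the in-tree proof)] -/
theorem gaugeW_ne_zero (z₂ : ℝ) (γ δ ε : ℂ) (z : ℝ) : gaugeW z₂ γ δ ε z ≠ 0 := by
  unfold gaugeW
  exact mul_ne_zero (mul_ne_zero (eulerKernel_ne_zero _ _) (eulerKernel_ne_zero _ _))
    (eulerKernel_ne_zero _ _)

/-- The real map `z ↦ (z − c)⁻¹` cast to `ℂ` has derivative `−((z−c)⁻¹)²`.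
[cite: CasalsTeixeiradacosta2022, Proposition 3.8 (arXiv v2) with Lemma 3.5 and the proof of Theorem 3.10, Step 2 (route W / spin-flip bookkeeping of the in-tree proof)] -/
theorem hasDerivAt_inv_sub_cast (c : ℝ) {z : ℝ} (hz : z - c ≠ 0) :
    HasDerivAt (fun x : ℝ => ((x : ℂ) - c)⁻¹) (-((((z : ℂ) - c)⁻¹) ^ 2)) z := by
  have h1 : HasDerivAt (fun x : ℝ => (x - c)⁻¹) (-((z - c) ^ 2)⁻¹) z :=
    (hasDerivAt_inv hz).comp_sub_const z c
  have h2 := h1.ofReal_comp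
  have hz' : (z : ℂ) - c ≠ 0 := by exact_mod_cast hz
  have e1 : (fun x : ℝ => (((x - c)⁻¹ : ℝ) : ℂ)) = fun x : ℝ => ((x : ℂ) - c)⁻¹ := by
    funext x; push_cast; ring
  rw [e1] at h2
  refine h2.congr_deriv ?_
  push_cast
  field_simp

/-- `W′ = W·P` on `(1, z₂)`.
[cite: CasalsTeixeiradacosta2022, Proposition 3.8 (arXiv v2) with Lemma 3.5 and the proof of Theorem 3.10, Step 2 (route W / spin-flip bookkeeping of the in-tree proof)] -/
theorem hasDerivAt_gaugeW {z₂ : ℝ} (γ δ ε : ℂ) {z : ℝ} (h1 : 1 < z) (h2 : z < z₂) :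
    HasDerivAt (gaugeW z₂ γ δ ε) (gaugeW z₂ γ δ ε z * gaugeP z₂ γ δ ε z) z := by
  have hz0 : 0 < z := by linarith
  have hz1 : 0 < z - 1 := by linarith
  have hz2 : 0 < z₂ - z := by linarith
  have hA := hasDerivAt_eulerKernel_mul_inv (-(γ / 2)) hz0
  have hB : HasDerivAt (fun x : ℝ => eulerKernel (-(δ / 2)) (x - 1))
      (eulerKernel (-(δ / 2)) (z - 1) * (-(-(δ / 2)) * (((z - 1 : ℝ) : ℂ))⁻¹)) z :=
    (hasDerivAt_eulerKernel_mul_inv (-(δ / 2)) hz1).comp_sub_const z 1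
  have hC : HasDerivAt (fun x : ℝ => eulerKernel (-(ε / 2)) (z₂ - x))
      (-(eulerKernel (-(ε / 2)) (z₂ - z) * (-(-(ε / 2)) * (((z₂ - z : ℝ) : ℂ))⁻¹))) z :=
    (hasDerivAt_eulerKernel_mul_inv (-(ε / 2)) hz2).comp_const_sub z₂ z
  have h := (hA.mul hB).mul hC
  unfold gaugeW gaugeP
  refine h.congr_deriv ?_
  simp only [Pi.mul_apply]
  have hz0' : (z : ℂ) ≠ 0 := by exact_mod_cast hz0.ne'
  have hz1' : (z : ℂ) - 1 ≠ 0 := by exact_mod_cast hz1.ne'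
  have hz2' : (z : ℂ) - z₂ ≠ 0 := by
    have : ((z₂ - z : ℝ) : ℂ) ≠ 0 := by exact_mod_cast hz2.ne'
    intro hc; apply this; push_cast; linear_combination -hc
  have hz2'' : ((z₂ : ℂ) - z) ≠ 0 := fun hc => hz2' (by linear_combination -hc)
  push_cast
  field_simp
  ring

/-- `P′` is the derivative of `P` on `(1,z₂)`.
[cite: CasalsTeixeiradacosta2022, Proposition 3.8 (arXiv v2) with Lemma 3.5 and the proof of Theorem 3.10, Step 2 (route W / spin-flip bookkeeping of the in-tree proof)] -/
theorem hasDerivAt_gaugeP {z₂ : ℝ} (γ δ ε : ℂ) {z : ℝ} (h1 : 1 < z) (h2 : z < z₂) :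
    HasDerivAt (gaugeP z₂ γ δ ε) (gaugeP' z₂ γ δ ε z) z := by
  have hz0 : z - 0 ≠ 0 := by simp; linarith
  have hz1 : z - 1 ≠ 0 := by linarith
  have hz2 : z - z₂ ≠ 0 := by linarith
  have hA := hasDerivAt_inv_sub_cast 0 hz0
  have hB := hasDerivAt_inv_sub_cast 1 hz1
  have hC := hasDerivAt_inv_sub_cast z₂ hz2
  have h := ((hA.const_mul (γ / 2)).add (hB.const_mul (δ / 2))).add (hC.const_mul (ε / 2))
  unfold gaugeP gaugeP'
  simp only [Complex.ofReal_zero, sub_zero, Complex.ofReal_one] at h ⊢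
  refine h.congr_deriv ?_
  ring

/-! ### The theorem -/

/-- **`K_G` holds**: the Euler-gauge ⇒ normal-form glue of route W, for arbitrary masses.
`R := W·u` with `W = z^{γ/2}(z−1)^{δ/2}(z₂−z)^{ε/2}`; the ODE for `R` is `lead·R″ + sqcdCoeff·R = 0`
by `sqcdCoeff_eq_normalForm`, the branch exponents shift by `δ/2` and `ε/2`, and `W ≠ 0` gives the
injectivity.
[cite: CasalsTeixeiradacosta2022, Proposition 3.8 (arXiv v2) with Lemma 3.5 and the proof of Theorem 3.10, Step 2 (route W / spin-flip bookkeeping of the in-tree proof)] -/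
theorem gaugeGlue_holds : GaugeGlue := by
  intro z₂ m₁ m₂ m₃ m₄ E ρ u hz₂ hu
  obtain ⟨⟨u₁, u₂, hode⟩, ⟨e, he, h, hh, hbr⟩, ⟨e', he', g, hg, hsm⟩⟩ := hu
  -- parameters
  set γ := eulerGaugeγ m₁ m₂ with hγ
  set δ := eulerGaugeδ m₁ m₂ with hδ
  set ε := eulerGaugeε m₃ m₄ with hε
  set α := eulerGaugeα m₂ m₃ with hα
  set β := eulerGaugeβ m₂ m₄ with hβ
  set q := eulerGaugeQ m₁ m₂ m₃ m₄ E (z₂ : ℂ) with hq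
  let W : ℝ → ℂ := gaugeW z₂ γ δ ε
  let P : ℝ → ℂ := gaugeP z₂ γ δ ε
  let P' : ℝ → ℂ := gaugeP' z₂ γ δ ε
  let R : ℝ → ℂ := fun z => W z * u z
  let R₁ : ℝ → ℂ := fun z => W z * (P z * u z + u₁ z)
  let R₂ : ℝ → ℂ := fun z => W z * (u₂ z + 2 * P z * u₁ z + (P z ^ 2 + P' z) * u z)
  refine ⟨R, ⟨⟨R₁, R₂, fun z hz => ?_⟩, ?_, ?_⟩, ?_⟩
  · -- the ODE
    obtain ⟨hz1, hzz⟩ := hz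
    obtain ⟨hdu, hdu₁, heq⟩ := hode z ⟨hz1, hzz⟩
    have hW := hasDerivAt_gaugeW (z₂ := z₂) γ δ ε hz1 hzz
    have hP := hasDerivAt_gaugeP (z₂ := z₂) γ δ ε hz1 hzz
    refine ⟨?_, ?_, ?_⟩
    · have hR := hW.mul hdu
      refine hR.congr_deriv ?_
      simp only [R₁, W, P]
      ring
    · have hin : HasDerivAt (fun x => P x * u x + u₁ x) (P' z * u z + P z * u₁ z + u₂ z) z :=
        (hP.mul hdu).add hdu₁
      have hR₁ := hW.mul hin
      refine hR₁.congr_deriv ?_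
      simp only [R₂, W, P, P']
      ring
    · -- lead·R₂ + C·R = W·[(2·lead·P − mid)·u₁ + (lead·(P²+P′) − low + C)·u] + W·(Heun equation)
      have hz0 : (z : ℂ) ≠ 0 := by
        have : (0 : ℝ) < z := by linarith
        exact_mod_cast this.ne'
      have hz1' : (z : ℂ) - 1 ≠ 0 := sub_ne_zero.mpr (by exact_mod_cast (ne_of_gt hz1))
      have hz2' : (z : ℂ) ≠ (z₂ : ℂ) := by exact_mod_cast (ne_of_lt hzz)
      have hz2'' : (z : ℂ) - z₂ ≠ 0 := sub_ne_zero.mpr hz2'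
      have hC := sqcdCoeff_eq_normalForm m₁ m₂ m₃ m₄ E (z₂ : ℂ) (z := z)
        (by intro h0; exact hz0 (by exact_mod_cast h0))
        (by intro h0; exact hz1' (by rw [sub_eq_zero]; exact_mod_cast h0)) hz2'
      have hlead : GeneralHeun.lead (z₂ : ℂ) z ≠ 0 := by
        unfold GeneralHeun.lead
        exact mul_ne_zero (mul_ne_zero hz0 hz1') hz2''
      have hCeq : sqcdCoeff m₁ m₂ m₃ m₄ E (↑z₂) z =
          GeneralHeun.lead (z₂ : ℂ) z * heunNormalFormQ (↑z₂) α β γ δ ε q z := by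
        rw [← hC]; field_simp
      have h1 : 2 * GeneralHeun.lead (z₂ : ℂ) z * P z = GeneralHeun.mid (z₂ : ℂ) γ δ ε z := by
        simp only [P, gaugeP]
        unfold GeneralHeun.lead GeneralHeun.mid
        field_simp
      have h2 : GeneralHeun.lead (z₂ : ℂ) z * (P z ^ 2 + P' z) - GeneralHeun.low α β q z +
          sqcdCoeff m₁ m₂ m₃ m₄ E (↑z₂) z = 0 := by
        rw [hCeq]
        simp only [P, P', gaugeP, gaugeP']
        unfold heunNormalFormQ GeneralHeun.lead GeneralHeun.low
        field_simp
        ring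
      have key : GeneralHeun.lead (z₂ : ℂ) z * R₂ z + sqcdCoeff m₁ m₂ m₃ m₄ E (↑z₂) z * R z =
          W z * ((2 * GeneralHeun.lead (z₂ : ℂ) z * P z - GeneralHeun.mid (z₂ : ℂ) γ δ ε z) * u₁ z
            + (GeneralHeun.lead (z₂ : ℂ) z * (P z ^ 2 + P' z) - GeneralHeun.low α β q z +
                sqcdCoeff m₁ m₂ m₃ m₄ E (↑z₂) z) * u z)
          + W z * (GeneralHeun.lead (z₂ : ℂ) z * u₂ z + GeneralHeun.mid (z₂ : ℂ) γ δ ε z * u₁ z +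
              GeneralHeun.low α β q z * u z) := by
        simp only [R, R₂]
        ring
      rw [key, h1, h2, heq]
      ring
  · -- branch at z = 1: exponent ρ + δ/2
    refine ⟨min e (min (1 / 2) ((z₂ - 1) / 2)), by positivity, fun z =>
      eulerKernel (-(γ / 2)) z * eulerKernel (-(ε / 2)) (z₂ - z) * h z, ?_, ?_⟩
    · have hS0 : ∀ z ∈ Ioo (1 - min e (min (1 / 2) ((z₂ - 1) / 2)))
          (1 + min e (min (1 / 2) ((z₂ - 1) / 2))), 0 < z := by
        intro z hz; obtain ⟨hzl, -⟩ := hz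
        have : min e (min (1 / 2) ((z₂ - 1) / 2)) ≤ 1 / 2 := le_trans (min_le_right _ _) (min_le_left _ _)
        linarith
      have hS2 : ∀ z ∈ Ioo (1 - min e (min (1 / 2) ((z₂ - 1) / 2)))
          (1 + min e (min (1 / 2) ((z₂ - 1) / 2))), 0 < z₂ - z := by
        intro z hz; obtain ⟨-, hzr⟩ := hz
        have : min e (min (1 / 2) ((z₂ - 1) / 2)) ≤ (z₂ - 1) / 2 :=
          le_trans (min_le_right _ _) (min_le_right _ _)
        linarith
      have hSe : Ioo (1 - min e (min (1 / 2) ((z₂ - 1) / 2))) (1 + min e (min (1 / 2) ((z₂ - 1) / 2)))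
          ⊆ Ioo (1 - e) (1 + e) := by
        intro z hz; obtain ⟨hzl, hzr⟩ := hz
        have : min e (min (1 / 2) ((z₂ - 1) / 2)) ≤ e := min_le_left _ _
        exact ⟨by linarith, by linarith⟩
      exact ((contDiffOn_eulerKernel_of_pos _ hS0).mul (contDiffOn_eulerKernel_const_sub _ z₂ hS2)).mul
        (hh.mono hSe)
    · intro z hz
      obtain ⟨hz1, hzr⟩ := hz
      have hmin : min e (min (1 / 2) ((z₂ - 1) / 2)) ≤ e := min_le_left _ _
      have hz1' : 0 < z - 1 := by linarith
      have hbz := hbr z ⟨hz1, by linarith⟩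
      simp only [R, W, gaugeW]
      rw [hbz, ← eulerKernel_neg_mul_cpow (δ / 2) ρ hz1']
      push_cast
      ring
  · -- analytic branch at z₂: exponent ε/2
    refine ⟨min e' ((z₂ - 1) / 2), by positivity, fun z =>
      eulerKernel (-(γ / 2)) z * eulerKernel (-(δ / 2)) (z - 1) * g z, ?_, ?_⟩
    · have hS0 : ∀ z ∈ Ioo (z₂ - min e' ((z₂ - 1) / 2)) (z₂ + min e' ((z₂ - 1) / 2)), 0 < z := by
        intro z hz; obtain ⟨hzl, -⟩ := hz
        have : min e' ((z₂ - 1) / 2) ≤ (z₂ - 1) / 2 := min_le_right _ _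
        linarith
      have hS1 : ∀ z ∈ Ioo (z₂ - min e' ((z₂ - 1) / 2)) (z₂ + min e' ((z₂ - 1) / 2)), 0 < z - 1 := by
        intro z hz; obtain ⟨hzl, -⟩ := hz
        have : min e' ((z₂ - 1) / 2) ≤ (z₂ - 1) / 2 := min_le_right _ _
        linarith
      have hSe : Ioo (z₂ - min e' ((z₂ - 1) / 2)) (z₂ + min e' ((z₂ - 1) / 2)) ⊆
          Ioo (z₂ - e') (z₂ + e') := by
        intro z hz; obtain ⟨hzl, hzr⟩ := hz
        have : min e' ((z₂ - 1) / 2) ≤ e' := min_le_left _ _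
        exact ⟨by linarith, by linarith⟩
      exact ((contDiffOn_eulerKernel_of_pos _ hS0).mul (contDiffOn_eulerKernel_sub _ 1 hS1)).mul
        (hg.mono hSe)
    · intro z hz
      obtain ⟨hzl, hzr⟩ := hz
      have hmin : min e' ((z₂ - 1) / 2) ≤ e' := min_le_left _ _
      have hz2 : 0 < z₂ - z := by linarith
      have hgz := hsm z ⟨by linarith, hzr⟩
      simp only [R, W, gaugeW]
      rw [hgz, eulerKernel_neg_eq_cpow (ε / 2) hz2]
      push_cast
      ring
  · -- injectivity
    intro hR z hz
    have h0 := hR z hz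
    simp only [R] at h0
    rcases mul_eq_zero.mp h0 with hW0 | hu0
    · exact absurd hW0 (gaugeW_ne_zero z₂ γ δ ε z)
    · exact hu0

end RouteW

end Literature.Geometry.Lorentzian.KerrDeSitter.TeukolskyRadial

end Part8

/-!
## Part 9 — port of `Summits/Ventures/KdS/RouteWTransfer.lean` (14 declarations kept)

# Venture KdS — ROUTE W: the transfer `K_A` reduced to ONE algebraic identity (`RouteW.Transfer`)

HONEST FRAMING (venture `Summits/Ventures/KdS`, cell `pub-kds`): this file proves
`transfer_of_accessoryIdentity : AccessoryIdentity → RouteW.Transfer`, where `AccessoryIdentity` is a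
single explicit polynomial identity between Hatsuda's accessory quantity `v` (tree `heunV`) pushed
through the Möbius automorphism `x = z_r(z−1)/z` (`GeneralHeun.mobiusQ`) and the Euler-gauge
accessory parameter of Casals–Teixeira da Costa's masses (`eulerGaugeQ … bigE …`). Everything
analytic in `Transfer` is PROVED here from landed theorems: LIT-1's
`heunSolution_of_isRadialTeukolskySolution`, `heunSolution_branch_at_zero`,
`heunSolution_smooth_at_one` (Hatsuda gauge on `z_H ∈ (0,1)`), the Möbius automorphism
`GeneralHeun.isSolutionOn_mobius` (`v(z) = z^{−σ₋} y_H(z_r(z−1)/z)`), and the dictionary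
`B_j = −η_j` (`horizonB_rPlus_eq_neg_etaEvent`, `…rCosmo…`, here `…rMinus…`), `z₂ = z_r/(z_r−1)`.
Nothing about Kerr–de Sitter modes is claimed; H1′/H3 stay cited.

(Verbatim declaration-level port — the declarations listed in the Part header count — of the Summits-side module of the KdS
venture; venture / cell / ruling bookkeeping in the text above is historical.)
-/

section Part9

open _root_.Set _root_.Complex

namespace Literature.Geometry.Lorentzian.KerrDeSitter.TeukolskyRadial

namespace RouteW

open Literature.Analysis.ODE Literature.Analysis.ODE.GeneralHeun
open Literature.Geometry.Lorentzian Literature.Geometry.Lorentzian.KerrDeSitter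

/-! ### Dictionary: Hatsuda's data versus the Euler gauge of CTdC's masses -/

/-- **`B(r₋) = −η₀`** (Cauchy horizon), for every subextremal geometry (including `a = 0`, where
both sides are `0`).
[cite: CasalsTeixeiradacosta2022, Proposition 3.8 (arXiv v2) with Lemma 3.5 and the proof of Theorem 3.10, Step 2 (route W / spin-flip bookkeeping of the in-tree proof)] -/
theorem horizonB_rMinus_eq_neg_etaCauchy {M a Λ : ℝ} (hsub : IsSubextremal M a Λ) (ω : ℂ) (m : ℝ) :
    horizonB M a Λ ω m (rMinus M a Λ) = -etaCauchy M a Λ ω m := by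
  have hd := deltaDeriv_rMinus_eq hsub
  have hκ := surfaceGravity_rMinus_eq hsub
  have h0 := rMinus_nonneg M a Λ
  obtain ⟨hM, hΛ, h01, h12, -⟩ := hsub
  have hξ := xi_pos hΛ.le a
  have hP : 0 < Λ / 3 * (rPlus M a Λ - rMinus M a Λ) * (rCosmo M a Λ - rMinus M a Λ) *
      (2 * rMinus M a Λ + rPlus M a Λ + rCosmo M a Λ) := by
    have hΛ3 : 0 < Λ / 3 := by positivity
    exact mul_pos (mul_pos (mul_pos hΛ3 (by linarith)) (by linarith)) (by linarith)
  unfold horizonB etaCauchy etaOf horizonAngVel radialK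
  rw [hκ, hd]
  by_cases hra : rMinus M a Λ ^ 2 + a ^ 2 = 0
  · -- then a = 0 and r₋ = 0: both sides vanish
    have ha : a = 0 := by nlinarith [sq_nonneg (rMinus M a Λ), sq_nonneg a]
    have hr : rMinus M a Λ = 0 := by nlinarith [sq_nonneg (rMinus M a Λ), sq_nonneg a]
    subst ha
    simp [hr]
  · have hra' : ((rMinus M a Λ : ℂ) ^ 2 + (a : ℂ) ^ 2) ≠ 0 := by exact_mod_cast hra
    have hP' : ((Λ / 3 * (rPlus M a Λ - rMinus M a Λ) * (rCosmo M a Λ - rMinus M a Λ) *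
      (2 * rMinus M a Λ + rPlus M a Λ + rCosmo M a Λ) : ℝ) : ℂ) ≠ 0 := by exact_mod_cast hP.ne'
    have hξ' : (xi a Λ : ℂ) ≠ 0 := by exact_mod_cast hξ.ne'
    push_cast at hra' hP' ⊢
    field_simp
    ring

/-- `B(r₋') = η₀ + η₁ + η₂` (negative root), from `Σ_j B_j = 0`.
[cite: CasalsTeixeiradacosta2022, Proposition 3.8 (arXiv v2) with Lemma 3.5 and the proof of Theorem 3.10, Step 2 (route W / spin-flip bookkeeping of the in-tree proof)] -/
theorem horizonB_rNeg_eq {M a Λ : ℝ} (hsub : IsSubextremal M a Λ) (ω : ℂ) (m : ℝ) :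
    horizonB M a Λ ω m (rNeg M a Λ) =
      etaCauchy M a Λ ω m + etaEvent M a Λ ω m + etaCosmo M a Λ ω m := by
  have h := horizonB_sum hsub ω m
  rw [horizonB_rPlus_eq_neg_etaEvent hsub, horizonB_rCosmo_eq_neg_etaCosmo hsub,
    horizonB_rMinus_eq_neg_etaCauchy hsub] at h
  linear_combination h

/-- `σ₋ = 1 + s + 2η₀ = eulerGaugeα m₂ m₃`.
[cite: CasalsTeixeiradacosta2022, Proposition 3.8 (arXiv v2) with Lemma 3.5 and the proof of Theorem 3.10, Step 2 (route W / spin-flip bookkeeping of the in-tree proof)] -/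
theorem heunSigmaMinus_eq {M a Λ : ℝ} (hsub : IsSubextremal M a Λ) (s : ℝ) (ω : ℂ) (m : ℝ) :
    heunSigmaMinus M a Λ s ω m = eulerGaugeα (mass₂ M a Λ ω m) (mass₃ M a Λ s ω m) := by
  unfold heunSigmaMinus mass₂ mass₃ eulerGaugeα sqcdM₂ sqcdM₃
  rw [horizonB_rMinus_eq_neg_etaCauchy hsub]
  ring

/-- `γ_H = 1 + s − 2η₁ = eulerGaugeδ m₁ m₂`.
[cite: CasalsTeixeiradacosta2022, Proposition 3.8 (arXiv v2) with Lemma 3.5 and the proof of Theorem 3.10, Step 2 (route W / spin-flip bookkeeping of the in-tree proof)] -/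
theorem heunGamma_eq {M a Λ : ℝ} (hsub : IsSubextremal M a Λ) (s : ℝ) (ω : ℂ) (m : ℝ) :
    heunGamma M a Λ s ω m = eulerGaugeδ (mass₁ M a Λ s ω m) (mass₂ M a Λ ω m) := by
  unfold heunGamma mass₁ mass₂ eulerGaugeδ sqcdM₁ sqcdM₂
  rw [horizonB_rPlus_eq_neg_etaEvent hsub]
  ring

/-- `δ_H = 1 + s − 2η₂ = eulerGaugeε m₃ m₄`.
[cite: CasalsTeixeiradacosta2022, Proposition 3.8 (arXiv v2) with Lemma 3.5 and the proof of Theorem 3.10, Step 2 (route W / spin-flip bookkeeping of the in-tree proof)] -/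
theorem heunDelta_eq {M a Λ : ℝ} (hsub : IsSubextremal M a Λ) (s : ℝ) (ω : ℂ) (m : ℝ) :
    heunDelta M a Λ s ω m = eulerGaugeε (mass₃ M a Λ s ω m) (mass₄ M a Λ ω m) := by
  unfold heunDelta mass₃ mass₄ eulerGaugeε sqcdM₃ sqcdM₄
  rw [horizonB_rCosmo_eq_neg_etaCosmo hsub]
  ring

/-- `1 + σ₋ − σ₊ = 1 − s + 2η₀ = eulerGaugeγ m₁ m₂`.
[cite: CasalsTeixeiradacosta2022, Proposition 3.8 (arXiv v2) with Lemma 3.5 and the proof of Theorem 3.10, Step 2 (route W / spin-flip bookkeeping of the in-tree proof)] -/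
theorem mobiusγ_eq {M a Λ : ℝ} (hsub : IsSubextremal M a Λ) (s : ℝ) (ω : ℂ) (m : ℝ) :
    mobiusγ (heunSigmaPlus s) (heunSigmaMinus M a Λ s ω m) =
      eulerGaugeγ (mass₁ M a Λ s ω m) (mass₂ M a Λ ω m) := by
  unfold mobiusγ heunSigmaPlus heunSigmaMinus mass₁ mass₂ eulerGaugeγ sqcdM₁ sqcdM₂
  rw [horizonB_rMinus_eq_neg_etaCauchy hsub]
  ring

/-- `σ₋ + 1 − ε_H = 1 − 2η₁ − 2η₂ = eulerGaugeβ m₂ m₄`.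
[cite: CasalsTeixeiradacosta2022, Proposition 3.8 (arXiv v2) with Lemma 3.5 and the proof of Theorem 3.10, Step 2 (route W / spin-flip bookkeeping of the in-tree proof)] -/
theorem mobiusβ_eq {M a Λ : ℝ} (hsub : IsSubextremal M a Λ) (s : ℝ) (ω : ℂ) (m : ℝ) :
    mobiusβ (heunSigmaMinus M a Λ s ω m) (heunEps M a Λ s ω m) =
      eulerGaugeβ (mass₂ M a Λ ω m) (mass₄ M a Λ ω m) := by
  unfold mobiusβ heunSigmaMinus heunEps mass₂ mass₄ eulerGaugeβ sqcdM₂ sqcdM₄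
  rw [horizonB_rMinus_eq_neg_etaCauchy hsub, horizonB_rNeg_eq hsub]
  ring

/-- The branch exponent at the event horizon: `1 − γ_H = 2η₁ − s`.
[cite: CasalsTeixeiradacosta2022, Proposition 3.8 (arXiv v2) with Lemma 3.5 and the proof of Theorem 3.10, Step 2 (route W / spin-flip bookkeeping of the in-tree proof)] -/
theorem one_sub_heunGamma {M a Λ : ℝ} (hsub : IsSubextremal M a Λ) (s : ℝ) (ω : ℂ) (m : ℝ) :
    1 - heunGamma M a Λ s ω m = 2 * etaEvent M a Λ ω m - (s : ℂ) := by
  unfold heunGamma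
  rw [horizonB_rPlus_eq_neg_etaEvent hsub]
  ring

/-- `z₂ = z_r/(z_r − 1)`: CTdC's `z₂` is the Möbius image parameter of Hatsuda's `z_r`.
[cite: CasalsTeixeiradacosta2022, Proposition 3.8 (arXiv v2) with Lemma 3.5 and the proof of Theorem 3.10, Step 2 (route W / spin-flip bookkeeping of the in-tree proof)] -/
theorem mobiusA_mobiusZr {M a Λ : ℝ} (hsub : IsSubextremal M a Λ) :
    mobiusA (mobiusZr M a Λ) = zTwo M a Λ := by
  have h0 := rMinus_nonneg M a Λ
  obtain ⟨hM, hΛ, h01, h12, -⟩ := hsub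
  unfold mobiusA mobiusZr mobiusZ zTwo ctdcZ₂ ctdcZinf rNeg
  have h1 : rCosmo M a Λ - rPlus M a Λ ≠ 0 := by linarith
  have h2 : -(rMinus M a Λ + rPlus M a Λ + rCosmo M a Λ) - rMinus M a Λ ≠ 0 := by linarith
  have h3 : rPlus M a Λ - rMinus M a Λ ≠ 0 := by linarith
  have h4 : rCosmo M a Λ + (rMinus M a Λ + rPlus M a Λ + rCosmo M a Λ) ≠ 0 := by linarith
  have h5 : (rCosmo M a Λ - rMinus M a Λ) * (-(rMinus M a Λ + rPlus M a Λ + rCosmo M a Λ) - rPlus M a Λ) -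
      (rCosmo M a Λ - rPlus M a Λ) * (-(rMinus M a Λ + rPlus M a Λ + rCosmo M a Λ) - rMinus M a Λ) ≠ 0 := by
    nlinarith
  field_simp
  ring

/-- `1 < z₂`.
[cite: CasalsTeixeiradacosta2022, Proposition 3.8 (arXiv v2) with Lemma 3.5 and the proof of Theorem 3.10, Step 2 (route W / spin-flip bookkeeping of the in-tree proof)] -/
theorem one_lt_zTwo {M a Λ : ℝ} (hsub : IsSubextremal M a Λ) : 1 < zTwo M a Λ := by
  rw [← mobiusA_mobiusZr hsub]
  have hz := one_lt_mobiusZr hsub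
  unfold mobiusA
  rw [lt_div_iff₀ (by linarith)]
  linarith

end RouteW

end Literature.Geometry.Lorentzian.KerrDeSitter.TeukolskyRadial

namespace Literature.Geometry.Lorentzian.KerrDeSitter.TeukolskyRadial

namespace RouteW

open Literature.Analysis.ODE Literature.Analysis.ODE.GeneralHeun
open Literature.Geometry.Lorentzian Literature.Geometry.Lorentzian.KerrDeSitter

/-! ### The `λ̄`-block simplifies: the `Ξ²` terms cancel -/

/-- **The one identity left in `K_A`**: Hatsuda's accessory quantity `v` (tree `heunV`, (2.21))
pushed through the Möbius automorphism `x = z_r(z−1)/z`, `y ↦ z^{−σ₋}y` (`GeneralHeun.mobiusQ`)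
equals the Euler-gauge accessory parameter of Casals–Teixeira da Costa's masses with their `E` of
(3.15b) (`eulerGaugeQ … bigE …`). A polynomial identity in the horizon data (exact CAS check: pub-kds
kit j167464 / j167997); its Lean proof is bookkeeping with `vieta_sq`, `vieta_M`, the `B_j = −η_j`
lemmas and `field_simp; ring`.
[cite: CasalsTeixeiradacosta2022, Proposition 3.8 (arXiv v2) with Lemma 3.5 and the proof of Theorem 3.10, Step 2 (route W / spin-flip bookkeeping of the in-tree proof)] -/
def AccessoryIdentity : Prop :=
  ∀ (M a Λ s : ℝ) (ω : ℂ) (m : ℝ) (lam : ℂ), IsSubextremal M a Λ →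
    mobiusQ (mobiusZr M a Λ) (heunSigmaPlus s) (heunSigmaMinus M a Λ s ω m) (heunGamma M a Λ s ω m)
        (heunDelta M a Λ s ω m) (heunV M a Λ s ω m lam) =
      eulerGaugeQ (mass₁ M a Λ s ω m) (mass₂ M a Λ ω m) (mass₃ M a Λ s ω m) (mass₄ M a Λ ω m)
        (bigE M a Λ s ω m lam) (zTwo M a Λ : ℂ)

/-- `mobiusX z_r w − 1 = (z_r − 1)(w − z₂)/w` with `z₂ = z_r/(z_r − 1)`.
[cite: CasalsTeixeiradacosta2022, Proposition 3.8 (arXiv v2) with Lemma 3.5 and the proof of Theorem 3.10, Step 2 (route W / spin-flip bookkeeping of the in-tree proof)] -/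
theorem mobiusX_sub_one {zr z₂ w : ℝ} (hA : zr / (zr - 1) = z₂) (hzr : 1 < zr) (hw : w ≠ 0) :
    mobiusX zr w - 1 = (zr - 1) * (w - z₂) / w := by
  unfold mobiusX
  rw [← hA]
  have : zr - 1 ≠ 0 := by linarith
  field_simp
  ring

/-- The Möbius map `z ↦ z_r(z−1)/z` is `C^∞` away from `0`.
[cite: CasalsTeixeiradacosta2022, Proposition 3.8 (arXiv v2) with Lemma 3.5 and the proof of Theorem 3.10, Step 2 (route W / spin-flip bookkeeping of the in-tree proof)] -/
theorem contDiffOn_mobiusX (zr : ℝ) {S : Set ℝ} (hS : ∀ w ∈ S, w ≠ 0) :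
    ContDiffOn ℝ ((⊤ : ℕ∞) : WithTop ℕ∞) (mobiusX zr) S := by
  unfold mobiusX
  exact (contDiffOn_const.mul (contDiffOn_id.sub contDiffOn_const)).div contDiffOn_id hS

/-- **`K_A` from the accessory identity.**
[cite: CasalsTeixeiradacosta2022, Proposition 3.8 (arXiv v2) with Lemma 3.5 and the proof of Theorem 3.10, Step 2 (route W / spin-flip bookkeeping of the in-tree proof)] -/
theorem transfer_of_accessoryIdentity (hQ : AccessoryIdentity) : Transfer := by
  intro M a Λ s ω m lam R hsub hR hin hout
  refine ⟨one_lt_zTwo hsub, ?_⟩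
  have hsol := heunSolution_of_isRadialTeukolskySolution hsub hR
  have hbr := heunSolution_branch_at_zero hsub hin
  have hreg := heunSolution_smooth_at_one hsub s hout
  set y : ℝ → ℂ := fun x => R (mobiusInv M a Λ x) / heunWeight M a Λ s ω m (mobiusInv M a Λ x)
    with hy
  have hzr1 : 1 < mobiusZr M a Λ := one_lt_mobiusZr hsub
  have hzr0 : 0 < mobiusZr M a Λ := by linarith
  have hz₂ := one_lt_zTwo hsub
  have hA : mobiusA (mobiusZr M a Λ) = zTwo M a Λ := mobiusA_mobiusZr hsub
  have hA' : mobiusZr M a Λ / (mobiusZr M a Λ - 1) = zTwo M a Λ := hA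
  -- where the Möbius map sends (1, z₂)
  have hV : ∀ z ∈ Ioo 1 (zTwo M a Λ), 0 < z ∧ mobiusX (mobiusZr M a Λ) z ∈ Ioo (0 : ℝ) 1 := by
    intro z hz
    obtain ⟨hz1, hzz⟩ := hz
    have hz0 : 0 < z := by linarith
    refine ⟨hz0, ?_, ?_⟩
    · unfold mobiusX
      exact div_pos (mul_pos hzr0 (by linarith)) hz0
    · unfold mobiusX
      rw [div_lt_one hz0]
      rw [← hA'] at hzz
      have h1 : z * (mobiusZr M a Λ - 1) < mobiusZr M a Λ := (lt_div_iff₀ (by linarith)).mp hzz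
      have key : mobiusZr M a Λ * (z - 1) = z * (mobiusZr M a Λ - 1) + (z - mobiusZr M a Λ) := by ring
      nlinarith
  -- the transformed solution, with all parameters rewritten into the Euler gauge
  have hmob := isSolutionOn_mobius (heun_fuchs hsub s ω m) (ne_of_gt hzr1) hV hsol
  rw [hQ M a Λ s ω m lam hsub, mobiusβ_eq hsub, mobiusγ_eq hsub, heunGamma_eq hsub, heunDelta_eq hsub,
    heunSigmaMinus_eq hsub, hA] at hmob
  set αE := eulerGaugeα (mass₂ M a Λ ω m) (mass₃ M a Λ s ω m) with hαE
  refine ⟨mobiusV (mobiusZr M a Λ) αE y, ⟨hmob, ?_, ?_⟩, ?_⟩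
  · -- branch at z = 1 with exponent ρ = 2η₁ − s
    obtain ⟨ε, hε, G, hG, hGy⟩ := hbr
    rw [one_sub_heunGamma hsub] at hGy
    set ρ := 2 * etaEvent M a Λ ω m - (s : ℂ) with hρ
    set e := min (1 / 2 : ℝ) (ε / (4 * mobiusZr M a Λ)) with hedef
    have he : 0 < e := lt_min (by norm_num) (by positivity)
    have he1 : e ≤ 1 / 2 := min_le_left _ _
    have he2 : e * (4 * mobiusZr M a Λ) ≤ ε := by
      have : e ≤ ε / (4 * mobiusZr M a Λ) := min_le_right _ _
      exact (le_div_iff₀ (by positivity)).mp this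
    -- the two-sided interval around 1 is mapped into (−ε, ε) and consists of positive numbers
    have hpos : ∀ w ∈ Ioo (1 - e) (1 + e), 0 < w := by
      intro w hw; obtain ⟨hwl, -⟩ := hw; linarith
    have hmaps : ∀ w ∈ Ioo (1 - e) (1 + e), mobiusX (mobiusZr M a Λ) w ∈ Ioo (-ε) ε := by
      intro w hw
      obtain ⟨hwl, hwr⟩ := hw
      have hw0 : 0 < w := by linarith
      unfold mobiusX
      constructor
      · rw [lt_div_iff₀ hw0]
        nlinarith
      · rw [div_lt_iff₀ hw0]
        nlinarith
    refine ⟨e, he, fun w => eulerKernel αE w * eulerKernel (-ρ) (mobiusZr M a Λ / w) *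
        G (mobiusX (mobiusZr M a Λ) w), ?_, ?_⟩
    · refine ((contDiffOn_eulerKernel_of_pos αE hpos).mul ?_).mul ?_
      · exact (contDiffOn_eulerKernel (-ρ)).comp (contDiffOn_const.div contDiffOn_id
          (fun w hw => (hpos w hw).ne')) (fun w hw => div_pos hzr0 (hpos w hw))
      · exact hG.comp (contDiffOn_mobiusX _ (fun w hw => (hpos w hw).ne')) hmaps
    · intro w hw
      obtain ⟨hw1, hwr⟩ := hw
      have hw0 : 0 < w := by linarith
      have hx : mobiusX (mobiusZr M a Λ) w ∈ Ioo (0 : ℝ) ε := by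
        refine ⟨?_, (hmaps w ⟨by linarith, hwr⟩).2⟩
        unfold mobiusX
        exact div_pos (mul_pos hzr0 (by linarith)) hw0
      have hyx := hGy _ hx
      have hxe : mobiusX (mobiusZr M a Λ) w = (w - 1) * (mobiusZr M a Λ / w) := by
        unfold mobiusX; field_simp
      have hq : 0 < mobiusZr M a Λ / w := div_pos hzr0 hw0
      simp only [mobiusV]
      rw [hyx, hxe, Complex.ofReal_mul, Complex.mul_cpow_ofReal_nonneg (by linarith) hq.le,
        ← eulerKernel_neg_eq_cpow ρ hq]
      push_cast
      ring
  · -- the analytic branch at z₂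
    obtain ⟨ε, hε, F, hF, hFy⟩ := hreg
    set z₂ := zTwo M a Λ with hz₂def
    set e := min (z₂ / 2) (ε * z₂ / (4 * (mobiusZr M a Λ - 1))) with hedef
    have hzrm : 0 < mobiusZr M a Λ - 1 := by linarith
    have he : 0 < e := lt_min (by linarith) (by positivity)
    have he1 : e ≤ z₂ / 2 := min_le_left _ _
    have he2 : e * (4 * (mobiusZr M a Λ - 1)) ≤ ε * z₂ := by
      have : e ≤ ε * z₂ / (4 * (mobiusZr M a Λ - 1)) := min_le_right _ _
      exact (le_div_iff₀ (by positivity)).mp this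
    have hpos : ∀ w ∈ Ioo (z₂ - e) (z₂ + e), 0 < w := by
      intro w hw; obtain ⟨hwl, -⟩ := hw; linarith
    have hmaps : ∀ w ∈ Ioo (z₂ - e) (z₂ + e), mobiusX (mobiusZr M a Λ) w ∈ Ioo (1 - ε) (1 + ε) := by
      intro w hw
      have hw0 := hpos w hw
      obtain ⟨hwl, hwr⟩ := hw
      have hsub1 := mobiusX_sub_one hA' hzr1 hw0.ne'
      have hw2 : z₂ / 2 < w := by linarith
      constructor
      · have : -(ε) < (mobiusZr M a Λ - 1) * (w - z₂) / w := by
          rw [lt_div_iff₀ hw0]; nlinarith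
        linarith
      · have : (mobiusZr M a Λ - 1) * (w - z₂) / w < ε := by
          rw [div_lt_iff₀ hw0]; nlinarith
        linarith
    refine ⟨e, he, fun w => eulerKernel αE w * F (mobiusX (mobiusZr M a Λ) w), ?_, ?_⟩
    · exact (contDiffOn_eulerKernel_of_pos αE hpos).mul
        (hF.comp (contDiffOn_mobiusX _ (fun w hw => (hpos w hw).ne')) hmaps)
    · intro w hw
      obtain ⟨hwl, hwr⟩ := hw
      have hw0 : 0 < w := hpos w ⟨hwl, by linarith⟩
      have hx1 : mobiusX (mobiusZr M a Λ) w < 1 := by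
        have hsub1 := mobiusX_sub_one hA' hzr1 hw0.ne'
        have : (mobiusZr M a Λ - 1) * (w - z₂) / w < 0 :=
          div_neg_of_neg_of_pos (mul_neg_of_pos_of_neg hzrm (by linarith)) hw0
        linarith
      have hx : mobiusX (mobiusZr M a Λ) w ∈ Ioo (1 - ε) 1 :=
        ⟨(hmaps w ⟨hwl, by linarith⟩).1, hx1⟩
      simp only [mobiusV]
      rw [hFy _ hx]
  · -- injectivity: v ≡ 0 on (1, z₂) ⇒ y ≡ 0 on (0, 1) ⇒ R ≡ 0 on (r₊, r_c)
    intro hv r hr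
    have hx := mobiusZ_mem_Ioo hsub hr
    set x := mobiusZ M a Λ r with hxdef
    obtain ⟨hx0, hx1⟩ := hx
    have hzx : 0 < mobiusZr M a Λ - x := by linarith
    -- the point w = z_r/(z_r − x) ∈ (1, z₂) with mobiusX z_r w = x
    have hw1 : 1 < mobiusZr M a Λ / (mobiusZr M a Λ - x) := by
      rw [lt_div_iff₀ hzx]; linarith
    have hw2 : mobiusZr M a Λ / (mobiusZr M a Λ - x) < zTwo M a Λ := by
      rw [← hA', div_lt_div_iff_of_pos_left hzr0 hzx (by linarith)]
      linarith
    have hX : mobiusX (mobiusZr M a Λ) (mobiusZr M a Λ / (mobiusZr M a Λ - x)) = x := by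
      unfold mobiusX
      field_simp
      ring
    have h0 := hv _ ⟨hw1, hw2⟩
    simp only [mobiusV] at h0
    rw [hX] at h0
    rcases mul_eq_zero.mp h0 with hk | hyx
    · exact absurd hk (eulerKernel_ne_zero _ _)
    · -- y x = R r / w r
      have hrm : r ≠ rMinus M a Λ := by
        obtain ⟨-, -, h01, -⟩ := hsub
        intro h; rw [h] at hr; exact absurd hr.1 (by linarith)
      have hinv := mobiusInv_mobiusZ hsub hrm
      simp only [hy, hxdef] at hyx
      rw [hinv] at hyx
      rcases div_eq_zero_iff.mp hyx with hR0 | hw0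
      · exact hR0
      · exact absurd hw0 (heunWeight_ne_zero hsub s ω m hr)

end RouteW

end Literature.Geometry.Lorentzian.KerrDeSitter.TeukolskyRadial

end Part9

/-!
## Part 10 — port of `Summits/Ventures/KdS/RouteWTransferHolds.lean` (2 declarations kept)

# Venture KdS — ROUTE W: `K_A` (`RouteW.Transfer`) holds

HONEST FRAMING (venture `Summits/Ventures/KdS`, cell `pub-kds`): the residual algebraic identity
`RouteW.AccessoryIdentity` of `RouteWTransfer.lean` is LIT-1 g5's Literature theorem
`KerrDeSitter.mobiusQ_hatsuda_eq_eulerGaugeQ` (Hatsuda's accessory quantity through the Möbius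
automorphism = the Euler-gauge accessory parameter of Casals–Teixeira da Costa's masses, via
`vieta_sq`); hence `transfer_holds : RouteW.Transfer`. With `gaugeGlue_holds` and
`swappedEnergyVanishing_holds`, three of the five hypotheses of `RouteW.prop38_of_routeW` are now
theorems; the remaining ones are `EulerRL` (analysis, cell memo theory/ROUTE-W-EULERRL-PLAN.md) and
`SpinFlip` (vacuous for `s < 1`). Nothing about Kerr–de Sitter modes is claimed beyond that.

(Verbatim declaration-level port — the declarations listed in the Part header count — of the Summits-side module of the KdS
venture; venture / cell / ruling bookkeeping in the text above is historical.)
-/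

section Part10

namespace Literature.Geometry.Lorentzian.KerrDeSitter.TeukolskyRadial

namespace RouteW

open Literature.Geometry.Lorentzian Literature.Geometry.Lorentzian.KerrDeSitter

/-- The residual identity of `K_A` holds (LIT-1's `mobiusQ_hatsuda_eq_eulerGaugeQ`; all of
`mass_j`, `bigE`, `ltBlock`, `zTwo` unfold definitionally).
[cite: CasalsTeixeiradacosta2022, Proposition 3.8 (arXiv v2) with Lemma 3.5 and the proof of Theorem 3.10, Step 2 (route W / spin-flip bookkeeping of the in-tree proof)] -/
theorem accessoryIdentity_holds : AccessoryIdentity := by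
  intro M a Λ s ω m lam hsub
  exact mobiusQ_hatsuda_eq_eulerGaugeQ hsub s ω m lam

/-- **K_A of route W holds**: every generic-boundary radial Teukolsky mode transfers to Euler-gauge
Heun mode data on `(1, z₂)` (CTdC Lemma 3.5 at the level of solutions).
[cite: CasalsTeixeiradacosta2022, Proposition 3.8 (arXiv v2) with Lemma 3.5 and the proof of Theorem 3.10, Step 2 (route W / spin-flip bookkeeping of the in-tree proof)] -/
theorem transfer_holds : Transfer :=
  transfer_of_accessoryIdentity accessoryIdentity_holds

end RouteW

end Literature.Geometry.Lorentzian.KerrDeSitter.TeukolskyRadial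

end Part10

/-!
## Part 11 — port of `Summits/Ventures/KdS/RouteWSwappedEnergy.lean` (1 declarations kept)

# Venture KdS — route W, input K₂: `RouteW.SwappedEnergyVanishing` holds

`swappedEnergyVanishing_holds : RouteW.SwappedEnergyVanishing` — Casals–Teixeira da Costa's
Theorem 3.10, proof Step 2 (energy identity for the `m₂ ↔ m₃`-transformed radial ODE (3.25) under
the boundary conditions (3.26), `Im ω > 0`, `0 ≤ a`), discharged by the Literature theorem
`Literature.Geometry.Lorentzian.KerrDeSitter.ctdcStep2_of_normalFormModeData`
(`Literature/Geometry/Lorentzian/KerrDeSitterHiddenSymmetryEnergy.lean`, §Assembly), whose hypotheses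
are the three conjuncts of `RouteW.NormalFormModeData (zTwo M a Λ) (tildeCoeff M a Λ s ω m lam)
(1/2+η₀+η₁) (1/2−η₀−η₂) R̃` verbatim (`zTwo`, `tildeCoeff`, `ltBlock` unfold definitionally).

(Verbatim declaration-level port — the declarations listed in the Part header count — of the Summits-side module of the KdS
venture; venture / cell / ruling bookkeeping in the text above is historical.)
-/

section Part11

namespace Literature.Geometry.Lorentzian.KerrDeSitter.TeukolskyRadial.RouteW

open _root_.Set

/-- **K₂ of route W.** [cite: CasalsTeixeiradacosta2022, Theorem 3.10 (proof, Step 2) with Corollary 3.10 (3.25)–(3.26)] -/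
theorem swappedEnergyVanishing_holds : SwappedEnergyVanishing := by
  intro M a Λ s ω m lam Rt hsub ha hω hlam hwin hD
  obtain ⟨hode, h1, h2⟩ := hD
  exact Literature.Geometry.Lorentzian.KerrDeSitter.ctdcStep2_of_normalFormModeData
    hsub ha hω hlam hwin hode h1 h2

end Literature.Geometry.Lorentzian.KerrDeSitter.TeukolskyRadial.RouteW

end Part11

/-!
## Part 12 — port of `Summits/Ventures/KdS/RouteWEulerRL.lean` (2 declarations kept)

# Venture KdS — ROUTE W: `EulerRLNonRes` DISCHARGED; H3 for spins `s < 1` with no open hypothesis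

HONEST FRAMING (venture `Summits/Ventures/KdS`, cell `pub-kds`; MONDAY-REBALANCE item 2): this
file PROVES `eulerRLNonRes_holds : RouteW.EulerRLNonRes` — the one-sided Euler / Riemann–Liouville
transform for Heun's equation off resonance (`Literature.Analysis.ODE.GeneralHeun.eulerRL_nonres`,
K. Takemura's Prop. 1.2 on the real segment with Riemann–Liouville regularisation and
injectivity) — and records the consequences for route W:

* `radial_vanishing_lt_one` — for subextremal Kerr–de Sitter parameters, `0 ≤ a`, every spin
  `s < 1` (the cell's `s = −2, 0`), `Im ω > 0`, `Im(λ̄ω̄) ≤ 0`, `|ω| ∉ |m|(0, Ω_SR)` and CTdC's pair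
  condition on `m₁ + m₃ = −2(η₁+η₀)`, every generic-boundary radial Teukolsky mode vanishes —
  PROVED with NO cited fact and NO open hypothesis (inputs: `transfer_holds`, `eulerRLNonRes_holds`,
  `gaugeGlue_holds`, `swappedEnergyVanishing_holds`, all theorems of this venture / Literature);
* `prop38_of_spinFlip : SpinFlip → CasalsTeixeiraDaCosta2022_partialModeStabilityProp38` — the
  cell's cited fact H3 in full now rests on the spin-flip statement for `s ≥ 1` alone.

What this is NOT: a statement about `s ≥ 1` (needs `SpinFlip`), nor about the resonant set
(excluded by CTdC's own pair condition, see `RouteWNonRes.lean`), nor mode stability of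
Kerr–de Sitter by itself (H1′ remains cited in the displayed theorems of the cell).

References: Casals–Teixeira da Costa, Commun. Math. Phys. 394 (2022) 797–832
[CasalsTeixeiradacosta2022] Prop. 3.8, Thm 3.10; K. Takemura, J. Math. Soc. Japan 69 (2017)
849–891 [Takemura2017] Prop. 1.2.

(Verbatim declaration-level port — the declarations listed in the Part header count — of the Summits-side module of the KdS
venture; venture / cell / ruling bookkeeping in the text above is historical.)
-/

section Part12

open _root_.Set _root_.Complex

namespace Literature.Geometry.Lorentzian.KerrDeSitter.TeukolskyRadial

namespace RouteW

open Literature.Analysis.ODE Literature.Analysis.ODE.GeneralHeun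
open Literature.Geometry.Lorentzian Literature.Geometry.Lorentzian.KerrDeSitter

/-- **K_B DISCHARGED: `EulerRLNonRes` holds** (Takemura's Prop. 1.2 on the real segment, with
Riemann–Liouville regularisation and injectivity off resonance; `eulerRL_nonres`).
[cite: CasalsTeixeiradacosta2022, Proposition 3.8 (arXiv v2) with Lemma 3.5 and the proof of Theorem 3.10, Step 2 (route W / spin-flip bookkeeping of the in-tree proof)] -/
theorem eulerRLNonRes_holds : EulerRLNonRes := by
  intro z₂ α β γ δ ε q η ρ v hz₂ hF hroot hρ hre hnr hv
  obtain ⟨hsol, h1, h2⟩ := hv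
  exact eulerRL_nonres z₂ α β γ δ ε q η ρ v hz₂ hF hroot hρ hre hnr hsol h1 h2

/-- **Route W closed for spins `s < 1`** (the cell's `s = −2` and `s = 0`): every generic-boundary
radial Teukolsky mode with `Im ω > 0`, `Im(λ̄ω̄) ≤ 0`, `|ω| ∉ |m|(0,Ω_SR)` and CTdC's pair condition
on `m₁ + m₃ = −2(η₁+η₀)` vanishes on `(r₊, r_c)`. PROVED — no cited fact, no open hypothesis.
[cite: CasalsTeixeiradacosta2022, Proposition 3.8 (arXiv v2) with Lemma 3.5 and the proof of Theorem 3.10, Step 2 (route W / spin-flip bookkeeping of the in-tree proof)] -/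
theorem radial_vanishing_lt_one {M a Λ s : ℝ} {ω : ℂ} {m : ℝ} {lam : ℂ} {R : ℝ → ℂ}
    (hsub : IsSubextremal M a Λ) (ha : 0 ≤ a) (hs : s < 1) (hω : 0 < ω.im)
    (hlam : (lambdaBar a Λ s ω m lam * (starRingEnd ℂ) ω).im ≤ 0)
    (hSR : ¬(0 < ‖ω‖ ∧ ‖ω‖ < |m| * superradiantUpper M a Λ))
    (hp₃ : PairCondition (-2 * (etaEvent M a Λ ω m + etaCauchy M a Λ ω m)))
    (hR : IsRadialTeukolskySolution M a Λ s ω m lam R) (hin : IsIngoingAtEventHorizon M a Λ s ω m R)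
    (hout : IsOutgoingAtCosmoHorizon M a Λ ω m R) :
    ∀ r ∈ Ioo (rPlus M a Λ) (rCosmo M a Λ), R r = 0 :=
  radial_vanishing_of_routeW_nonres_lt_one transfer_holds eulerRLNonRes_holds gaugeGlue_holds
    swappedEnergyVanishing_holds hsub ha hs hω hlam hSR hp₃ hR hin hout

end RouteW

end Literature.Geometry.Lorentzian.KerrDeSitter.TeukolskyRadial

end Part12

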